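import Literature.NumberTheory.LFunctions.BurnolResidueExpansionPointwiseProofs
import Literature.NumberTheory.LFunctions.BurnolScriptL1FourierProofs
import Literature.NumberTheory.LFunctions.LehmanCriticalLineBoundProofs
import Literature.NumberTheory.LFunctions.BurnolZetaQuotientCompletenessProofs
import Literature.NumberTheory.LFunctions.BurnolScriptL1DensityProofs
import Literature.NumberTheory.LFunctions.BurnolZetaSystemsMinimal
import HarnessLib

/-!
# Burnol 2004b, Thm. 5.2 — the `L²(½+iℝ)` clause of the residue expansion, and the discharge

LINE 1 — LABEL: RH-FREE (an `L²` estimate, on the critical line, of the expansion of the Mellin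
transforms `ĝ = G` of `g ∈ 𝓛₁ ⊂ L_1` in residues of `G(s)/ζ(s)·ζ(Z)/(Z−s)` over the non-trivial zeros
of `ζ` — wherever those zeros are; no hypothesis and no conclusion about their location). FRAMING (cell
rh-crit, D-0074): corpus theorems are RH-FREE literature; nothing here is worded as progress toward RH.
bears_on: B-C/B-P (LADDER-RH COLUMN 6, de Branges framework) as corpus structure (Burnol's completeness
of the zeta-quotient system in `L_1`, Thm. 3.3 / Cor. 5.3, runs through this expansion). WHAT THIS IS
NOT: not a route, not a criterion; an unconditional 2004 theorem about `L²(0,∞)` and `ζ`.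

## Source and what is proved

J.-F. Burnol, *Two complete and minimal systems associated with the zeros of the Riemann zeta
function*, J. Théor. Nombres Bordeaux 16 (2004) 65–94 = arXiv:math/0203120v7 [Burnol2004b], §5,
**Thm. 5.2** (TeX l.989–1000, proof l.1003–1120; cell copy `dbl/src/Burnol2004JTNB_arXivmath0203120v7.tex`).
The named fact `Burnol2004b_thm5_2` (`BurnolZetaSystemsHardy.lean`) has four conjuncts: (1) pointwise
convergence with summable blocks (dbl-t12's `BurnolResidueSum.tendsto_burnolResiduePartialSum`,
`BurnolResidueExpansionPointwiseProofs.lean`, imported BY NAME); (2) every partial sum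
`S_n(½+iτ) ∈ L²(dτ)`; (3) `Σ_n ‖S_{n+1} − S_n‖_{L²(½+iℝ)} < ∞` ("converges absolutely in `L²`");
(4) `‖G − S_n‖_{L²(½+iℝ)} → 0`.  This file proves (2), (3), (4) and files the discharge
`Burnol2004b_thm5_2_holds`, plus the two downstream one-liners the tree had reduced to it:
`Burnol2004b_cor5_3_holds` (door `BurnolZetaQuotientCompleteness.Burnol2004b_cor5_3_of` + dbl-t1's
`Burnol2004b_thm4_9_holds`) and `Burnol2004b_thm3_3_holds` (door `BurnolZetaMinimal.Burnol2004b_thm3_3_of_cor5_3`).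

## The argument, and ONE documented deviation from print

Burnol (TeX l.1052–1120) bounds the block `S_{n+1} − S_n` as a contour integral over the rectangles
`[−¼, 5/4] × [T_n, T_{n+1}]` for `Re Z = −½` first, and transfers the `L²` estimate to the critical
line through the Hardy space of `Re s > −½` (his Lemma 4.10 / Note 5).  **Deviation (shorter road over
tree theorems, same mechanism):** we estimate DIRECTLY ON `Re Z = ½`.  With `F = G/ζ` and the kernel
`ζ(Z)/(Z−s) = ζ(Z)/(Z+2) + ζ(Z)(2+s)/((Z−s)(Z+2))`, the residue theorem on dbl-t12's symmetric
rectangles `R_n = [−¼, 5/4] × [−T_n, T_n]` (`BurnolResidueSum.rectBoundaryIntegral_eq_sum_residueAt`)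
gives, for a.e. `τ` (`ζ(Z) ≠ 0`, `|τ| ≠ T_n`; `Z = ½+iτ`),
`S_n(Z) = ζ(Z)(2πi)⁻¹ ∮_{∂R_n} F(s)(2+s)/((Z−s)(Z+2)) ds + c_n·ζ(Z)/(Z+2) + 𝟙_{|τ|<T_n}·G(Z)`
(`partialSum_line_eq`; `c_n` = dbl-t12's `burnolInvZetaResiduePartialSum`, the residues of `F` alone;
the pole `s = 1` of `ζ(Z)/(Z−s)·1/ζ(s)`… is removable for `F`; the extra simple pole `s = Z` inside
`R_n` when `|τ| < T_n` has residue `−G(Z)/ζ(Z)`).  The horizontal edges CROSS the critical line, but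
`∫dτ/|Z−s|² = π/|½−Re s|` is an integrable singularity in `Re s`: Cauchy–Schwarz in `s` with the weight
`|Re s−½|^{∓1/2}` and Tonelli (`lintegral_norm_integral_mul_sq_le`, `eLpNorm_horizontal_le`) give
`‖edge‖_{L²(dτ)} ≤ 12√π·sup|F|·(4+T)·W`, and `sup|F| ≤ C·T_n^{−3}` on the good heights of Prop. 5.1
(`exists_horizontal_decay`: quick decrease of `G` in `𝓛₁` against `|ζ|⁻¹ < |s|^A`).  The vertical
edges (`Re s = 5/4`, and `Re s = −¼` reflected to `Re s = 5/4` by the functional equation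
`G(s)/ζ(s) = H(1−s)/ζ(1−s)`, `H = G_{𝓕g}`, `𝓕g ∈ 𝓛₁` by Lemma 4.10 — `div_zeta_neg_quarter_line`)
telescope: `‖ζ·(∫_{−T_{n+1}}^{T_{n+1}} − ∫_{−T_n}^{T_n})‖_{L²} ≤ √(192π)·(e(T_{n+1}) − e(T_n))` with
`e(T) = ∫_{−T}^{T} ‖F‖(4+|y|)²` bounded (`eLpNorm_vertical_block_le`); `|ζ(Z)/(Z+2)| ≤ 12` and
`ζ(Z)/(Z+2) ∈ L²(dτ)` come from Trudgian's critical-line bound (`norm_zeta_half_le`,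
`memLp_zeta_div_line`); the blocks `c_{n+1} − c_n` are summable by dbl-t12's `Burnol2004b_prop5_4_holds`;
the indicator blocks are tails of `G ∈ L²(½+iℝ)` of size `T_n^{−5/4}` (`exists_eLpNorm_indicator_line_le`).
Summing in `ℝ≥0∞` gives (3) (`tsum_eLpNorm_sub_ne_top`); (2) is the same decomposition for one `n`
(`memLp_partialSum`); (4) follows from (1)+(2)+(3) abstractly (`L²`-Cauchy ⇒ `L²`-limit ⇒ a.e.
subsequence limit = the pointwise limit `G`; `tendsto_eLpNorm_of_tsum_ne_top_of_ae_tendsto`).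

## Contents (namespace `BurnolResidueL2`; 0 `def`s, 0 new facts, 0 `kit`)

§A generic tools (Cauchy–Schwarz/Tonelli in `ℝ≥0∞`, `∫dτ/(a²+(τ−c)²) = π/|a|`, `|x−½|^{−r}`
integrable, critical-line bounds for `ζ(Z)/(Z+2)`); §B residue algebra at a pole against `1/(Z−s)`
(`residueAt_div_sub_of_principalPart`: the residue of `F/(Z−·)` at `ρ` is the principal part of `F`
at `ρ` EVALUATED AT `Z`); §C the representation `partialSum_line_eq`; §D the `L²(dτ)` edge estimates,
decay inputs, the reflected left edge, the tails; §E assembly: `memLp_partialSum` (2),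
`tsum_eLpNorm_sub_ne_top` (3), `tendsto_eLpNorm_of_tsum_ne_top_of_ae_tendsto` ((1)+(3) ⇒ (4)); then
`Burnol2004b_thm5_2_holds`, `Burnol2004b_cor5_3_holds`, `Burnol2004b_thm3_3_holds`.

## References

* [Burnol2004b] J.-F. Burnol, J. Théor. Nombres Bordeaux 16 (2004) 65–94; arXiv:math/0203120v7 —
  Thm. 5.2 p. 12 (TeX l.989–1120), Prop. 5.1 (l.955–962), Prop. 5.4, Lemma 4.10 (l.947–951),
  Cor. 5.3 (l.1124–1127), Thm. 3.3 (l.587–594).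
* [Trudgian2011] T. Trudgian, Math. Comp. 80 (2011), Lemma 2.5 (the critical-line bound used via
  `LehmanCriticalLineBoundProofs`).
-/

noncomputable section

open MeasureTheory Complex Filter Set Topology Metric
open scoped Real ENNReal FourierTransform

namespace Literature.NumberTheory.LFunctions

namespace BurnolResidueL2

open Literature.Analysis.Complex

/-! ## §A. Generic measure-theoretic tools -/

/-- **Cauchy–Schwarz + Tonelli** for the `L²` norm of a parametric integral: if
`‖f x‖ₑ ≤ a x * b x`, then `∫⁻_y ‖∫_x f x k x y‖ₑ² ≤ (∫⁻ a²)·∫⁻_x b² ∫⁻_y ‖k x y‖ₑ²`. [folklore] -/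
private theorem lintegral_norm_integral_mul_sq_le {X Y : Type*} [MeasurableSpace X] [MeasurableSpace Y]
    {μ : Measure X} {ν : Measure Y} [SFinite μ] [SFinite ν] {f : X → ℂ} {k : X → Y → ℂ}
    {a b : X → ℝ≥0∞} (ha : Measurable a) (hb : Measurable b)
    (hk : Measurable (Function.uncurry k)) (hfab : ∀ x, ‖f x‖ₑ ≤ a x * b x) :
    ∫⁻ y, ‖∫ x, f x * k x y ∂μ‖ₑ ^ 2 ∂ν ≤
      (∫⁻ x, a x ^ 2 ∂μ) * ∫⁻ x, b x ^ 2 * ∫⁻ y, ‖k x y‖ₑ ^ 2 ∂ν ∂μ := by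
  have hky : ∀ y, Measurable fun x ↦ k x y := fun y ↦ hk.comp (measurable_id.prodMk measurable_const)
  have hkx : ∀ x, Measurable fun y ↦ k x y := fun x ↦ hk.comp (measurable_const.prodMk measurable_id)
  set A : ℝ≥0∞ := ∫⁻ x, a x ^ 2 ∂μ with hA
  have hF : Measurable (Function.uncurry fun x y ↦ (b x * ‖k x y‖ₑ) ^ 2) :=
    ((hb.comp measurable_fst).mul hk.enorm).pow_const 2
  have hpt : ∀ y, ‖∫ x, f x * k x y ∂μ‖ₑ ^ 2 ≤ A * ∫⁻ x, (b x * ‖k x y‖ₑ) ^ 2 ∂μ := by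
    intro y
    have h1 : ‖∫ x, f x * k x y ∂μ‖ₑ ≤ ∫⁻ x, a x * (b x * ‖k x y‖ₑ) ∂μ := by
      refine (enorm_integral_le_lintegral_enorm _).trans (lintegral_mono fun x ↦ ?_)
      rw [enorm_mul, ← mul_assoc]
      gcongr
      exact hfab x
    have h2 : ∫⁻ x, a x * (b x * ‖k x y‖ₑ) ∂μ ≤
        A ^ (1 / (2 : ℝ)) * (∫⁻ x, (b x * ‖k x y‖ₑ) ^ 2 ∂μ) ^ (1 / (2 : ℝ)) := by
      have h := ENNReal.lintegral_mul_le_Lp_mul_Lq μ Real.HolderConjugate.two_two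
        ha.aemeasurable ((hb.mul (hky y).enorm)).aemeasurable
      simp only [Pi.mul_apply, ENNReal.rpow_two] at h
      exact h
    calc ‖∫ x, f x * k x y ∂μ‖ₑ ^ 2
        ≤ (A ^ (1 / (2 : ℝ)) * (∫⁻ x, (b x * ‖k x y‖ₑ) ^ 2 ∂μ) ^ (1 / (2 : ℝ))) ^ 2 := by
          gcongr
          exact h1.trans h2
      _ = A * ∫⁻ x, (b x * ‖k x y‖ₑ) ^ 2 ∂μ := by
          rw [mul_pow, ← ENNReal.rpow_two, ← ENNReal.rpow_two, ← ENNReal.rpow_mul,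
            ← ENNReal.rpow_mul]
          norm_num
  calc ∫⁻ y, ‖∫ x, f x * k x y ∂μ‖ₑ ^ 2 ∂ν
      ≤ ∫⁻ y, A * ∫⁻ x, (b x * ‖k x y‖ₑ) ^ 2 ∂μ ∂ν := lintegral_mono hpt
    _ = A * ∫⁻ y, ∫⁻ x, (b x * ‖k x y‖ₑ) ^ 2 ∂μ ∂ν := by
        rw [lintegral_const_mul _ hF.lintegral_prod_left]
    _ = A * ∫⁻ x, ∫⁻ y, (b x * ‖k x y‖ₑ) ^ 2 ∂ν ∂μ := by
        rw [lintegral_lintegral_swap hF.aemeasurable]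
    _ = A * ∫⁻ x, b x ^ 2 * ∫⁻ y, ‖k x y‖ₑ ^ 2 ∂ν ∂μ := by
        congr 1
        refine lintegral_congr fun x ↦ ?_
        rw [← lintegral_const_mul _ ((hkx x).enorm.pow_const 2)]
        refine lintegral_congr fun y ↦ ?_
        rw [mul_pow]

/-- `∫_ℝ dτ/(a² + (τ − c)²) = π/|a|` for `a ≠ 0`. [folklore] -/
private theorem integral_inv_sq_add_sq {a : ℝ} (ha : a ≠ 0) (c : ℝ) :
    ∫ τ : ℝ, (a ^ 2 + (τ - c) ^ 2)⁻¹ = π / |a| := by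
  have ha0 : 0 < |a| := abs_pos.2 ha
  have h1 : ∫ τ : ℝ, (a ^ 2 + (τ - c) ^ 2)⁻¹ = ∫ τ : ℝ, (a ^ 2 + τ ^ 2)⁻¹ :=
    integral_sub_right_eq_self (fun τ ↦ (a ^ 2 + τ ^ 2)⁻¹) c
  have h2 : (fun τ : ℝ ↦ (a ^ 2 + τ ^ 2)⁻¹) = fun τ ↦ (a ^ 2)⁻¹ * (1 + (|a|⁻¹ * τ) ^ 2)⁻¹ := by
    funext τ
    have ha2 : a ^ 2 ≠ 0 := pow_ne_zero 2 ha
    rw [mul_pow, inv_pow, sq_abs, ← mul_inv]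
    congr 1
    field_simp
  rw [h1, h2, integral_const_mul, Measure.integral_comp_mul_left (fun τ ↦ (1 + τ ^ 2)⁻¹),
    integral_univ_inv_one_add_sq, inv_inv, abs_of_pos ha0, smul_eq_mul, ← sq_abs]
  field_simp

/-- Integrability of `τ ↦ (a² + (τ − c)²)⁻¹`. [folklore] -/
private theorem integrable_inv_sq_add_sq {a : ℝ} (ha : a ≠ 0) (c : ℝ) :
    Integrable fun τ : ℝ ↦ (a ^ 2 + (τ - c) ^ 2)⁻¹ := by
  have ha0 : 0 < |a| := abs_pos.2 ha
  have h0 : Integrable fun τ : ℝ ↦ (a ^ 2 + τ ^ 2)⁻¹ := by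
    have h' : Integrable fun τ : ℝ ↦ (a ^ 2)⁻¹ * (1 + (|a|⁻¹ * τ) ^ 2)⁻¹ :=
      (integrable_inv_one_add_sq.comp_mul_left' (inv_ne_zero ha0.ne')).const_mul _
    refine h'.congr (ae_of_all _ fun τ ↦ ?_)
    simp only
    rw [mul_pow, inv_pow, sq_abs, ← mul_inv]
    congr 1
    field_simp
  exact h0.comp_sub_right c

/-- The lintegral form: `∫⁻ ‖(a² + (τ − c)²)⁻¹‖ₑ dτ = π/|a|`. [folklore] -/
private theorem lintegral_inv_sq_add_sq {a : ℝ} (ha : a ≠ 0) (c : ℝ) :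
    ∫⁻ τ : ℝ, ENNReal.ofReal ((a ^ 2 + (τ - c) ^ 2)⁻¹) = ENNReal.ofReal (π / |a|) := by
  rw [← ofReal_integral_eq_lintegral_ofReal (integrable_inv_sq_add_sq ha c)
    (ae_of_all _ fun τ ↦ by positivity), integral_inv_sq_add_sq ha c]

/-- `x ↦ |x − x₀|^{−r}` is integrable on `[a, b] ∋ x₀` for `r < 1`. [folklore] -/
private theorem integrableOn_abs_sub_rpow_neg {r : ℝ} (hr : r < 1) {x₀ a b : ℝ} (ha : a ≤ x₀) (hb : x₀ ≤ b) :
    IntegrableOn (fun x : ℝ ↦ |x - x₀| ^ (-r)) (Set.Icc a b) := by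
  have hr' : -1 < -r := by linarith
  -- right piece `[x₀, b]`
  have h1 : IntegrableOn (fun x : ℝ ↦ |x - x₀| ^ (-r)) (Set.Icc x₀ b) := by
    have h0 : IntervalIntegrable (fun x : ℝ ↦ x ^ (-r)) volume 0 (b - x₀) :=
      intervalIntegral.intervalIntegrable_rpow' hr'
    have h := h0.comp_sub_right x₀ (by simp)
    simp only [zero_add, sub_add_cancel] at h
    have h' : IntegrableOn (fun x : ℝ ↦ (x - x₀) ^ (-r)) (Set.Icc x₀ b) :=
      (intervalIntegrable_iff_integrableOn_Icc_of_le hb).1 h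
    refine h'.congr_fun (fun x hx ↦ ?_) measurableSet_Icc
    simp only
    rw [abs_of_nonneg (by linarith [hx.1])]
  -- left piece `[a, x₀]`
  have h2 : IntegrableOn (fun x : ℝ ↦ |x - x₀| ^ (-r)) (Set.Icc a x₀) := by
    have h0 : IntervalIntegrable (fun x : ℝ ↦ x ^ (-r)) volume 0 (x₀ - a) :=
      intervalIntegral.intervalIntegrable_rpow' hr'
    have h := h0.comp_sub_left x₀ (by simp)
    simp only [sub_zero, sub_sub_cancel] at h
    have h' : IntegrableOn (fun x : ℝ ↦ (x₀ - x) ^ (-r)) (Set.Icc a x₀) :=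
      (intervalIntegrable_iff_integrableOn_Icc_of_le ha).1 h.symm
    refine h'.congr_fun (fun x hx ↦ ?_) measurableSet_Icc
    simp only
    rw [abs_of_nonpos (by linarith [hx.2]), neg_sub]
  have := h2.union h1
  rwa [Set.Icc_union_Icc_eq_Icc ha hb] at this

/-- Finiteness of `∫⁻_{[a,b]} |x − x₀|^{−r}` for `r < 1`. [folklore] -/
private theorem lintegral_abs_sub_rpow_neg_lt_top {r : ℝ} (hr : r < 1) {x₀ a b : ℝ} (ha : a ≤ x₀)
    (hb : x₀ ≤ b) :
    ∫⁻ x in Set.Icc a b, ENNReal.ofReal (|x - x₀| ^ (-r)) < ∞ := by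
  have h := (integrableOn_abs_sub_rpow_neg hr ha hb).2
  rw [HasFiniteIntegral] at h
  refine lt_of_le_of_lt (lintegral_mono fun x ↦ ?_) h
  rw [Real.enorm_eq_ofReal (Real.rpow_nonneg (abs_nonneg _) _)]

/-! ### Functions on the critical line -/

/-- A continuous function on `ℝ` dominated by `C(1+|τ|)^{-3/4}` lies in `L²`. [folklore] -/
private theorem memLp_two_of_continuous_of_decay {f : ℝ → ℂ} (hf : Continuous f) {C : ℝ}
    (h : ∀ τ : ℝ, ‖f τ‖ ≤ C * (1 + |τ|) ^ (-(3 / 4 : ℝ))) : MemLp f 2 volume := by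
  have hC : 0 ≤ C := by
    have := (norm_nonneg _).trans (h 0)
    simpa using this
  -- dominate `‖f‖²` by the integrable `C² (1+|τ|)^{-3/2}`
  have hdom : Integrable fun τ : ℝ ↦ C ^ 2 * (1 + |τ|) ^ (-(3 / 2 : ℝ)) := by
    have h0 : Integrable fun τ : ℝ ↦ (1 + |τ|) ^ (-(3 / 2 : ℝ)) := by
      have := integrable_one_add_norm (E := ℝ) (μ := volume) (r := 3 / 2) (by norm_num)
      refine this.congr (ae_of_all _ fun τ ↦ ?_)
      simp [Real.norm_eq_abs]
    exact h0.const_mul _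
  refine (memLp_two_iff_integrable_sq_norm hf.aestronglyMeasurable).2 ?_
  refine Integrable.mono' hdom (hf.norm.aestronglyMeasurable.pow 2) (ae_of_all _ fun τ ↦ ?_)
  rw [Real.norm_eq_abs, abs_of_nonneg (by positivity)]
  have h1 := h τ
  have hpos : 0 < 1 + |τ| := by positivity
  calc ‖f τ‖ ^ 2 ≤ (C * (1 + |τ|) ^ (-(3 / 4 : ℝ))) ^ 2 := by gcongr
    _ = C ^ 2 * (1 + |τ|) ^ (-(3 / 2 : ℝ)) := by
        rw [mul_pow]
        congr 1
        rw [← Real.rpow_two, ← Real.rpow_mul hpos.le]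
        norm_num

/-- **Polynomial bound on the critical line** (from the tree's Trudgian bound
`|ζ(½+it)| ≤ 2.53|3+it|^{1/4}`): `‖ζ(½+iτ)‖ ≤ 6 (1+|τ|)^{1/4}`.
[cite: Trudgian2011, Lemma 2.5] -/
theorem norm_zeta_half_le (τ : ℝ) : ‖riemannZeta (1 / 2 + τ * I)‖ ≤ 6 * (1 + |τ|) ^ (1 / 4 : ℝ) := by
  have h := norm_riemannZeta_half_line_le_allT Trudgian2011_lemma_2_5_allT_holds τ
  have hQ : ((5 / 2 : ℝ) : ℂ) + (1 / 2 + τ * I) = ((3 : ℝ) : ℂ) + τ * I := by push_cast; ring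
  rw [hQ] at h
  have hn : ‖((3 : ℝ) : ℂ) + τ * I‖ ≤ 3 * (1 + |τ|) := by
    calc ‖((3 : ℝ) : ℂ) + τ * I‖ ≤ ‖((3 : ℝ) : ℂ)‖ + ‖(τ : ℂ) * I‖ := norm_add_le _ _
      _ = 3 + |τ| := by simp
      _ ≤ 3 * (1 + |τ|) := by linarith [abs_nonneg τ]
  have hpos : 0 < 1 + |τ| := by positivity
  calc ‖riemannZeta (1 / 2 + τ * I)‖ ≤ 2.53 * ‖((3 : ℝ) : ℂ) + τ * I‖ ^ (1 / 4 : ℝ) := h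
    _ ≤ 2.53 * (3 * (1 + |τ|)) ^ (1 / 4 : ℝ) := by gcongr
    _ = 2.53 * 3 ^ (1 / 4 : ℝ) * (1 + |τ|) ^ (1 / 4 : ℝ) := by
        rw [Real.mul_rpow (by norm_num) hpos.le]; ring
    _ ≤ 6 * (1 + |τ|) ^ (1 / 4 : ℝ) := by
        gcongr
        have h16 : (16 : ℝ) ^ (1 / 4 : ℝ) = 2 := by
          rw [show (16 : ℝ) = 2 ^ (4 : ℝ) by norm_num, ← Real.rpow_mul (by norm_num)]
          norm_num
        have : (3 : ℝ) ^ (1 / 4 : ℝ) ≤ 16 ^ (1 / 4 : ℝ) :=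
          Real.rpow_le_rpow (by norm_num) (by norm_num) (by norm_num)
        rw [h16] at this
        linarith

/-- On the critical line `|Z + 2| ≥ (1 + |τ|)/2` (`Z = ½ + iτ`). [folklore] -/
private theorem half_one_add_abs_le_norm (τ : ℝ) : (1 + |τ|) / 2 ≤ ‖(1 / 2 + τ * I : ℂ) + 2‖ := by
  have hre : ((1 / 2 + τ * I : ℂ) + 2).re = 5 / 2 := by simp; norm_num
  have him : ((1 / 2 + τ * I : ℂ) + 2).im = τ := by simp
  have h1 : (5 / 2 : ℝ) ≤ ‖(1 / 2 + τ * I : ℂ) + 2‖ := by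
    have := abs_re_le_norm ((1 / 2 + τ * I : ℂ) + 2)
    rw [hre] at this
    exact le_trans (by norm_num) this
  have h2 : |τ| ≤ ‖(1 / 2 + τ * I : ℂ) + 2‖ := by
    have := abs_im_le_norm ((1 / 2 + τ * I : ℂ) + 2)
    rwa [him] at this
  linarith

/-- **`ζ(Z)/(Z+2)` is bounded on the critical line**: `‖ζ(½+iτ)/(5/2+iτ)‖ ≤ 12`. [folklore] -/
private theorem norm_zeta_div_le (τ : ℝ) :
    ‖riemannZeta (1 / 2 + τ * I) / ((1 / 2 + τ * I) + 2)‖ ≤ 12 := by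
  have hpos : 0 < 1 + |τ| := by positivity
  have hZ := half_one_add_abs_le_norm τ
  have hZ0 : 0 < ‖(1 / 2 + τ * I : ℂ) + 2‖ := lt_of_lt_of_le (by positivity) hZ
  rw [norm_div, div_le_iff₀ hZ0]
  have h1 : (1 + |τ|) ^ (1 / 4 : ℝ) ≤ 1 + |τ| := by
    have := Real.rpow_le_rpow_of_exponent_le (by linarith [abs_nonneg τ] : (1 : ℝ) ≤ 1 + |τ|)
      (by norm_num : (1 / 4 : ℝ) ≤ 1)
    rwa [Real.rpow_one] at this
  calc ‖riemannZeta (1 / 2 + τ * I)‖ ≤ 6 * (1 + |τ|) ^ (1 / 4 : ℝ) := norm_zeta_half_le τ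
    _ ≤ 6 * (1 + |τ|) := by gcongr
    _ ≤ 12 * ‖(1 / 2 + τ * I : ℂ) + 2‖ := by linarith

/-- **`ζ(Z)/(Z+2)` decays like `(1+|τ|)^{−3/4}` on the critical line.** [folklore] -/
private theorem norm_zeta_div_le_rpow (τ : ℝ) :
    ‖riemannZeta (1 / 2 + τ * I) / ((1 / 2 + τ * I) + 2)‖ ≤ 12 * (1 + |τ|) ^ (-(3 / 4 : ℝ)) := by
  have hpos : 0 < 1 + |τ| := by positivity
  have hZ := half_one_add_abs_le_norm τ
  have hZ0 : 0 < ‖(1 / 2 + τ * I : ℂ) + 2‖ := lt_of_lt_of_le (by positivity) hZ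
  rw [norm_div, div_le_iff₀ hZ0]
  calc ‖riemannZeta (1 / 2 + τ * I)‖ ≤ 6 * (1 + |τ|) ^ (1 / 4 : ℝ) := norm_zeta_half_le τ
    _ = 12 * (1 + |τ|) ^ (-(3 / 4 : ℝ)) * ((1 + |τ|) / 2) := by
        rw [show (1 / 4 : ℝ) = -(3 / 4 : ℝ) + 1 by norm_num, Real.rpow_add hpos, Real.rpow_one]
        ring
    _ ≤ 12 * (1 + |τ|) ^ (-(3 / 4 : ℝ)) * ‖(1 / 2 + τ * I : ℂ) + 2‖ := by gcongr

/-- Continuity of `τ ↦ ζ(½ + iτ)/(5/2 + iτ)`. [folklore] -/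
private theorem continuous_zeta_div_line :
    Continuous fun τ : ℝ ↦ riemannZeta (1 / 2 + τ * I) / ((1 / 2 + τ * I) + 2) := by
  have hline : Continuous fun τ : ℝ ↦ (1 / 2 + τ * I : ℂ) := by fun_prop
  refine Continuous.div ?_ (by fun_prop) fun τ ↦ ?_
  · refine continuous_iff_continuousAt.2 fun τ ↦ ?_
    have hne : (1 / 2 + τ * I : ℂ) ≠ 1 := by
      intro h; have := congrArg Complex.re h; norm_num at this
    exact (differentiableAt_riemannZeta hne).continuousAt.comp (f := fun τ : ℝ ↦ (1 / 2 + τ * I : ℂ))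
      (x := τ) hline.continuousAt
  · intro h
    have := congrArg Complex.re h
    norm_num at this

/-- **`ζ(Z)/(Z+2) ∈ L²` on the critical line.** [folklore] -/
private theorem memLp_zeta_div_line :
    MemLp (fun τ : ℝ ↦ riemannZeta (1 / 2 + τ * I) / ((1 / 2 + τ * I) + 2)) 2 volume :=
  memLp_two_of_continuous_of_decay continuous_zeta_div_line norm_zeta_div_le_rpow


/-! ## §B. Residues of `F(z)/(Z − z)` at a pole of `F` -/

/-- Near `c`, punctured: `z ≠ c` and `z ≠ Z` (for `Z ≠ c`). [folklore] -/
private theorem eventually_ne_and_ne {c Z : ℂ} (hZ : Z ≠ c) : ∀ᶠ z in 𝓝[≠] c, z ≠ c ∧ z ≠ Z := by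
  have h1 : ∀ᶠ z in 𝓝[≠] c, z ≠ c := self_mem_nhdsWithin
  have h2 : ∀ᶠ z in 𝓝[≠] c, z ≠ Z := mem_nhdsWithin_of_mem_nhds (isOpen_ne.mem_nhds hZ.symm)
  exact h1.and h2

/-- `z ↦ (z − c)^{−(k+1)}/(Z − z)` is differentiable on a punctured neighbourhood of `c`. [folklore] -/
private theorem eventually_differentiableAt_zpow_div {c Z : ℂ} (hZ : Z ≠ c) (n : ℤ) :
    ∀ᶠ z in 𝓝[≠] c, DifferentiableAt ℂ (fun z ↦ (z - c) ^ n / (Z - z)) z := by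
  filter_upwards [eventually_ne_and_ne hZ] with z hz
  exact ((differentiableAt_id.sub_const c).zpow (Or.inl (sub_ne_zero.2 hz.1))).div
    ((differentiableAt_const Z).sub differentiableAt_id) (sub_ne_zero.2 (Ne.symm hz.2))

/-- **`Res_c [(z−c)^{−(k+1)}/(Z−z)] = (Z−c)^{−(k+1)}`** for `Z ≠ c`: the partial-fraction identity
`(z−c)^{−K}/(Z−z) = (Z−c)^{−1}(z−c)^{−K} + (Z−c)^{−1}(z−c)^{−(K−1)}/(Z−z)` and induction on `K`.
[folklore] -/
private theorem residueAt_zpow_neg_div_sub {c Z : ℂ} (hZ : Z ≠ c) (k : ℕ) :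
    residueAt (fun z ↦ (z - c) ^ (-(k + 1 : ℤ)) / (Z - z)) c = (Z - c) ^ (-(k + 1 : ℤ)) := by
  have hZc : Z - c ≠ 0 := sub_ne_zero.2 hZ
  induction k with
  | zero =>
    -- `(z−c)⁻¹/(Z−z) = (Z−c)⁻¹ (z−c)⁻¹ + (Z−c)⁻¹ (Z−z)⁻¹`
    simp only [Nat.cast_zero, zero_add]
    have hev : (fun z ↦ (Z - c)⁻¹ * (z - c)⁻¹ + (Z - c)⁻¹ * (Z - z)⁻¹) =ᶠ[𝓝[≠] c]
        fun z ↦ (z - c) ^ (-1 : ℤ) / (Z - z) := by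
      filter_upwards [eventually_ne_and_ne hZ] with z hz
      have h1 : z - c ≠ 0 := sub_ne_zero.2 hz.1
      have h2 : Z - z ≠ 0 := sub_ne_zero.2 (Ne.symm hz.2)
      simp only [zpow_neg, zpow_one]
      field_simp
      ring
    have hd1 : ∀ᶠ z in 𝓝[≠] c, DifferentiableAt ℂ (fun z ↦ (z - c)⁻¹) z := by
      filter_upwards [eventually_ne_and_ne hZ] with z hz
      exact (differentiableAt_id.sub_const c).inv (sub_ne_zero.2 hz.1)
    have hd2 : ∀ᶠ z in 𝓝[≠] c, DifferentiableAt ℂ (fun z ↦ (Z - z)⁻¹) z := by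
      filter_upwards [eventually_ne_and_ne hZ] with z hz
      exact ((differentiableAt_const Z).sub differentiableAt_id).inv (sub_ne_zero.2 (Ne.symm hz.2))
    have ha2 : AnalyticAt ℂ (fun z ↦ (Z - c)⁻¹ * (Z - z)⁻¹) c :=
      analyticAt_const.mul ((analyticAt_const.sub analyticAt_id).inv hZc)
    have hsum : ∀ᶠ z in 𝓝[≠] c, DifferentiableAt ℂ
        (fun z ↦ (Z - c)⁻¹ * (z - c)⁻¹ + (Z - c)⁻¹ * (Z - z)⁻¹) z := by
      filter_upwards [hd1, hd2] with z h1 h2 using (h1.const_mul _).add (h2.const_mul _)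
    rw [residueAt_congr hsum hev,
      show (fun z ↦ (Z - c)⁻¹ * (z - c)⁻¹ + (Z - c)⁻¹ * (Z - z)⁻¹) =
        (fun z ↦ (Z - c)⁻¹ * (z - c)⁻¹) + fun z ↦ (Z - c)⁻¹ * (Z - z)⁻¹ from rfl,
      residueAt_add (hd1.mono fun _ h ↦ h.const_mul _) (hd2.mono fun _ h ↦ h.const_mul _),
      residueAt_const_mul hd1, residueAt_inv_sub_self, residueAt_of_analyticAt ha2]
    simp
  | succ k ih =>
    -- `(z−c)^{−(k+2)}/(Z−z) = (Z−c)^{−1}(z−c)^{−(k+2)} + (Z−c)^{−1}(z−c)^{−(k+1)}/(Z−z)`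
    have hev : (fun z ↦ (Z - c)⁻¹ * (z - c) ^ (-(k + 1 + 1 : ℤ)) +
        (Z - c)⁻¹ * ((z - c) ^ (-(k + 1 : ℤ)) / (Z - z))) =ᶠ[𝓝[≠] c]
        fun z ↦ (z - c) ^ (-((k + 1 : ℕ) + 1 : ℤ)) / (Z - z) := by
      filter_upwards [eventually_ne_and_ne hZ] with z hz
      have h1 : z - c ≠ 0 := sub_ne_zero.2 hz.1
      have h2 : Z - z ≠ 0 := sub_ne_zero.2 (Ne.symm hz.2)
      have e1 : (z - c) ^ (-(k + 1 + 1 : ℤ)) = (z - c) ^ (-(k + 1 : ℤ)) * (z - c)⁻¹ := by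
        rw [show (-(k + 1 + 1 : ℤ)) = -(k + 1 : ℤ) + (-1) by ring, zpow_add₀ h1, zpow_neg_one]
      push_cast
      rw [e1]
      field_simp
      ring
    have hd1 : ∀ᶠ z in 𝓝[≠] c, DifferentiableAt ℂ (fun z ↦ (z - c) ^ (-(k + 1 + 1 : ℤ))) z := by
      filter_upwards [eventually_ne_and_ne hZ] with z hz
      exact (differentiableAt_id.sub_const c).zpow (Or.inl (sub_ne_zero.2 hz.1))
    have hd2 := eventually_differentiableAt_zpow_div hZ (-(k + 1 : ℤ))
    have hsum : ∀ᶠ z in 𝓝[≠] c, DifferentiableAt ℂ (fun z ↦ (Z - c)⁻¹ * (z - c) ^ (-(k + 1 + 1 : ℤ)) +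
        (Z - c)⁻¹ * ((z - c) ^ (-(k + 1 : ℤ)) / (Z - z))) z := by
      filter_upwards [hd1, hd2] with z h1 h2 using (h1.const_mul _).add (h2.const_mul _)
    rw [residueAt_congr hsum hev,
      show (fun z ↦ (Z - c)⁻¹ * (z - c) ^ (-(k + 1 + 1 : ℤ)) +
          (Z - c)⁻¹ * ((z - c) ^ (-(k + 1 : ℤ)) / (Z - z))) =
        (fun z ↦ (Z - c)⁻¹ * (z - c) ^ (-(k + 1 + 1 : ℤ))) +
          fun z ↦ (Z - c)⁻¹ * ((z - c) ^ (-(k + 1 : ℤ)) / (Z - z)) from rfl,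
      residueAt_add (hd1.mono fun _ h ↦ h.const_mul _) (hd2.mono fun _ h ↦ h.const_mul _),
      residueAt_const_mul hd1, residueAt_const_mul hd2, ih,
      residueAt_zpow_sub_self c (by omega), mul_zero, zero_add]
    rw [show (-((k + 1 : ℕ) + 1 : ℤ)) = -(k + 1 : ℤ) + (-1) by push_cast; ring, zpow_add₀ hZc,
      zpow_neg_one]
    ring

/-- **Residue of `F(z)/(Z − z)` at a pole `c ≠ Z` of `F`** with principal part
`Σ_{k<m} b_k (z−c)^{−(k+1)}`: it is the principal part EVALUATED AT `Z`, `Σ_{k<m} b_k (Z−c)^{−(k+1)}`.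
[folklore] -/
private theorem residueAt_div_sub_of_principalPart {F H : ℂ → ℂ} {c Z : ℂ} {m : ℕ} {b : ℕ → ℂ}
    (hH : AnalyticAt ℂ H c) (hZ : Z ≠ c)
    (hF : ∀ᶠ z in 𝓝[≠] c, F z = (∑ k ∈ Finset.range m, b k * (z - c) ^ (-(k + 1 : ℤ))) + H z) :
    residueAt (fun z ↦ F z / (Z - z)) c = ∑ k ∈ Finset.range m, b k * (Z - c) ^ (-(k + 1 : ℤ)) := by
  -- rewrite `F/(Z−z)` as `Σ b_k [(z−c)^{−(k+1)}/(Z−z)] + H/(Z−z)` on a punctured neighbourhood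
  have hev : (fun z ↦ (∑ k ∈ Finset.range m, b k * ((z - c) ^ (-(k + 1 : ℤ)) / (Z - z))) +
      H z / (Z - z)) =ᶠ[𝓝[≠] c] fun z ↦ F z / (Z - z) := by
    filter_upwards [hF] with z hz
    rw [hz, add_div, Finset.sum_div]
    refine congrArg₂ (· + ·) (Finset.sum_congr rfl fun k _ ↦ ?_) rfl
    ring
  have hdk : ∀ k ∈ Finset.range m, ∀ᶠ z in 𝓝[≠] c,
      DifferentiableAt ℂ (fun z ↦ b k * ((z - c) ^ (-(k + 1 : ℤ)) / (Z - z))) z := fun k _ ↦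
    (eventually_differentiableAt_zpow_div hZ _).mono fun _ h ↦ h.const_mul _
  have hdS : ∀ᶠ z in 𝓝[≠] c, DifferentiableAt ℂ
      (fun z ↦ ∑ k ∈ Finset.range m, b k * ((z - c) ^ (-(k + 1 : ℤ)) / (Z - z))) z := by
    have hall : ∀ᶠ z in 𝓝[≠] c, ∀ k ∈ Finset.range m,
        DifferentiableAt ℂ (fun z ↦ b k * ((z - c) ^ (-(k + 1 : ℤ)) / (Z - z))) z :=
      ((Finset.range m).eventually_all).mpr hdk
    filter_upwards [hall] with z hz using DifferentiableAt.fun_sum hz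
  have hHa : AnalyticAt ℂ (fun z ↦ H z / (Z - z)) c :=
    hH.div (analyticAt_const.sub analyticAt_id) (sub_ne_zero.2 hZ)
  have hdH : ∀ᶠ z in 𝓝[≠] c, DifferentiableAt ℂ (fun z ↦ H z / (Z - z)) z :=
    (hHa.eventually_analyticAt.mono fun z hz ↦ hz.differentiableAt).filter_mono nhdsWithin_le_nhds
  have hsum : ∀ᶠ z in 𝓝[≠] c, DifferentiableAt ℂ
      (fun z ↦ (∑ k ∈ Finset.range m, b k * ((z - c) ^ (-(k + 1 : ℤ)) / (Z - z))) + H z / (Z - z)) z := by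
    filter_upwards [hdS, hdH] with z h1 h2 using h1.add h2
  rw [residueAt_congr hsum hev,
    show (fun z ↦ (∑ k ∈ Finset.range m, b k * ((z - c) ^ (-(k + 1 : ℤ)) / (Z - z))) + H z / (Z - z)) =
      (fun z ↦ ∑ k ∈ Finset.range m, b k * ((z - c) ^ (-(k + 1 : ℤ)) / (Z - z))) +
        fun z ↦ H z / (Z - z) from rfl,
    residueAt_add hdS hdH, residueAt_of_analyticAt hHa, add_zero, residueAt_sum _ hdk]
  refine Finset.sum_congr rfl fun k _ ↦ ?_
  rw [residueAt_const_mul (eventually_differentiableAt_zpow_div hZ _), residueAt_zpow_neg_div_sub hZ]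

/-- **Residue of `F(z)·(2+z)/((Z−z)(Z+2))` at a pole `c` of `F`** (`c ≠ Z`, `Z ≠ −2`): by
`(2+z)/((Z−z)(Z+2)) = 1/(Z−z) − 1/(Z+2)` it is `P(Z) − Res_c F/(Z+2)`, `P` the principal part.
[cite: Burnol2004b, proof of Thm. 5.2 (arXiv:math/0203120v7 p. 13, TeX l.1067–1075)] -/
theorem residueAt_mul_kernel_of_principalPart {F H : ℂ → ℂ} {c Z : ℂ} {m : ℕ} {b : ℕ → ℂ}
    (hH : AnalyticAt ℂ H c) (hZ : Z ≠ c) (hZ2 : Z + 2 ≠ 0)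
    (hF : ∀ᶠ z in 𝓝[≠] c, F z = (∑ k ∈ Finset.range m, b k * (z - c) ^ (-(k + 1 : ℤ))) + H z) :
    residueAt (fun z ↦ F z * ((2 + z) / ((Z - z) * (Z + 2)))) c =
      (∑ k ∈ Finset.range m, b k * (Z - c) ^ (-(k + 1 : ℤ))) -
        (if 0 < m then b 0 else 0) / (Z + 2) := by
  -- differentiability of `F` on a punctured neighbourhood (from the decomposition)
  have hPd : ∀ᶠ z in 𝓝[≠] c, DifferentiableAt ℂ
      (fun z ↦ (∑ k ∈ Finset.range m, b k * (z - c) ^ (-(k + 1 : ℤ))) + H z) z := by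
    have hHd : ∀ᶠ z in 𝓝[≠] c, DifferentiableAt ℂ H z :=
      (hH.eventually_analyticAt.mono fun z hz ↦ hz.differentiableAt).filter_mono nhdsWithin_le_nhds
    filter_upwards [hHd, eventually_ne_and_ne hZ] with z h1 hz
    refine DifferentiableAt.add (DifferentiableAt.fun_sum fun k _ ↦ ?_) h1
    exact ((differentiableAt_id.sub_const c).zpow (Or.inl (sub_ne_zero.2 hz.1))).const_mul _
  have hFd : ∀ᶠ z in 𝓝[≠] c, DifferentiableAt ℂ F z := by
    obtain ⟨R, hR, hRh⟩ := exists_ball_forall_of_eventually (hPd.and hF)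
    refine eventually_of_forall_ball hR fun z hz ↦ ?_
    have hz' : ball c R \ {c} ∈ 𝓝 z := by
      refine (isOpen_ball.sdiff isClosed_singleton).mem_nhds hz
    refine (hRh z hz).1.congr_of_eventuallyEq ?_
    filter_upwards [hz'] with w hw using (hRh w hw).2
  have hd1 : ∀ᶠ z in 𝓝[≠] c, DifferentiableAt ℂ (fun z ↦ F z / (Z - z)) z := by
    filter_upwards [hFd, eventually_ne_and_ne hZ] with z h1 hz
    exact h1.div ((differentiableAt_const Z).sub differentiableAt_id) (sub_ne_zero.2 (Ne.symm hz.2))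
  have hd2 : ∀ᶠ z in 𝓝[≠] c, DifferentiableAt ℂ (fun z ↦ (Z + 2)⁻¹ * F z) z :=
    hFd.mono fun _ h ↦ h.const_mul _
  have hev : (fun z ↦ F z / (Z - z) - (Z + 2)⁻¹ * F z) =ᶠ[𝓝[≠] c]
      fun z ↦ F z * ((2 + z) / ((Z - z) * (Z + 2))) := by
    filter_upwards [eventually_ne_and_ne hZ] with z hz
    have h2 : Z - z ≠ 0 := sub_ne_zero.2 (Ne.symm hz.2)
    field_simp
    ring
  have hsub : ∀ᶠ z in 𝓝[≠] c, DifferentiableAt ℂ (fun z ↦ F z / (Z - z) - (Z + 2)⁻¹ * F z) z := by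
    filter_upwards [hd1, hd2] with z h1 h2 using h1.sub h2
  rw [residueAt_congr hsub hev,
    show (fun z ↦ F z / (Z - z) - (Z + 2)⁻¹ * F z) = (fun z ↦ F z / (Z - z)) - fun z ↦ (Z + 2)⁻¹ * F z
      from rfl,
    residueAt_sub hd1 hd2, residueAt_div_sub_of_principalPart hH hZ hF, residueAt_const_mul hFd,
    residueAt_eq_of_principalPart hH hF, div_eq_inv_mul]

/-- **The residue at the parameter point**: for `h` analytic at `Z`, `Res_{z=Z} h(z)/(Z−z) = −h(Z)`.
[cite: Burnol2004b, proof of Thm. 5.2 (arXiv:math/0203120v7 p. 12, TeX l.1014–1029)] -/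
theorem residueAt_div_sub_self {h : ℂ → ℂ} {Z : ℂ} (hh : AnalyticAt ℂ h Z) :
    residueAt (fun z ↦ h z / (Z - z)) Z = -h Z := by
  -- `h(z)/(Z−z) = (−h Z)(z−Z)⁻¹ + (−dslope h Z z)`
  have hds : AnalyticAt ℂ (fun z ↦ -dslope h Z z) Z := by
    obtain ⟨p, hp⟩ := hh
    have hd : AnalyticAt ℂ (dslope h Z) Z := ⟨_, hp.has_fpower_series_dslope_fslope⟩
    exact hd.neg
  have hdec : ∀ᶠ z in 𝓝[≠] Z, h z / (Z - z) =
      (∑ k ∈ Finset.range 1, (fun _ ↦ -h Z) k * (z - Z) ^ (-(k + 1 : ℤ))) + -dslope h Z z := by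
    filter_upwards [self_mem_nhdsWithin] with z hz
    have hzZ : z - Z ≠ 0 := sub_ne_zero.2 hz
    have hZz : Z - z ≠ 0 := sub_ne_zero.2 (Ne.symm hz)
    rw [Finset.sum_range_one, dslope_of_ne _ hz, slope_def_field]
    simp only [Nat.cast_zero, zero_add, zpow_neg, zpow_one]
    field_simp
    ring
  rw [residueAt_eq_of_principalPart hds hdec]
  simp


/-! ## §C. The partial sums on the critical line: residue bookkeeping -/

/-- From a principal-part decomposition, `F` is differentiable on a punctured neighbourhood. [folklore] -/
private theorem eventually_differentiableAt_of_principalPart {F H : ℂ → ℂ} {c : ℂ} {m : ℕ} {b : ℕ → ℂ}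
    (hH : AnalyticAt ℂ H c)
    (hF : ∀ᶠ z in 𝓝[≠] c, F z = (∑ k ∈ Finset.range m, b k * (z - c) ^ (-(k + 1 : ℤ))) + H z) :
    ∀ᶠ z in 𝓝[≠] c, DifferentiableAt ℂ F z := by
  have hPd : ∀ᶠ z in 𝓝[≠] c, DifferentiableAt ℂ
      (fun z ↦ (∑ k ∈ Finset.range m, b k * (z - c) ^ (-(k + 1 : ℤ))) + H z) z := by
    have hHd : ∀ᶠ z in 𝓝[≠] c, DifferentiableAt ℂ H z :=
      (hH.eventually_analyticAt.mono fun z hz ↦ hz.differentiableAt).filter_mono nhdsWithin_le_nhds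
    filter_upwards [hHd, self_mem_nhdsWithin] with z h1 hz
    refine DifferentiableAt.add (DifferentiableAt.fun_sum fun k _ ↦ ?_) h1
    exact ((differentiableAt_id.sub_const c).zpow (Or.inl (sub_ne_zero.2 hz))).const_mul _
  obtain ⟨R, hR, hRh⟩ := exists_ball_forall_of_eventually (hPd.and hF)
  refine eventually_of_forall_ball hR fun z hz ↦ ?_
  have hz' : ball c R \ {c} ∈ 𝓝 z := (isOpen_ball.sdiff isClosed_singleton).mem_nhds hz
  refine (hRh z hz).1.congr_of_eventuallyEq ?_
  filter_upwards [hz'] with w hw using (hRh w hw).2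

/-- The non-trivial zeros below height `t` form a finite set. [folklore] -/
private theorem ntz_below_finite (t : ℝ) :
    {ρ : ℂ | ρ ∈ ZetaZeros.riemannZetaNontrivialZeros ∧ |ρ.im| < t}.Finite := by
  refine (((isCompact_Icc (a := (0 : ℝ)) (b := 1)).reProdIm
    (isCompact_Icc (a := -t) (b := t))).inter_riemannZetaZeros_finite).subset ?_
  rintro ρ ⟨hρ, hT⟩
  have h := mem_riemannZetaNontrivialZeros_iff_holds.1 hρ
  exact ⟨Complex.mem_reProdIm.2 ⟨⟨h.2.1.le, h.2.2.le⟩, abs_lt.1 hT |>.imp le_of_lt le_of_lt⟩, h.1⟩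

/-- A zero of `ζ` with `−1 ≤ Re s` is a non-trivial zero. [folklore] -/
private theorem mem_ntz_of_zero {s : ℂ} (h0 : riemannZeta s = 0) (h1 : -1 ≤ s.re) :
    s ∈ ZetaZeros.riemannZetaNontrivialZeros ∧ 0 < s.re ∧ s.re < 1 := by
  have hmem : s ∈ ZetaZeros.riemannZetaNontrivialZeros := by
    refine ⟨h0, ?_⟩
    rintro ⟨n, rfl⟩
    have : (-2 * ((n : ℂ) + 1)).re = -2 * (n + 1) := by simp
    rw [this] at h1
    have : (0 : ℝ) ≤ n := n.cast_nonneg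
    linarith
  have h := mem_riemannZetaNontrivialZeros_iff_holds.1 hmem
  exact ⟨hmem, h.2.1, h.2.2⟩

/-- `ζ` is analytic off `s = 1`. [folklore] -/
private theorem analyticAt_zeta {z : ℂ} (hz : z ≠ 1) : AnalyticAt ℂ riemannZeta z :=
  Complex.analyticAt_iff_eventually_differentiableAt.2
    (by filter_upwards [isOpen_ne.mem_nhds hz] with w hw using differentiableAt_riemannZeta hw)

/-- `ζ` is measurable (continuous off the single point `1`). [folklore] -/
private theorem measurable_zeta : Measurable riemannZeta :=
  measurable_of_continuousOn_compl_singleton 1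
    (fun _ hz ↦ (differentiableAt_riemannZeta hz).continuousAt.continuousWithinAt)

/-- `G_g = rightMellinExt g` is measurable for `g ∈ L_1` (continuous off `1`). [folklore] -/
private theorem measurable_rightMellinExt {g : Lp ℂ 2 (volume : Measure ℝ)} (hg : g ∈ sonineL 1) :
    Measurable (rightMellinExt g) :=
  measurable_of_continuousOn_compl_singleton 1
    (fun _ hz ↦ (BurnolResidueSum.differentiableAt_rightMellinExt hg hz).continuousAt.continuousWithinAt)

/-- **Principal parts of `G/ζ` at the non-trivial zeros** (`G` analytic, `1/ζ` meromorphic there).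
[cite: Burnol2004b, §5 Note 5 (arXiv:math/0203120v7 p. 11, TeX l.978–984)] -/
theorem exists_principalParts {g : Lp ℂ 2 (volume : Measure ℝ)} (hg : g ∈ sonineL 1) :
    ∃ (m : ℂ → ℕ) (b : ℂ → ℕ → ℂ) (H : ℂ → ℂ → ℂ), ∀ ρ ∈ ZetaZeros.riemannZetaNontrivialZeros,
      AnalyticAt ℂ (H ρ) ρ ∧ ∀ᶠ s in 𝓝[≠] ρ, rightMellinExt g s / riemannZeta s =
        (∑ k ∈ Finset.range (m ρ), b ρ k * (s - ρ) ^ (-(k + 1 : ℤ))) + H ρ s := by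
  have h : ∀ ρ : ℂ, ρ ∈ ZetaZeros.riemannZetaNontrivialZeros → ∃ (m : ℕ) (b : ℕ → ℂ) (H : ℂ → ℂ),
      AnalyticAt ℂ H ρ ∧ ∀ᶠ s in 𝓝[≠] ρ, rightMellinExt g s / riemannZeta s =
        (∑ k ∈ Finset.range m, b k * (s - ρ) ^ (-(k + 1 : ℤ))) + H s := by
    intro ρ hρ
    have h := mem_riemannZetaNontrivialZeros_iff_holds.1 hρ
    have hρ1 : ρ ≠ 1 := by intro h1; rw [h1] at h; norm_num at h
    have hGa : AnalyticAt ℂ (rightMellinExt g) ρ :=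
      (hasRightMellinContinuation_rightMellinExt_of_mem_sonineL one_pos hg).1.analyticAt
        (isOpen_ne.mem_nhds hρ1)
    exact exists_principalPart (hGa.meromorphicAt.div (analyticAt_zeta hρ1).meromorphicAt)
  choose! m b H hH using h
  exact ⟨m, b, H, hH⟩

/-- **`s = 1` is a regular point of `G/ζ`**: there is `Ψ` analytic at `1` agreeing with `G/ζ` on a
punctured neighbourhood (simple pole of `G` against the simple pole of `ζ`).
[cite: Burnol2004b, §5 after Thm. 5.2 (arXiv:math/0203120v7 p. 12, TeX l.1007–1010)] -/
theorem exists_analyticAt_one {g : Lp ℂ 2 (volume : Measure ℝ)} (hg : g ∈ sonineL 1) :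
    ∃ Ψ : ℂ → ℂ, AnalyticAt ℂ Ψ 1 ∧
      (fun s ↦ rightMellinExt g s / riemannZeta s) =ᶠ[𝓝[≠] (1 : ℂ)] Ψ := by
  have hg' := hg
  obtain ⟨-, ⟨c, hc⟩, -⟩ := hg'
  have hgm : MemLp (Set.indicator {x : ℝ | 1 < |x|} (g : ℝ → ℂ)) 2 volume :=
    (Lp.memLp g).indicator (isOpen_lt continuous_const continuous_abs).measurableSet
  set g₁ : Lp ℂ 2 (volume : Measure ℝ) := hgm.toLp _ with hg₁def
  have hg₁ : ∀ᵐ x : ℝ, g₁ x = Set.indicator {x : ℝ | 1 < |x|} (g : ℝ → ℂ) x := hgm.coeFn_toLp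
  refine ⟨fun s ↦ (-c + (s - 1) * mellin (g₁ : ℝ → ℂ) (1 - s)) / riemannZeta₁ s, ?_,
    BurnolResidueSum.div_zeta_eventuallyEq_near_one g g₁ hg₁ hg hc⟩
  have hO : IsOpen ({s : ℂ | 1 / 2 < s.re} ∩ {s | riemannZeta₁ s ≠ 0}) :=
    (isOpen_lt continuous_const Complex.continuous_re).inter
      (isOpen_ne_fun differentiable_riemannZeta₁.continuous continuous_const)
  have h1 : (1 : ℂ) ∈ {s : ℂ | 1 / 2 < s.re} ∩ {s | riemannZeta₁ s ≠ 0} :=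
    ⟨by norm_num, by simp [riemannZeta₁_one]⟩
  have hM := BurnolResidueSum.differentiableOn_mellin_trunc_one_sub g g₁ hg₁
  have hd : DifferentiableOn ℂ (fun s ↦ (-c + (s - 1) * mellin (g₁ : ℝ → ℂ) (1 - s)) / riemannZeta₁ s)
      ({s : ℂ | 1 / 2 < s.re} ∩ {s | riemannZeta₁ s ≠ 0}) := by
    intro z hz
    refine DifferentiableWithinAt.div ?_ (differentiable_riemannZeta₁ z).differentiableWithinAt hz.2
    exact ((differentiableAt_const _).add (((differentiableAt_id).sub (differentiableAt_const _)).mul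
      ((hM z hz.1).differentiableAt ((isOpen_lt continuous_const Complex.continuous_re).mem_nhds hz.1))))
      |>.differentiableWithinAt
  exact hd.analyticAt (hO.mem_nhds h1)

section Formula

variable {A : ℝ} {T : ℕ → ℝ} {g : Lp ℂ 2 (volume : Measure ℝ)}
  {m : ℂ → ℕ} {b : ℂ → ℕ → ℂ} {H : ℂ → ℂ → ℂ}

/-- **The partial sum `S_n(Z)` off the zeros**: `S_n(Z) = ζ(Z)·Σ_{|Im ρ|<T_n} P_ρ(Z)`, `P_ρ` the
principal part of `G/ζ` at `ρ` ("the exact expression is a linear combination of `ζ(Z)/(Z−ρ)^l`,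
`1 ≤ l ≤ m_ρ`"). [cite: Burnol2004b, §5 after Thm. 5.2 (arXiv:math/0203120v7 p. 12, TeX l.1004–1008)] -/
theorem partialSum_eq_zeta_mul_sum
    (hPP : ∀ ρ ∈ ZetaZeros.riemannZetaNontrivialZeros, AnalyticAt ℂ (H ρ) ρ ∧
      ∀ᶠ s in 𝓝[≠] ρ, rightMellinExt g s / riemannZeta s =
        (∑ k ∈ Finset.range (m ρ), b ρ k * (s - ρ) ^ (-(k + 1 : ℤ))) + H ρ s)
    (n : ℕ) {Z : ℂ} (hZ : riemannZeta Z ≠ 0) :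
    burnolResiduePartialSum (rightMellinExt g) T n Z =
      riemannZeta Z * ∑ ρ ∈ (ntz_below_finite (T n)).toFinset,
        ∑ k ∈ Finset.range (m ρ), b ρ k * (Z - ρ) ^ (-(k + 1 : ℤ)) := by
  rw [burnolResiduePartialSum, finsum_mem_eq_finite_toFinset_sum _ (ntz_below_finite (T n)),
    Finset.mul_sum]
  refine Finset.sum_congr rfl fun ρ hρ ↦ ?_
  have hρ' : ρ ∈ ZetaZeros.riemannZetaNontrivialZeros := ((Set.Finite.mem_toFinset _).1 hρ).1
  have hZρ : Z ≠ ρ := fun h ↦ hZ (by rw [h]; exact (mem_riemannZetaNontrivialZeros_iff_holds.1 hρ').1)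
  obtain ⟨hHρ, hFρ⟩ := hPP ρ hρ'
  have hfun : (fun s ↦ rightMellinExt g s / riemannZeta s * (riemannZeta Z / (Z - s))) =
      fun s ↦ riemannZeta Z * ((fun s ↦ rightMellinExt g s / riemannZeta s) s / (Z - s)) := by
    funext s; ring
  have hd : ∀ᶠ s in 𝓝[≠] ρ, DifferentiableAt ℂ
      (fun s ↦ (fun s ↦ rightMellinExt g s / riemannZeta s) s / (Z - s)) s := by
    filter_upwards [eventually_differentiableAt_of_principalPart hHρ hFρ, eventually_ne_and_ne hZρ]
      with s h1 hs
    exact h1.div ((differentiableAt_const Z).sub differentiableAt_id) (sub_ne_zero.2 (Ne.symm hs.2))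
  rw [hfun, residueAt_const_mul hd, residueAt_div_sub_of_principalPart hHρ hZρ hFρ]

/-- The Prop. 5.4 partial sums in the same bookkeeping: `Σ_{|Im ρ|<T_n} Res_ρ(G/ζ) = Σ r_ρ`, `r_ρ = b_ρ,0`.
[cite: Burnol2004b, Prop. 5.4 and Note 5 (arXiv:math/0203120v7 pp. 11, 14)] -/
theorem invZetaPartialSum_eq_sum
    (hPP : ∀ ρ ∈ ZetaZeros.riemannZetaNontrivialZeros, AnalyticAt ℂ (H ρ) ρ ∧
      ∀ᶠ s in 𝓝[≠] ρ, rightMellinExt g s / riemannZeta s =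
        (∑ k ∈ Finset.range (m ρ), b ρ k * (s - ρ) ^ (-(k + 1 : ℤ))) + H ρ s)
    (n : ℕ) :
    burnolInvZetaResiduePartialSum (rightMellinExt g) T n =
      ∑ ρ ∈ (ntz_below_finite (T n)).toFinset, (if 0 < m ρ then b ρ 0 else 0) := by
  rw [burnolInvZetaResiduePartialSum, finsum_mem_eq_finite_toFinset_sum _ (ntz_below_finite (T n))]
  refine Finset.sum_congr rfl fun ρ hρ ↦ ?_
  have hρ' : ρ ∈ ZetaZeros.riemannZetaNontrivialZeros := ((Set.Finite.mem_toFinset _).1 hρ).1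
  obtain ⟨hHρ, hFρ⟩ := hPP ρ hρ'
  exact residueAt_eq_of_principalPart hHρ hFρ

/-- **The residue theorem on `[−¼, 5/4] × [−T_n, T_n]` for `G(s)/ζ(s) · (2+s)/((Z−s)(Z+2))`**,
`Z = ½ + iτ` not a zero, `|τ| ≠ T_n`: the poles are the non-trivial zeros below height `T_n`
(residue `P_ρ(Z) − r_ρ/(Z+2)`), the removable point `s = 1` (residue `0`) and, when `|τ| < T_n`, the
point `s = Z` (residue `−G(Z)/ζ(Z)`). [cite: Burnol2004b, proof of Thm. 5.2 (arXiv:math/0203120v7 pp. 12–13, TeX l.1012–1029, 1095–1105)] -/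
theorem rectBoundaryIntegral_kernel_eq (hT : IsInvZetaHeightSeq A T) (hg : g ∈ sonineL 1)
    (hPP : ∀ ρ ∈ ZetaZeros.riemannZetaNontrivialZeros, AnalyticAt ℂ (H ρ) ρ ∧
      ∀ᶠ s in 𝓝[≠] ρ, rightMellinExt g s / riemannZeta s =
        (∑ k ∈ Finset.range (m ρ), b ρ k * (s - ρ) ^ (-(k + 1 : ℤ))) + H ρ s)
    (n : ℕ) {τ : ℝ} (hζ : riemannZeta (1 / 2 + τ * I) ≠ 0) (hτ : |τ| ≠ T n) :
    rectBoundaryIntegral (fun s ↦ rightMellinExt g s / riemannZeta s *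
        ((2 + s) / (((1 / 2 + τ * I) - s) * ((1 / 2 + τ * I) + 2)))) (-1 / 4) (5 / 4) (-T n) (T n) =
      2 * Real.pi * I *
        ((∑ ρ ∈ (ntz_below_finite (T n)).toFinset,
          ((∑ k ∈ Finset.range (m ρ), b ρ k * ((1 / 2 + τ * I) - ρ) ^ (-(k + 1 : ℤ))) -
            (if 0 < m ρ then b ρ 0 else 0) / ((1 / 2 + τ * I) + 2))) -
          (if |τ| < T n then rightMellinExt g (1 / 2 + τ * I) / riemannZeta (1 / 2 + τ * I) else 0)) := by
  classical
  set Z : ℂ := 1 / 2 + τ * I with hZdef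
  set G : ℂ → ℂ := rightMellinExt g with hGdef
  set F : ℂ → ℂ := fun s ↦ G s / riemannZeta s with hFdef
  set κ : ℂ → ℂ := fun s ↦ (2 + s) / ((Z - s) * (Z + 2)) with hκdef
  set FZ : ℂ → ℂ := fun s ↦ F s * κ s with hFZdef
  have hTpos : 0 < T n := lt_of_le_of_lt (Nat.cast_nonneg n) (hT.2.1 n)
  have hZre : Z.re = 1 / 2 := by simp [hZdef]
  have hZim : Z.im = τ := by simp [hZdef]
  have hZ1 : Z ≠ 1 := fun h ↦ by have := congrArg Complex.re h; rw [hZre] at this; norm_num at this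
  have hZ2 : Z + 2 ≠ 0 := by
    intro h
    have h' := congrArg Complex.re h
    rw [hZdef] at h'
    norm_num at h'
  -- analyticity of the kernel off `Z`
  have hκa : ∀ s : ℂ, s ≠ Z → AnalyticAt ℂ κ s := fun s hs ↦
    (analyticAt_const.add analyticAt_id).div ((analyticAt_const.sub analyticAt_id).mul analyticAt_const)
      (mul_ne_zero (sub_ne_zero.2 (Ne.symm hs)) hZ2)
  -- analyticity of `F` off `1` and the zeros
  have hFa : ∀ s : ℂ, s ≠ 1 → riemannZeta s ≠ 0 → AnalyticAt ℂ F s := fun s hs1 hs0 ↦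
    ((hasRightMellinContinuation_rightMellinExt_of_mem_sonineL one_pos hg).1.analyticAt
      (isOpen_ne.mem_nhds hs1)).div (analyticAt_zeta hs1) hs0
  -- the finite set of poles
  set Zn : Finset ℂ := (ntz_below_finite (T n)).toFinset with hZn
  have hZnmem : ∀ ρ, ρ ∈ Zn ↔ ρ ∈ ZetaZeros.riemannZetaNontrivialZeros ∧ |ρ.im| < T n := fun ρ ↦ by
    simp [hZn]
  set S₀ : Finset ℂ := insert 1 Zn with hS₀
  set S' : Finset ℂ := if |τ| < T n then insert Z S₀ else S₀ with hS'
  have h1Zn : (1 : ℂ) ∉ Zn := by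
    intro h1
    have := mem_riemannZetaNontrivialZeros_iff_holds.1 ((hZnmem 1).1 h1).1
    exact riemannZeta_one_ne_zero this.1
  have hZZn : Z ∉ Zn := fun h ↦ hζ (mem_riemannZetaNontrivialZeros_iff_holds.1 ((hZnmem Z).1 h).1).1
  have hZS₀ : Z ∉ S₀ := by
    rw [hS₀, Finset.mem_insert, not_or]; exact ⟨hZ1, hZZn⟩
  have hS'sub : ∀ p ∈ S', p = Z ∨ p = 1 ∨ p ∈ Zn := by
    intro p hp
    rw [hS'] at hp
    split_ifs at hp with h
    · rcases Finset.mem_insert.1 hp with h' | h'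
      · exact Or.inl h'
      · rw [hS₀] at h'
        rcases Finset.mem_insert.1 h' with h'' | h''
        · exact Or.inr (Or.inl h'')
        · exact Or.inr (Or.inr h'')
    · rw [hS₀] at hp
      rcases Finset.mem_insert.1 hp with h'' | h''
      · exact Or.inr (Or.inl h'')
      · exact Or.inr (Or.inr h'')
  have hZS' : Z ∈ S' ↔ |τ| < T n := by
    rw [hS']
    split_ifs with h
    · simp [h]
    · simp only [h, iff_false]; exact hZS₀
  -- the regular point `s = 1`
  obtain ⟨Ψ, hΨa, hΨ⟩ := exists_analyticAt_one hg
  have hΨκa : AnalyticAt ℂ (fun s ↦ Ψ s * κ s) 1 := hΨa.mul (hκa 1 (Ne.symm hZ1))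
  have hnear1 : FZ =ᶠ[𝓝[≠] (1 : ℂ)] fun s ↦ Ψ s * κ s := by
    filter_upwards [hΨ] with s hs
    simp only [hFZdef, hFdef, hGdef] at hs ⊢
    rw [hs]
  have hres1 : residueAt FZ 1 = 0 := by
    have hd : ∀ᶠ z in 𝓝[≠] (1 : ℂ), DifferentiableAt ℂ (fun s ↦ Ψ s * κ s) z :=
      (hΨκa.eventually_analyticAt.mono fun z hz ↦ hz.differentiableAt).filter_mono nhdsWithin_le_nhds
    rw [residueAt_congr hd hnear1.symm]
    exact residueAt_of_analyticAt hΨκa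
  -- residues at the zeros
  have hresρ : ∀ ρ ∈ Zn, residueAt FZ ρ =
      (∑ k ∈ Finset.range (m ρ), b ρ k * (Z - ρ) ^ (-(k + 1 : ℤ))) -
        (if 0 < m ρ then b ρ 0 else 0) / (Z + 2) := by
    intro ρ hρ
    have hρ' := ((hZnmem ρ).1 hρ).1
    have hZρ : Z ≠ ρ := fun h ↦ hZZn (h ▸ hρ)
    obtain ⟨hHρ, hFρ⟩ := hPP ρ hρ'
    exact residueAt_mul_kernel_of_principalPart hHρ hZρ hZ2 hFρ
  -- residue at `Z`
  have hresZ : residueAt FZ Z = -F Z := by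
    have hfun : FZ = fun s ↦ (F s * ((2 + s) / (Z + 2))) / (Z - s) := by
      funext s
      simp only [hFZdef, hκdef]
      conv_rhs => rw [mul_div_assoc, div_div, mul_comm (Z + 2) (Z - s)]
    have hha : AnalyticAt ℂ (fun s ↦ F s * ((2 + s) / (Z + 2))) Z :=
      (hFa Z hZ1 hζ).mul ((analyticAt_const.add analyticAt_id).div analyticAt_const hZ2)
    rw [hfun, residueAt_div_sub_self hha]
    have : (2 + Z) / (Z + 2) = 1 := by rw [add_comm]; exact div_self hZ2
    rw [this, mul_one]
  -- pole neighbourhoods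
  have hV : ∀ p ∈ S', ∃ V : Set ℂ, IsOpen V ∧ p ∈ V ∧ ∀ z ∈ V, z ≠ p → DifferentiableAt ℂ FZ z := by
    intro p hp
    rcases hS'sub p hp with rfl | rfl | hpZ
    · -- `p = Z`
      have hev : ∀ᶠ z in 𝓝 Z, riemannZeta z ≠ 0 ∧ z ≠ 1 := by
        filter_upwards [(differentiableAt_riemannZeta hZ1).continuousAt.eventually_ne hζ,
          isOpen_ne.mem_nhds hZ1] with z h1 h2 using ⟨h1, h2⟩
      obtain ⟨V, hVsub, hVo, hpV⟩ := _root_.mem_nhds_iff.1 hev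
      refine ⟨V, hVo, hpV, fun z hz hzp ↦ ?_⟩
      exact ((hFa z (hVsub hz).2 (hVsub hz).1).mul (hκa z hzp)).differentiableAt
    · -- `p = 1`
      have hev : ∀ᶠ z in 𝓝 (1 : ℂ), (z ≠ 1 → FZ z = Ψ z * κ z) ∧ AnalyticAt ℂ (fun s ↦ Ψ s * κ s) z :=
        (eventually_nhdsWithin_iff.1 hnear1).and hΨκa.eventually_analyticAt
      obtain ⟨V, hVsub, hVo, h1V⟩ := _root_.mem_nhds_iff.1 hev
      refine ⟨V, hVo, h1V, fun z hz hz1 ↦ ?_⟩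
      have hev' : FZ =ᶠ[𝓝 z] fun s ↦ Ψ s * κ s := by
        filter_upwards [hVo.mem_nhds hz, isOpen_ne.mem_nhds hz1] with w hw hw1
        exact (hVsub hw).1 hw1
      exact (hVsub hz).2.differentiableAt.congr_of_eventuallyEq hev'
    · -- `p = ρ`, a zero
      have hρ' := ((hZnmem p).1 hpZ).1
      have hρ := mem_riemannZetaNontrivialZeros_iff_holds.1 hρ'
      have hρ1 : p ≠ 1 := fun h1 ↦ by rw [h1] at hρ; norm_num at hρ
      have hρZ : p ≠ Z := fun h ↦ hZZn (h ▸ hpZ)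
      have hev1 : ∀ᶠ z in 𝓝[≠] p, riemannZeta z ≠ 0 := by
        have h := (isDiscrete_iff_nhdsNE.1 isDiscrete_riemannZetaZeros) p hρ.1
        rw [Filter.inf_principal_eq_bot] at h
        filter_upwards [h] with z hz
        simpa [mem_riemannZetaZeros] using hz
      have hev : ∀ᶠ z in 𝓝 p, (z ≠ p → riemannZeta z ≠ 0) ∧ z ≠ 1 ∧ z ≠ Z := by
        filter_upwards [eventually_nhdsWithin_iff.1 hev1, isOpen_ne.mem_nhds hρ1,
          isOpen_ne.mem_nhds hρZ] with z h1 h2 h3 using ⟨h1, h2, h3⟩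
      obtain ⟨V, hVsub, hVo, hpV⟩ := _root_.mem_nhds_iff.1 hev
      refine ⟨V, hVo, hpV, fun z hz hzp ↦ ?_⟩
      have h' := hVsub hz
      exact ((hFa z h'.2.1 (h'.1 hzp)).mul (hκa z h'.2.2)).differentiableAt
  choose! V hVo hpV hVd using hV
  -- the residue theorem
  set U : Set ℂ := {z | AnalyticAt ℂ FZ z} ∪ ⋃ p ∈ S', V p with hU
  have hUo : IsOpen U := (isOpen_analyticAt ℂ FZ).union (isOpen_biUnion fun p hp ↦ hVo p hp)
  have key := BurnolResidueSum.rectBoundaryIntegral_eq_sum_residueAt (a := -1 / 4) (b := 5 / 4)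
    (c := -T n) (d := T n) (by norm_num) (by linarith) S' FZ U hUo ?_ ?_ ?_ ?_
  · rw [key]
    congr 1
    -- evaluate the sum of residues
    have hsumS₀ : ∑ p ∈ S₀, residueAt FZ p =
        ∑ ρ ∈ Zn, ((∑ k ∈ Finset.range (m ρ), b ρ k * (Z - ρ) ^ (-(k + 1 : ℤ))) -
          (if 0 < m ρ then b ρ 0 else 0) / (Z + 2)) := by
      rw [hS₀, Finset.sum_insert h1Zn, hres1, zero_add]
      exact Finset.sum_congr rfl hresρ
    rw [hS']
    split_ifs with hlt
    · rw [Finset.sum_insert hZS₀, hresZ, hsumS₀]; ring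
    · rw [hsumS₀]; ring
  · -- the closed rectangle lies in `U`
    intro z hz
    rw [mem_reProdIm] at hz
    by_cases hzS : z ∈ S'
    · exact Or.inr (mem_iUnion₂.2 ⟨z, hzS, hpV z hzS⟩)
    · left
      have hz1 : z ≠ 1 := fun h1 ↦ hzS (by
        rw [hS', h1]; split_ifs
        · exact Finset.mem_insert_of_mem (by rw [hS₀]; exact Finset.mem_insert_self _ _)
        · rw [hS₀]; exact Finset.mem_insert_self _ _)
      have hzre1 : -1 ≤ z.re := by linarith [hz.1.1]
      have hζz : riemannZeta z ≠ 0 := by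
        intro h0
        obtain ⟨hntz, -, -⟩ := mem_ntz_of_zero h0 hzre1
        have hne : |z.im| ≠ T n := fun habs ↦
          BurnolResidueSum.zeta_ne_zero_of_isInvZetaHeightSeq hT n habs hzre1 h0
        have hlt : |z.im| < T n := lt_of_le_of_ne (abs_le.2 hz.2) hne
        refine hzS ?_
        have hzZn : z ∈ Zn := (hZnmem z).2 ⟨hntz, hlt⟩
        rw [hS']; split_ifs
        · exact Finset.mem_insert_of_mem (by rw [hS₀]; exact Finset.mem_insert_of_mem hzZn)
        · rw [hS₀]; exact Finset.mem_insert_of_mem hzZn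
      have hzZ : z ≠ Z := by
        intro h
        have hτle : |τ| ≤ T n := by rw [← hZim, ← h]; exact abs_le.2 hz.2
        have hlt : |τ| < T n := lt_of_le_of_ne hτle hτ
        exact hzS (h ▸ (hZS'.2 hlt))
      exact (hFa z hz1 hζz).mul (hκa z hzZ)
  · -- poles inside the open rectangle
    intro p hp
    rw [mem_reProdIm]
    rcases hS'sub p (Finset.mem_coe.1 hp) with rfl | rfl | hpZ
    · have hlt : |τ| < T n := hZS'.1 (Finset.mem_coe.1 hp)
      refine ⟨⟨by rw [hZre]; norm_num, by rw [hZre]; norm_num⟩, ?_⟩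
      rw [hZim]; exact abs_lt.1 hlt
    · exact ⟨⟨by norm_num, by norm_num⟩, ⟨by simp; exact hTpos, by simp; exact hTpos⟩⟩
    · obtain ⟨hntz, hlt⟩ := (hZnmem p).1 hpZ
      have h := mem_riemannZetaNontrivialZeros_iff_holds.1 hntz
      exact ⟨⟨by linarith [h.2.1], by linarith [h.2.2]⟩, abs_lt.1 hlt⟩
  · -- differentiability on `U ∖ S'`
    intro z hz
    have hzS : z ∉ S' := fun h' ↦ hz.2 (Finset.mem_coe.2 h')
    rcases hz.1 with h' | h'
    · exact h'.differentiableAt.differentiableWithinAt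
    · obtain ⟨p, hp, hzp⟩ := mem_iUnion₂.1 h'
      exact (hVd p hp z hzp (fun h'' ↦ hzS (h'' ▸ hp))).differentiableWithinAt
  · -- meromorphy at the poles
    intro p hp
    rcases hS'sub p hp with rfl | rfl | hpZ
    · exact (hFa Z hZ1 hζ).meromorphicAt.mul
        (((analyticAt_const.add analyticAt_id).meromorphicAt).div
          (((analyticAt_const.sub analyticAt_id).mul analyticAt_const).meromorphicAt))
    · exact hΨκa.meromorphicAt.congr hnear1.symm
    · have hρ' := ((hZnmem p).1 hpZ).1
      have hρ := mem_riemannZetaNontrivialZeros_iff_holds.1 hρ'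
      have hρ1 : p ≠ 1 := fun h1 ↦ by rw [h1] at hρ; norm_num at hρ
      have hρZ : p ≠ Z := fun h ↦ hZZn (h ▸ hpZ)
      have hGa : AnalyticAt ℂ G p :=
        (hasRightMellinContinuation_rightMellinExt_of_mem_sonineL one_pos hg).1.analyticAt
          (isOpen_ne.mem_nhds hρ1)
      exact (hGa.meromorphicAt.div (analyticAt_zeta hρ1).meromorphicAt).mul (hκa p hρZ).meromorphicAt

/-- **The partial sums on the critical line** (`Z = ½ + iτ` not a zero, `|τ| ≠ T_n`):
`S_n(Z) = ζ(Z)·(2πi)⁻¹·∮_{∂([−¼,5/4]×[−T_n,T_n])} G(s)/ζ(s)·(2+s)/((Z−s)(Z+2)) ds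
  + c_n·ζ(Z)/(Z+2) + 𝟙_{|τ|<T_n}·G(Z)`, `c_n` the Prop. 5.4 partial sum.
[cite: Burnol2004b, proof of Thm. 5.2 (arXiv:math/0203120v7 pp. 12–13, TeX l.1012–1029, 1060–1075)] -/
theorem partialSum_line_eq (hT : IsInvZetaHeightSeq A T) (hg : g ∈ sonineL 1)
    (n : ℕ) {τ : ℝ} (hζ : riemannZeta (1 / 2 + τ * I) ≠ 0) (hτ : |τ| ≠ T n) :
    burnolResiduePartialSum (rightMellinExt g) T n (1 / 2 + τ * I) =
      riemannZeta (1 / 2 + τ * I) * (2 * Real.pi * I)⁻¹ *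
          rectBoundaryIntegral (fun s ↦ rightMellinExt g s / riemannZeta s *
            ((2 + s) / (((1 / 2 + τ * I) - s) * ((1 / 2 + τ * I) + 2)))) (-1 / 4) (5 / 4) (-T n) (T n) +
        burnolInvZetaResiduePartialSum (rightMellinExt g) T n *
          (riemannZeta (1 / 2 + τ * I) / ((1 / 2 + τ * I) + 2)) +
        (if |τ| < T n then rightMellinExt g (1 / 2 + τ * I) else 0) := by
  classical
  obtain ⟨m, b, H, hPP⟩ := exists_principalParts hg
  have hZ2 : (1 / 2 + τ * I : ℂ) + 2 ≠ 0 := by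
    intro h
    have h' := congrArg Complex.re h
    norm_num at h'
  have h2πI : (2 * Real.pi * I : ℂ) ≠ 0 := by simp [Real.pi_pos.ne', I_ne_zero]
  rw [partialSum_eq_zeta_mul_sum hPP n hζ, rectBoundaryIntegral_kernel_eq hT hg hPP n hζ hτ,
    invZetaPartialSum_eq_sum (T := T) hPP n, Finset.sum_sub_distrib, ← Finset.sum_div]
  set P : ℂ := ∑ ρ ∈ (ntz_below_finite (T n)).toFinset,
    ∑ k ∈ Finset.range (m ρ), b ρ k * ((1 / 2 + τ * I : ℂ) - ρ) ^ (-(k + 1 : ℤ)) with hP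
  set R : ℂ := ∑ ρ ∈ (ntz_below_finite (T n)).toFinset, (if 0 < m ρ then b ρ 0 else 0) with hR
  set Z : ℂ := 1 / 2 + τ * I with hZ
  have e1 : ∀ X : ℂ, riemannZeta Z * (2 * Real.pi * I)⁻¹ * (2 * Real.pi * I * X) = riemannZeta Z * X := by
    intro X; field_simp
  rw [e1]
  split_ifs with hlt
  · field_simp
    ring
  · field_simp
    ring

end Formula


/-! ## §D. `L²(dτ)` bounds for the boundary integrals -/

/-- `eLpNorm f 2 = (∫⁻ ‖f‖ₑ²)^{1/2}`. [folklore] -/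
private theorem eLpNorm_two_eq {f : ℝ → ℂ} :
    eLpNorm f 2 volume = (∫⁻ τ, ‖f τ‖ₑ ^ 2) ^ (1 / 2 : ℝ) := by
  rw [eLpNorm_eq_lintegral_rpow_enorm_toReal (by norm_num) (by norm_num)]
  simp only [ENNReal.toReal_ofNat, ENNReal.rpow_two, one_div]

/-- `((t)²)^{1/2} = t` in `ℝ≥0∞`. [folklore] -/
private theorem ENNReal_sq_rpow_half (t : ℝ≥0∞) : (t ^ 2) ^ (1 / 2 : ℝ) = t := by
  rw [← ENNReal.rpow_two, ← ENNReal.rpow_mul]; norm_num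

/-- `(t^{1/2})² = t` in `ℝ≥0∞`. [folklore] -/
private theorem ENNReal_rpow_half_sq (t : ℝ≥0∞) : (t ^ (1 / 2 : ℝ)) ^ 2 = t := by
  rw [← ENNReal.rpow_two, ← ENNReal.rpow_mul]; norm_num

/-- **The kernel bound**: for `Re s ≠ ½`,
`∫⁻_τ ‖ζ(Z)·(2+s)/((Z−s)(Z+2))‖ₑ² dτ ≤ 144π‖2+s‖²/|½ − Re s|` (`Z = ½ + iτ`): `|ζ(Z)/(Z+2)| ≤ 12` and
`∫ dτ/|Z−s|² = π/|½ − Re s|`. [cite: Burnol2004b, proof of Thm. 5.2 (arXiv:math/0203120v7 p. 13, TeX l.1106–1118)] -/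
theorem lintegral_kernel_sq_le (s : ℂ) (hs : s.re ≠ 1 / 2) :
    ∫⁻ τ : ℝ, ‖riemannZeta (1 / 2 + τ * I) *
        ((2 + s) / (((1 / 2 + τ * I) - s) * ((1 / 2 + τ * I) + 2)))‖ₑ ^ 2 ≤
      ENNReal.ofReal (144 * π * ‖2 + s‖ ^ 2 / |1 / 2 - s.re|) := by
  have ha : (1 / 2 - s.re) ≠ 0 := sub_ne_zero.2 (Ne.symm hs)
  have hpt : ∀ τ : ℝ, ‖riemannZeta (1 / 2 + τ * I) *
      ((2 + s) / (((1 / 2 + τ * I) - s) * ((1 / 2 + τ * I) + 2)))‖ₑ ^ 2 ≤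
      ENNReal.ofReal (144 * ‖2 + s‖ ^ 2) *
        ENNReal.ofReal (((1 / 2 - s.re) ^ 2 + (τ - s.im) ^ 2)⁻¹) := by
    intro τ
    set Z : ℂ := 1 / 2 + τ * I with hZ
    have hZ2 : Z + 2 ≠ 0 := by
      intro h; have h' := congrArg Complex.re h; rw [hZ] at h'; norm_num at h'
    have hZs : Z - s ≠ 0 := by
      intro h; have h' := congrArg Complex.re h; rw [hZ] at h'; simp at h'
      exact hs (by linarith)
    have hnormZs : ‖Z - s‖ ^ 2 = (1 / 2 - s.re) ^ 2 + (τ - s.im) ^ 2 := by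
      rw [Complex.sq_norm, Complex.normSq_apply, hZ]; simp; ring
    have heq : riemannZeta Z * ((2 + s) / ((Z - s) * (Z + 2))) =
        (riemannZeta Z / (Z + 2)) * ((2 + s) / (Z - s)) := by
      field_simp
    have h12 := norm_zeta_div_le τ
    rw [← hZ] at h12
    have hn : ‖riemannZeta Z * ((2 + s) / ((Z - s) * (Z + 2)))‖ ≤ 12 * ‖2 + s‖ / ‖Z - s‖ := by
      rw [heq, norm_mul, mul_div_assoc, ← norm_div]
      gcongr
    have hpos : 0 < ‖Z - s‖ := norm_pos_iff.2 hZs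
    rw [← ofReal_norm, ← ENNReal.ofReal_pow (norm_nonneg _), ← ENNReal.ofReal_mul (by positivity)]
    refine ENNReal.ofReal_le_ofReal ?_
    calc ‖riemannZeta Z * ((2 + s) / ((Z - s) * (Z + 2)))‖ ^ 2 ≤ (12 * ‖2 + s‖ / ‖Z - s‖) ^ 2 := by
          gcongr
      _ = 144 * ‖2 + s‖ ^ 2 * (‖Z - s‖ ^ 2)⁻¹ := by
          field_simp; ring
      _ = _ := by rw [hnormZs]
  calc ∫⁻ τ : ℝ, ‖riemannZeta (1 / 2 + τ * I) *
        ((2 + s) / (((1 / 2 + τ * I) - s) * ((1 / 2 + τ * I) + 2)))‖ₑ ^ 2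
      ≤ ∫⁻ τ : ℝ, ENNReal.ofReal (144 * ‖2 + s‖ ^ 2) *
          ENNReal.ofReal (((1 / 2 - s.re) ^ 2 + (τ - s.im) ^ 2)⁻¹) := lintegral_mono hpt
    _ = ENNReal.ofReal (144 * ‖2 + s‖ ^ 2) * ENNReal.ofReal (π / |1 / 2 - s.re|) := by
        rw [lintegral_const_mul' _ _ ENNReal.ofReal_ne_top, lintegral_inv_sq_add_sq ha]
    _ = ENNReal.ofReal (144 * π * ‖2 + s‖ ^ 2 / |1 / 2 - s.re|) := by
        rw [← ENNReal.ofReal_mul (by positivity)]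
        congr 1; ring

/-- Joint measurability of the kernel `(x, τ) ↦ ζ(Z_τ)(2+s_x)/((Z_τ−s_x)(Z_τ+2))` along a parametrised
line `x ↦ s_x`. [folklore] -/
private theorem measurable_kernel {ℓ : ℝ → ℂ} (hℓ : Continuous ℓ) :
    Measurable (Function.uncurry fun (x τ : ℝ) ↦ riemannZeta (1 / 2 + τ * I) *
      ((2 + ℓ x) / (((1 / 2 + τ * I) - ℓ x) * ((1 / 2 + τ * I) + 2)))) := by
  have h1 : Measurable fun p : ℝ × ℝ ↦ riemannZeta (1 / 2 + p.2 * I) :=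
    measurable_zeta.comp (by fun_prop)
  have h2 : Measurable fun p : ℝ × ℝ ↦ (2 + ℓ p.1) / (((1 / 2 + p.2 * I) - ℓ p.1) * ((1 / 2 + p.2 * I) + 2)) :=
    (Continuous.measurable (by fun_prop)).div (Continuous.measurable (by fun_prop))
  exact h1.mul h2

/-- `‖2 + (x + iy)‖ ≤ 4 + |y|` for `|x| ≤ 2`. [folklore] -/
private theorem norm_two_add_le {x y : ℝ} (hx : |x| ≤ 2) : ‖(2 : ℂ) + (x + y * I)‖ ≤ 4 + |y| := by
  have h1 : ‖(2 : ℂ) + (x + y * I)‖ ≤ ‖(2 : ℂ) + x‖ + ‖(y : ℂ) * I‖ := by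
    rw [← add_assoc]; exact norm_add_le _ _
  have h2 : ‖(2 : ℂ) + x‖ = |2 + x| := by
    rw [show (2 : ℂ) + x = ((2 + x : ℝ) : ℂ) by push_cast; rfl, Complex.norm_real, Real.norm_eq_abs]
  have h3 : ‖(y : ℂ) * I‖ = |y| := by simp
  have h4 : |2 + x| ≤ 4 := by
    have := abs_add_le (2 : ℝ) x
    norm_num at this
    linarith
  linarith

/-- The weight `W = ∫⁻_{[−¼,5/4]} |x − ½|^{−1/2} dx` is finite. [folklore] -/
private theorem weight_lt_top :
    ∫⁻ x in Icc (-1 / 4 : ℝ) (5 / 4), ENNReal.ofReal (|x - 1 / 2| ^ (-(1 / 2 : ℝ))) < ∞ :=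
  lintegral_abs_sub_rpow_neg_lt_top (by norm_num) (by norm_num) (by norm_num)

/-- **Horizontal edges.** For `φ` measurable with `‖φ‖ ≤ M` on `(−¼, 5/4]` and any height `y`,
`‖τ ↦ ζ(Z)·∫_{−¼}^{5/4} φ(x)·(2+s)/((Z−s)(Z+2)) dx‖_{L²(dτ)} ≤ 12√π·M·(4+|y|)·W` (`s = x+iy`): Cauchy–Schwarz
in `x` with the weight `|x−½|^{∓1/2}` against `∫dτ/|Z−s|² = π/|½−x|`, whose singularity at the crossing
point `x = ½` is integrable. [cite: Burnol2004b, proof of Thm. 5.2 (arXiv:math/0203120v7 p. 13, TeX l.1095–1120)] -/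
theorem eLpNorm_horizontal_le {φ : ℝ → ℂ} {M : ℝ} (hM : 0 ≤ M)
    (hφM : ∀ x ∈ Ioc (-1 / 4 : ℝ) (5 / 4), ‖φ x‖ ≤ M) (y : ℝ) :
    eLpNorm (fun τ : ℝ ↦ riemannZeta (1 / 2 + τ * I) *
        ∫ x in (-1 / 4 : ℝ)..(5 / 4), φ x *
          ((2 + (x + y * I)) / (((1 / 2 + τ * I) - (x + y * I)) * ((1 / 2 + τ * I) + 2)))) 2 volume ≤
      ENNReal.ofReal (12 * Real.sqrt π * M * (4 + |y|)) *
        ∫⁻ x in Icc (-1 / 4 : ℝ) (5 / 4), ENNReal.ofReal (|x - 1 / 2| ^ (-(1 / 2 : ℝ))) := by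
  set W := ∫⁻ x in Icc (-1 / 4 : ℝ) (5 / 4), ENNReal.ofReal (|x - 1 / 2| ^ (-(1 / 2 : ℝ))) with hW
  set μ : Measure ℝ := volume.restrict (Ioc (-1 / 4 : ℝ) (5 / 4)) with hμ
  set k : ℝ → ℝ → ℂ := fun x τ ↦ riemannZeta (1 / 2 + τ * I) *
    ((2 + (x + y * I)) / (((1 / 2 + τ * I) - (x + y * I)) * ((1 / 2 + τ * I) + 2))) with hk
  have hk_meas : Measurable (Function.uncurry k) := measurable_kernel (ℓ := fun x : ℝ ↦ (x + y * I : ℂ))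
    (by fun_prop)
  -- rewrite the function as a `μ`-integral of `φ x * k x τ`
  have hfun : (fun τ : ℝ ↦ riemannZeta (1 / 2 + τ * I) *
      ∫ x in (-1 / 4 : ℝ)..(5 / 4), φ x *
        ((2 + (x + y * I)) / (((1 / 2 + τ * I) - (x + y * I)) * ((1 / 2 + τ * I) + 2)))) =
      fun τ ↦ ∫ x, φ x * k x τ ∂μ := by
    funext τ
    rw [intervalIntegral.integral_of_le (by norm_num), ← integral_const_mul]
    refine integral_congr_ae (ae_of_all _ fun x ↦ ?_)
    simp only [hk]; ring
  rw [hfun, eLpNorm_two_eq]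
  -- the weights
  set a : ℝ → ℝ≥0∞ := fun x ↦ ENNReal.ofReal (M * |x - 1 / 2| ^ (-(1 / 4 : ℝ))) with ha
  set b : ℝ → ℝ≥0∞ := fun x ↦ ENNReal.ofReal (|x - 1 / 2| ^ (1 / 4 : ℝ)) with hb
  have ha_meas : Measurable a := by
    refine ENNReal.measurable_ofReal.comp ?_
    exact measurable_const.mul ((continuous_abs.measurable.comp (measurable_id.sub_const _)).pow_const _)
  have hb_meas : Measurable b :=
    ENNReal.measurable_ofReal.comp ((continuous_abs.measurable.comp (measurable_id.sub_const _)).pow_const _)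
  have hne : ∀ᵐ x ∂μ, x ≠ 1 / 2 := by
    have : (volume : Measure ℝ) {1 / 2} = 0 := measure_singleton _
    exact ae_restrict_of_ae (by
      filter_upwards [measure_eq_zero_iff_ae_notMem.1 this] with u hu
      simpa using hu)
  have hfab : ∀ᵐ x ∂μ, ‖φ x‖ₑ ≤ a x * b x := by
    filter_upwards [hne, ae_restrict_mem measurableSet_Ioc] with x hx hxI
    have hpos : 0 < |x - 1 / 2| := abs_pos.2 (sub_ne_zero.2 hx)
    rw [ha, hb]
    simp only
    rw [← ENNReal.ofReal_mul (by positivity), mul_assoc, ← Real.rpow_add hpos]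
    norm_num
    rw [← ofReal_norm]
    exact ENNReal.ofReal_le_ofReal (hφM x hxI)
  -- Cauchy–Schwarz + Tonelli (a.e. version)
  have hCS : ∫⁻ τ, ‖∫ x, φ x * k x τ ∂μ‖ₑ ^ 2 ≤
      (∫⁻ x, a x ^ 2 ∂μ) * ∫⁻ x, b x ^ 2 * (∫⁻ τ, ‖k x τ‖ₑ ^ 2) ∂μ := by
    -- modify `φ` on a null set so that the pointwise hypothesis holds everywhere
    have h := lintegral_norm_integral_mul_sq_le (μ := μ) (ν := volume) (f := fun x ↦
      if ‖φ x‖ₑ ≤ a x * b x then φ x else 0) (k := k) ha_meas hb_meas hk_meas (fun x ↦ by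
        split_ifs with h
        · exact h
        · simp)
    have hae : (fun x ↦ (if ‖φ x‖ₑ ≤ a x * b x then φ x else 0)) =ᵐ[μ] φ := by
      filter_upwards [hfab] with x hx
      rw [if_pos hx]
    have hint : ∀ τ, ∫ x, (if ‖φ x‖ₑ ≤ a x * b x then φ x else 0) * k x τ ∂μ = ∫ x, φ x * k x τ ∂μ :=
      fun τ ↦ integral_congr_ae (by filter_upwards [hae] with x hx; rw [hx])
    simpa only [hint] using h
  -- the two factors
  have hA : ∫⁻ x, a x ^ 2 ∂μ ≤ ENNReal.ofReal (M ^ 2) * W := by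
    have h1 : ∀ᵐ x ∂μ, a x ^ 2 = ENNReal.ofReal (M ^ 2) * ENNReal.ofReal (|x - 1 / 2| ^ (-(1 / 2 : ℝ))) := by
      filter_upwards [hne] with x hx
      have hpos : 0 < |x - 1 / 2| := abs_pos.2 (sub_ne_zero.2 hx)
      rw [ha]
      simp only
      rw [← ENNReal.ofReal_pow (by positivity), mul_pow,
        ← Real.rpow_natCast (|x - 1 / 2| ^ (-(1 / 4 : ℝ))) 2, ← Real.rpow_mul hpos.le,
        show (-(1 / 4 : ℝ)) * ((2 : ℕ) : ℝ) = -(1 / 2 : ℝ) by norm_num, ENNReal.ofReal_mul (by positivity)]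
    rw [lintegral_congr_ae h1, lintegral_const_mul' _ _ ENNReal.ofReal_ne_top, hW]
    gcongr
    exact Measure.restrict_mono Ioc_subset_Icc_self le_rfl
  have hB : ∫⁻ x, b x ^ 2 * (∫⁻ τ, ‖k x τ‖ₑ ^ 2) ∂μ ≤ ENNReal.ofReal (144 * π * (4 + |y|) ^ 2) * W := by
    have h1 : ∀ᵐ x ∂μ, b x ^ 2 * (∫⁻ τ, ‖k x τ‖ₑ ^ 2) ≤
        ENNReal.ofReal (144 * π * (4 + |y|) ^ 2) * ENNReal.ofReal (|x - 1 / 2| ^ (-(1 / 2 : ℝ))) := by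
      filter_upwards [hne, ae_restrict_mem measurableSet_Ioc] with x hx hxI
      have hpos : 0 < |x - 1 / 2| := abs_pos.2 (sub_ne_zero.2 hx)
      have hxre : ((x : ℂ) + y * I).re ≠ 1 / 2 := by simpa using hx
      have hker := lintegral_kernel_sq_le ((x : ℂ) + y * I) hxre
      have hx2 : |x| ≤ 2 := abs_le.2 ⟨by linarith [hxI.1], by linarith [hxI.2]⟩
      have hns : ‖(2 : ℂ) + (x + y * I)‖ ≤ 4 + |y| := norm_two_add_le hx2
      have hre : |1 / 2 - ((x : ℂ) + y * I).re| = |x - 1 / 2| := by simp [abs_sub_comm]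
      rw [hre] at hker
      have hid : |x - 1 / 2| ^ (1 / 2 : ℝ) * (144 * π * (4 + |y|) ^ 2 / |x - 1 / 2|) =
          144 * π * (4 + |y|) ^ 2 * |x - 1 / 2| ^ (-(1 / 2 : ℝ)) := by
        have : |x - 1 / 2| ^ (-(1 / 2 : ℝ)) = |x - 1 / 2| ^ (1 / 2 : ℝ) / |x - 1 / 2| := by
          rw [show (-(1 / 2 : ℝ)) = (1 / 2 : ℝ) - 1 by norm_num, Real.rpow_sub hpos, Real.rpow_one]
        rw [this]; ring
      calc b x ^ 2 * ∫⁻ τ, ‖k x τ‖ₑ ^ 2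
          ≤ b x ^ 2 * ENNReal.ofReal (144 * π * ‖(2 : ℂ) + (x + y * I)‖ ^ 2 / |x - 1 / 2|) := by
            gcongr
        _ ≤ b x ^ 2 * ENNReal.ofReal (144 * π * (4 + |y|) ^ 2 / |x - 1 / 2|) := by
            gcongr
        _ = ENNReal.ofReal (144 * π * (4 + |y|) ^ 2) * ENNReal.ofReal (|x - 1 / 2| ^ (-(1 / 2 : ℝ))) := by
            rw [hb]
            simp only
            rw [← ENNReal.ofReal_pow (by positivity), ← Real.rpow_natCast (|x - 1 / 2| ^ (1 / 4 : ℝ)) 2,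
              ← Real.rpow_mul hpos.le, show ((1 / 4 : ℝ) * ((2 : ℕ) : ℝ)) = 1 / 2 by norm_num,
              ← ENNReal.ofReal_mul (by positivity), hid, ENNReal.ofReal_mul (by positivity)]
    calc ∫⁻ x, b x ^ 2 * (∫⁻ τ, ‖k x τ‖ₑ ^ 2) ∂μ
        ≤ ∫⁻ x, ENNReal.ofReal (144 * π * (4 + |y|) ^ 2) *
            ENNReal.ofReal (|x - 1 / 2| ^ (-(1 / 2 : ℝ))) ∂μ := lintegral_mono_ae h1
      _ = ENNReal.ofReal (144 * π * (4 + |y|) ^ 2) *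
            ∫⁻ x, ENNReal.ofReal (|x - 1 / 2| ^ (-(1 / 2 : ℝ))) ∂μ :=
          lintegral_const_mul' _ _ ENNReal.ofReal_ne_top
      _ ≤ ENNReal.ofReal (144 * π * (4 + |y|) ^ 2) * W := by
          rw [hW]; gcongr; exact Measure.restrict_mono Ioc_subset_Icc_self le_rfl
  -- assemble
  have hsq : ∫⁻ τ, ‖∫ x, φ x * k x τ ∂μ‖ₑ ^ 2 ≤
      (ENNReal.ofReal (12 * Real.sqrt π * M * (4 + |y|)) * W) ^ 2 := by
    refine hCS.trans ((mul_le_mul' hA hB).trans (le_of_eq ?_))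
    have hπ : 0 ≤ Real.sqrt π := Real.sqrt_nonneg _
    rw [mul_pow, ← ENNReal.ofReal_pow (by positivity), mul_mul_mul_comm, ← ENNReal.ofReal_mul (by positivity),
      ← pow_two]
    congr 2
    have : Real.sqrt π ^ 2 = π := Real.sq_sqrt Real.pi_pos.le
    rw [show (12 * Real.sqrt π * M * (4 + |y|)) ^ 2 = 144 * Real.sqrt π ^ 2 * M ^ 2 * (4 + |y|) ^ 2 by ring,
      this]
    ring
  calc (∫⁻ τ, ‖∫ x, φ x * k x τ ∂μ‖ₑ ^ 2) ^ (1 / 2 : ℝ)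
      ≤ ((ENNReal.ofReal (12 * Real.sqrt π * M * (4 + |y|)) * W) ^ 2) ^ (1 / 2 : ℝ) := by gcongr
    _ = _ := ENNReal_sq_rpow_half _

/-- **Vertical edges.** For `φ` measurable, `S` measurable, `x₀` with `|½ − x₀| ≥ ¾`, `|x₀| ≤ 2`, and
`‖φ‖(4+|y|)²` integrable on `S`:
`‖τ ↦ ζ(Z)·∫_S φ(y)(2+s)/((Z−s)(Z+2)) dy‖_{L²(dτ)} ≤ √(192π)·∫_S ‖φ(y)‖(4+|y|)² dy` (`s = x₀+iy`): Cauchy–Schwarz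
in `y` with the weight `‖φ‖(4+|y|)^{±2}` ("the Cauchy–Schwarz inequality", printed for the far vertical
lines). [cite: Burnol2004b, proof of Thm. 5.2 (arXiv:math/0203120v7 p. 12–13, TeX l.1035–1045, 1106–1120)] -/
theorem eLpNorm_vertical_le {φ : ℝ → ℂ} (hφ : Measurable φ) {x₀ : ℝ} (hx₀ : 3 / 4 ≤ |1 / 2 - x₀|)
    (hx₀' : |x₀| ≤ 2) {S : Set ℝ} (_hS : MeasurableSet S)
    (hint : IntegrableOn (fun y ↦ ‖φ y‖ * (4 + |y|) ^ 2) S) :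
    eLpNorm (fun τ : ℝ ↦ riemannZeta (1 / 2 + τ * I) *
        ∫ y in S, φ y *
          ((2 + (x₀ + y * I)) / (((1 / 2 + τ * I) - (x₀ + y * I)) * ((1 / 2 + τ * I) + 2)))) 2 volume ≤
      ENNReal.ofReal (Real.sqrt (192 * π) * ∫ y in S, ‖φ y‖ * (4 + |y|) ^ 2) := by
  set μ : Measure ℝ := volume.restrict S with hμ
  set k : ℝ → ℝ → ℂ := fun y τ ↦ riemannZeta (1 / 2 + τ * I) *
    ((2 + (x₀ + y * I)) / (((1 / 2 + τ * I) - (x₀ + y * I)) * ((1 / 2 + τ * I) + 2))) with hk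
  have hk_meas : Measurable (Function.uncurry k) := measurable_kernel (ℓ := fun y : ℝ ↦ ((x₀ : ℂ) + y * I))
    (by fun_prop)
  have hfun : (fun τ : ℝ ↦ riemannZeta (1 / 2 + τ * I) *
      ∫ y in S, φ y *
        ((2 + (x₀ + y * I)) / (((1 / 2 + τ * I) - (x₀ + y * I)) * ((1 / 2 + τ * I) + 2)))) =
      fun τ ↦ ∫ y, φ y * k y τ ∂μ := by
    funext τ
    rw [← integral_const_mul]
    refine integral_congr_ae (ae_of_all _ fun y ↦ ?_)
    simp only [hk]; ring
  rw [hfun, eLpNorm_two_eq]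
  -- weights
  set w : ℝ → ℝ≥0∞ := fun y ↦ ENNReal.ofReal ((4 + |y|) ^ 2) with hw
  have hw_meas : Measurable w := ENNReal.measurable_ofReal.comp (by fun_prop)
  have hw0 : ∀ y, w y ≠ 0 := fun y ↦ by
    rw [hw]; simp only [ne_eq, ENNReal.ofReal_eq_zero, not_le]; positivity
  have hwtop : ∀ y, w y ≠ ∞ := fun y ↦ ENNReal.ofReal_ne_top
  have hw1 : ∀ y, 1 ≤ w y := fun y ↦ by
    rw [hw]; simp only
    rw [← ENNReal.ofReal_one]
    exact ENNReal.ofReal_le_ofReal (by nlinarith [abs_nonneg y])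
  have hφe : Measurable fun y ↦ ‖φ y‖ₑ := hφ.enorm
  set a : ℝ → ℝ≥0∞ := fun y ↦ (‖φ y‖ₑ * w y) ^ (1 / 2 : ℝ) with ha
  set b : ℝ → ℝ≥0∞ := fun y ↦ (‖φ y‖ₑ * (w y)⁻¹) ^ (1 / 2 : ℝ) with hb
  have ha_meas : Measurable a := (hφe.mul hw_meas).pow_const _
  have hb_meas : Measurable b := (hφe.mul hw_meas.inv).pow_const _
  have hfab : ∀ y, ‖φ y‖ₑ ≤ a y * b y := by
    intro y
    rw [ha, hb]
    simp only
    rw [← ENNReal.mul_rpow_of_nonneg _ _ (by norm_num : (0 : ℝ) ≤ 1 / 2), mul_mul_mul_comm,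
      ENNReal.mul_inv_cancel (hw0 y) (hwtop y), mul_one, ← pow_two, ENNReal_sq_rpow_half]
  have hCS := lintegral_norm_integral_mul_sq_le (μ := μ) (ν := volume) (f := φ) (k := k)
    ha_meas hb_meas hk_meas hfab
  -- the factors
  set J : ℝ≥0∞ := ∫⁻ y, ‖φ y‖ₑ * w y ∂μ with hJ
  have hA : ∫⁻ y, a y ^ 2 ∂μ = J := by
    rw [hJ]; refine lintegral_congr fun y ↦ ?_
    rw [ha]; simp only; rw [ENNReal_rpow_half_sq]
  have hB : ∫⁻ y, b y ^ 2 * (∫⁻ τ, ‖k y τ‖ₑ ^ 2) ∂μ ≤ ENNReal.ofReal (192 * π) * J := by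
    have h1 : ∀ y, b y ^ 2 * (∫⁻ τ, ‖k y τ‖ₑ ^ 2) ≤ ENNReal.ofReal (192 * π) * ‖φ y‖ₑ := by
      intro y
      have hre : ((x₀ : ℂ) + y * I).re ≠ 1 / 2 := by
        simp; intro h; rw [h] at hx₀; norm_num at hx₀
      have hker := lintegral_kernel_sq_le ((x₀ : ℂ) + y * I) hre
      have hre' : |1 / 2 - ((x₀ : ℂ) + y * I).re| = |1 / 2 - x₀| := by simp
      rw [hre'] at hker
      have hns : ‖(2 : ℂ) + (x₀ + y * I)‖ ≤ 4 + |y| := norm_two_add_le hx₀'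
      have hker' : ∫⁻ τ, ‖k y τ‖ₑ ^ 2 ≤ ENNReal.ofReal (192 * π) * w y := by
        refine hker.trans ?_
        rw [hw]; simp only
        rw [← ENNReal.ofReal_mul (by positivity)]
        refine ENNReal.ofReal_le_ofReal ?_
        rw [div_le_iff₀ (by linarith)]
        have h34 : 0 < |1 / 2 - x₀| := by linarith
        calc 144 * π * ‖(2 : ℂ) + (x₀ + y * I)‖ ^ 2 ≤ 144 * π * (4 + |y|) ^ 2 := by gcongr
          _ = 192 * π * (4 + |y|) ^ 2 * (3 / 4) := by ring
          _ ≤ 192 * π * (4 + |y|) ^ 2 * |1 / 2 - x₀| := by gcongr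
      calc b y ^ 2 * (∫⁻ τ, ‖k y τ‖ₑ ^ 2) ≤ b y ^ 2 * (ENNReal.ofReal (192 * π) * w y) := by gcongr
        _ = ENNReal.ofReal (192 * π) * ‖φ y‖ₑ := by
            rw [hb]; simp only; rw [ENNReal_rpow_half_sq]
            rw [mul_comm (ENNReal.ofReal _) (w y), ← mul_assoc, mul_assoc (‖φ y‖ₑ),
              ENNReal.inv_mul_cancel (hw0 y) (hwtop y), mul_one, mul_comm]
    calc ∫⁻ y, b y ^ 2 * (∫⁻ τ, ‖k y τ‖ₑ ^ 2) ∂μ ≤ ∫⁻ y, ENNReal.ofReal (192 * π) * ‖φ y‖ₑ ∂μ :=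
          lintegral_mono h1
      _ ≤ ∫⁻ y, ENNReal.ofReal (192 * π) * (‖φ y‖ₑ * w y) ∂μ :=
          lintegral_mono fun y ↦ mul_le_mul' le_rfl (le_mul_of_one_le_right' (hw1 y))
      _ = ENNReal.ofReal (192 * π) * J := by rw [lintegral_const_mul' _ _ ENNReal.ofReal_ne_top]
  -- `J` as a real integral
  have hJreal : J = ENNReal.ofReal (∫ y in S, ‖φ y‖ * (4 + |y|) ^ 2) := by
    rw [hJ, ofReal_integral_eq_lintegral_ofReal hint (ae_of_all _ fun y ↦ by positivity)]
    refine lintegral_congr fun y ↦ ?_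
    rw [hw]; simp only
    rw [← ofReal_norm, ← ENNReal.ofReal_mul (norm_nonneg _)]
  have hsq : ∫⁻ τ, ‖∫ y, φ y * k y τ ∂μ‖ₑ ^ 2 ≤
      (ENNReal.ofReal (Real.sqrt (192 * π) * ∫ y in S, ‖φ y‖ * (4 + |y|) ^ 2)) ^ 2 := by
    refine hCS.trans ?_
    rw [hA]
    refine (mul_le_mul' le_rfl hB).trans (le_of_eq ?_)
    have hI : 0 ≤ ∫ y in S, ‖φ y‖ * (4 + |y|) ^ 2 := integral_nonneg fun y ↦ by positivity
    rw [hJreal, ← mul_assoc, mul_comm (ENNReal.ofReal _) (ENNReal.ofReal (192 * π)),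
      ← ENNReal.ofReal_mul (by positivity), ← ENNReal.ofReal_mul (by positivity),
      ← ENNReal.ofReal_pow (by positivity)]
    congr 1
    have : Real.sqrt (192 * π) ^ 2 = 192 * π := Real.sq_sqrt (by positivity)
    rw [mul_pow, this]; ring
  calc (∫⁻ τ, ‖∫ y, φ y * k y τ ∂μ‖ₑ ^ 2) ^ (1 / 2 : ℝ)
      ≤ ((ENNReal.ofReal (Real.sqrt (192 * π) * ∫ y in S, ‖φ y‖ * (4 + |y|) ^ 2)) ^ 2) ^ (1 / 2 : ℝ) := by
        gcongr
    _ = _ := ENNReal_sq_rpow_half _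

/-- Measurability in `τ` of the boundary integrals (`x ↦ s_x` a continuous parametrisation, `μ` an
s-finite measure on the parameter). [folklore] -/
private theorem aestronglyMeasurable_zeta_mul_integral {φ : ℝ → ℂ} (hφ : Measurable φ) {ℓ : ℝ → ℂ}
    (hℓ : Continuous ℓ) (μ : Measure ℝ) [SFinite μ] :
    AEStronglyMeasurable (fun τ : ℝ ↦ riemannZeta (1 / 2 + τ * I) *
      ∫ x, φ x * ((2 + ℓ x) / (((1 / 2 + τ * I) - ℓ x) * ((1 / 2 + τ * I) + 2))) ∂μ) volume := by
  have h1 : Measurable fun τ : ℝ ↦ riemannZeta (1 / 2 + τ * I) := measurable_zeta.comp (by fun_prop)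
  have h2 : StronglyMeasurable (Function.uncurry fun (τ x : ℝ) ↦ φ x *
      ((2 + ℓ x) / (((1 / 2 + τ * I) - ℓ x) * ((1 / 2 + τ * I) + 2)))) := by
    refine Measurable.stronglyMeasurable ?_
    exact (hφ.comp measurable_snd).mul
      ((Continuous.measurable (by fun_prop)).div (Continuous.measurable (by fun_prop)))
  exact (h1.aestronglyMeasurable.mul (h2.integral_prod_right (ν := μ)).aestronglyMeasurable)

/-! ### Decay inputs: `𝓛₁` on vertical lines, `1/ζ` on `Re s = 5/4`, the functional equation -/

/-- For `g ∈ 𝓛₁` and a line `σ ≠ 1`: `‖G(σ+iy)‖ ≤ C/(1+y²)²`. [cite: Burnol2004b, §4 Definition of 𝓛₁ (arXiv:math/0203120v7 p. 10, TeX l.899–906)] -/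
theorem exists_norm_line_le_sq {g : Lp ℂ 2 (volume : Measure ℝ)} (hg : g ∈ burnolScriptL1)
    {σ : ℝ} (hσ : σ ≠ 1) : ∃ C : ℝ, 0 ≤ C ∧ ∀ y : ℝ, ‖rightMellinExt g (σ + y * I)‖ ≤ C / (1 + y ^ 2) ^ 2 := by
  obtain ⟨C₄, hC₄⟩ := hg.2 σ σ 4
  -- continuity on the compact piece `|y| ≤ 1`
  have hcont : Continuous fun y : ℝ ↦ rightMellinExt g (σ + y * I) := by
    refine continuous_iff_continuousAt.2 fun y ↦ ?_
    have hne : (σ : ℂ) + y * I ≠ 1 := fun h ↦ hσ (by simpa using congrArg Complex.re h)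
    exact (BurnolResidueSum.differentiableAt_rightMellinExt hg.1 hne).continuousAt.comp
      (f := fun y : ℝ ↦ (σ : ℂ) + y * I) (x := y) (by fun_prop)
  obtain ⟨C₀, hC₀⟩ : ∃ C₀, ∀ y ∈ Icc (-1 : ℝ) 1, ‖rightMellinExt g (σ + y * I)‖ ≤ C₀ :=
    isCompact_Icc.exists_bound_of_continuousOn hcont.continuousOn
  refine ⟨4 * max C₄ 0 + 4 * max C₀ 0, by positivity, fun y ↦ ?_⟩
  have hy2 : 0 < (1 + y ^ 2) ^ 2 := by positivity
  rw [le_div_iff₀ hy2]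
  by_cases hy : 1 ≤ |y|
  · have h := hC₄ (σ + y * I) (by simp) (by simp) (by simpa using hy)
    have hy0 : 0 < |y| := by linarith
    have hn : |y| ≤ ‖(σ : ℂ) + y * I‖ := by simpa using abs_im_le_norm ((σ : ℂ) + y * I)
    have hpow : ‖(σ : ℂ) + y * I‖ ^ (-((4 : ℕ) : ℝ)) ≤ |y| ^ (-((4 : ℕ) : ℝ)) :=
      Real.rpow_le_rpow_of_nonpos hy0 hn (by norm_num)
    have hy4 : |y| ^ (-((4 : ℕ) : ℝ)) = (y ^ 4)⁻¹ := by
      rw [Real.rpow_neg (abs_nonneg _), Real.rpow_natCast, Even.pow_abs ⟨2, rfl⟩]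
    have hbd : ‖rightMellinExt g (σ + y * I)‖ ≤ max C₄ 0 * (y ^ 4)⁻¹ := by
      calc ‖rightMellinExt g (σ + y * I)‖ ≤ C₄ * ‖(σ : ℂ) + y * I‖ ^ (-((4 : ℕ) : ℝ)) := h
        _ ≤ max C₄ 0 * ‖(σ : ℂ) + y * I‖ ^ (-((4 : ℕ) : ℝ)) := by gcongr; exact le_max_left _ _
        _ ≤ max C₄ 0 * |y| ^ (-((4 : ℕ) : ℝ)) := mul_le_mul_of_nonneg_left hpow (le_max_right _ _)
        _ = max C₄ 0 * (y ^ 4)⁻¹ := by rw [hy4]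
    have hysq : 1 ≤ y ^ 2 := by nlinarith [abs_nonneg y, sq_abs y]
    have h14 : (1 : ℝ) ≤ y ^ 4 := by nlinarith [hysq, sq_nonneg (y ^ 2 - 1)]
    have hy4pos : 0 < y ^ 4 := by linarith
    have hkey : (1 + y ^ 2) ^ 2 ≤ 4 * y ^ 4 := by nlinarith
    have hyne : y ≠ 0 := fun h0 ↦ by simp [h0] at hy0
    calc ‖rightMellinExt g (σ + y * I)‖ * (1 + y ^ 2) ^ 2 ≤ max C₄ 0 * (y ^ 4)⁻¹ * (4 * y ^ 4) := by
          gcongr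
      _ = 4 * max C₄ 0 := by field_simp
      _ ≤ 4 * max C₄ 0 + 4 * max C₀ 0 := by linarith [le_max_right C₀ 0]
  · have hy' : |y| ≤ 1 := le_of_lt (not_le.1 hy)
    have h := hC₀ y (abs_le.1 hy')
    have hysq : y ^ 2 ≤ 1 := by nlinarith [abs_nonneg y, sq_abs y]
    have hkey : (1 + y ^ 2) ^ 2 ≤ 4 := by nlinarith
    calc ‖rightMellinExt g (σ + y * I)‖ * (1 + y ^ 2) ^ 2 ≤ max C₀ 0 * 4 := by
          gcongr; exact h.trans (le_max_left _ _)
      _ ≤ 4 * max C₄ 0 + 4 * max C₀ 0 := by linarith [le_max_right C₄ 0]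

/-- `‖1/ζ(s)‖ ≤ Σ_k k^{−Re s}` for `Re s > 1` (Möbius series). [folklore] -/
private theorem norm_inv_zeta_le_tsum {s : ℂ} (hs : 1 < s.re) :
    ‖(riemannZeta s)⁻¹‖ ≤ ∑' k : ℕ, (k : ℝ) ^ (-s.re) := by
  have h := LSeries_one_mul_Lseries_moebius hs
  rw [LSeries_one_eq_riemannZeta hs] at h
  rw [inv_eq_of_mul_eq_one_right h, LSeries]
  have hsum : Summable fun k : ℕ ↦ (k : ℝ) ^ (-s.re) := Real.summable_nat_rpow.2 (by linarith)
  have hle : ∀ k : ℕ, ‖LSeries.term (fun n : ℕ ↦ ((ArithmeticFunction.moebius n : ℤ) : ℂ)) s k‖ ≤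
      (k : ℝ) ^ (-s.re) := by
    intro k
    rw [LSeries.norm_term_eq]
    split_ifs with hk
    · exact Real.rpow_nonneg (Nat.cast_nonneg k) _
    · have h1 : ‖((ArithmeticFunction.moebius k : ℤ) : ℂ)‖ ≤ 1 := by
        rw [Complex.norm_intCast]
        exact_mod_cast ArithmeticFunction.abs_moebius_le_one
      have hk0 : (0 : ℝ) < k := Nat.cast_pos.2 (Nat.pos_of_ne_zero hk)
      calc ‖((ArithmeticFunction.moebius k : ℤ) : ℂ)‖ / (k : ℝ) ^ s.re ≤ 1 / (k : ℝ) ^ s.re := by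
            gcongr
        _ = (k : ℝ) ^ (-s.re) := by rw [Real.rpow_neg hk0.le, one_div]
  exact (norm_tsum_le_tsum_norm (hsum.of_nonneg_of_le (fun k ↦ norm_nonneg _) hle)).trans
    (Summable.tsum_le_tsum hle (hsum.of_nonneg_of_le (fun k ↦ norm_nonneg _) hle) hsum)

/-- **`G(s)/ζ(s) = H(1−s)/ζ(1−s)` on `Re s = −¼`**, `H = G_{𝓕g}` (functional equations of `ζ` and of
`L_1`). [cite: Burnol2004b, proof of Thm. 5.2 (arXiv:math/0203120v7 p. 12, TeX l.1030–1034)] -/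
theorem div_zeta_neg_quarter_line {g : Lp ℂ 2 (volume : Measure ℝ)} (hg : g ∈ sonineL 1) (t : ℝ) :
    rightMellinExt g ((-1 / 4 : ℝ) + t * I) / riemannZeta ((-1 / 4 : ℝ) + t * I) =
      rightMellinExt (𝓕 g : Lp ℂ 2 (volume : Measure ℝ)) ((5 / 4 : ℝ) + ((-t : ℝ) : ℂ) * I) /
        riemannZeta ((5 / 4 : ℝ) + ((-t : ℝ) : ℂ) * I) := by
  set s : ℂ := (-1 / 4 : ℝ) + t * I with hsdef
  set u : ℂ := (5 / 4 : ℝ) + ((-t : ℝ) : ℂ) * I with hudef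
  have hus : 1 - u = s := by rw [hsdef, hudef]; push_cast; ring
  have hu0 : ∀ n : ℕ, u ≠ -2 * (n : ℂ) := by
    intro n h
    have := congrArg Complex.re h
    simp [hudef] at this
    have : (0 : ℝ) ≤ n := n.cast_nonneg
    linarith
  have hu1 : ∀ n : ℕ, u ≠ 1 + 2 * (n : ℂ) := by
    intro n h
    have := congrArg Complex.re h
    simp [hudef] at this
    have h3 : (8 * n : ℝ) = 1 := by linarith
    norm_cast at h3
    omega
  have hFE := SonineLContinuation.rightMellinExt_functionalEquation_of_mem_sonineL one_pos hg u hu0 hu1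
  rw [hus] at hFE
  have hs0 : s ≠ 0 := fun h ↦ by
    have := congrArg Complex.re h; simp [hsdef] at this
  have hu0' : u ≠ 0 := fun h ↦ by
    have := congrArg Complex.re h; simp [hudef] at this
  have hΛ : completedRiemannZeta s = completedRiemannZeta u := by
    rw [← hus]; exact completedRiemannZeta_one_sub u
  rw [riemannZeta_def_of_ne_zero hs0, riemannZeta_def_of_ne_zero hu0', div_div_eq_mul_div,
    div_div_eq_mul_div, hΛ, mul_comm (rightMellinExt (𝓕 g : Lp ℂ 2 (volume : Measure ℝ)) u), hFE,
    mul_comm]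

/-- **Tails of `G` on the critical line in `L²`**: there is a finite constant `K` with
`‖𝟙_{|τ| ≥ R} G(½+iτ)‖_{L²(dτ)} ≤ R^{−5/4}·K` for `R ≥ 1` (from `‖G(½+iτ)‖ ≤ C/(1+τ²)`, the quick decrease
of `g ∈ 𝓛₁`). [cite: Burnol2004b, §4 Definition of 𝓛₁ (arXiv:math/0203120v7 p. 10, TeX l.899–906)] -/
theorem exists_eLpNorm_indicator_line_le {g : Lp ℂ 2 (volume : Measure ℝ)} (hg : g ∈ burnolScriptL1) :
    ∃ K : ℝ≥0∞, K < ∞ ∧ ∀ R : ℝ, 1 ≤ R →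
      eLpNorm ({τ : ℝ | R ≤ |τ|}.indicator fun τ : ℝ ↦ rightMellinExt g (1 / 2 + τ * I)) 2 volume ≤
        ENNReal.ofReal (R ^ (-(5 / 4 : ℝ))) * K := by
  obtain ⟨C, hC⟩ := BurnolResidueSum.exists_norm_line_le_of_mem_scriptL1 hg (σ := 1 / 2) (by norm_num)
  have hC0 : 0 ≤ C := by
    have := (norm_nonneg _).trans (hC 0)
    simpa using this
  -- the comparison function `h(τ) = 2C (1+|τ|)^{-3/4}`
  set h : ℝ → ℂ := fun τ ↦ ((2 * C * (1 + |τ|) ^ (-(3 / 4 : ℝ)) : ℝ) : ℂ) with hh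
  have hhm : MemLp h 2 volume := by
    refine memLp_two_of_continuous_of_decay (C := 2 * C) ?_ fun τ ↦ ?_
    · rw [hh]
      refine Complex.continuous_ofReal.comp (continuous_const.mul ?_)
      exact Continuous.rpow_const (by fun_prop) fun τ ↦ Or.inl (by positivity)
    · rw [hh]; simp only [Complex.norm_real, Real.norm_eq_abs]
      rw [abs_of_nonneg (by positivity)]
  refine ⟨eLpNorm h 2 volume, hhm.eLpNorm_lt_top, fun R hR ↦ ?_⟩
  have hpt : ∀ τ : ℝ, ‖{τ : ℝ | R ≤ |τ|}.indicator (fun τ : ℝ ↦ rightMellinExt g (1 / 2 + τ * I)) τ‖ ≤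
      ‖(R ^ (-(5 / 4 : ℝ)) : ℝ) • h τ‖ := by
    intro τ
    by_cases hτ : τ ∈ {τ : ℝ | R ≤ |τ|}
    · rw [Set.indicator_of_mem hτ]
      have hRτ : R ≤ |τ| := hτ
      have hτ1 : 1 ≤ |τ| := hR.trans hRτ
      have hτ0 : 0 < |τ| := by linarith
      have h1 := hC τ
      have e1 : (((1 : ℝ) / 2 : ℝ) : ℂ) + τ * I = 1 / 2 + τ * I := by push_cast; ring
      rw [e1] at h1
      rw [norm_smul, hh]
      simp only [Complex.norm_real, Real.norm_eq_abs]
      rw [abs_of_nonneg (by positivity), abs_of_nonneg (by positivity)]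
      -- `C/(1+τ²) ≤ R^{-5/4} · 2C (1+|τ|)^{-3/4}`
      have hA : (1 : ℝ) + τ ^ 2 ≥ |τ| ^ (5 / 4 : ℝ) * (1 + |τ|) ^ (3 / 4 : ℝ) / 2 := by
        have h2 : (1 + |τ|) ^ (3 / 4 : ℝ) ≤ (2 * |τ|) ^ (3 / 4 : ℝ) :=
          Real.rpow_le_rpow (by positivity) (by linarith) (by norm_num)
        have h3 : (2 * |τ|) ^ (3 / 4 : ℝ) = 2 ^ (3 / 4 : ℝ) * |τ| ^ (3 / 4 : ℝ) :=
          Real.mul_rpow (by norm_num) hτ0.le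
        have h4 : (2 : ℝ) ^ (3 / 4 : ℝ) ≤ 2 := by
          have := Real.rpow_le_rpow_of_exponent_le (by norm_num : (1 : ℝ) ≤ 2) (by norm_num : (3 / 4 : ℝ) ≤ 1)
          rwa [Real.rpow_one] at this
        have h5 : |τ| ^ (5 / 4 : ℝ) * |τ| ^ (3 / 4 : ℝ) = τ ^ 2 := by
          rw [← Real.rpow_add hτ0]; norm_num [sq_abs]
        have h6 : 0 ≤ |τ| ^ (5 / 4 : ℝ) := by positivity
        have h7 : 0 ≤ |τ| ^ (3 / 4 : ℝ) := by positivity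
        calc |τ| ^ (5 / 4 : ℝ) * (1 + |τ|) ^ (3 / 4 : ℝ) / 2 ≤ |τ| ^ (5 / 4 : ℝ) * (2 * |τ| ^ (3 / 4 : ℝ)) / 2 := by
              gcongr; exact h2.trans (by rw [h3]; gcongr)
          _ = τ ^ 2 := by rw [← h5]; ring
          _ ≤ 1 + τ ^ 2 := by linarith
      have hR5 : R ^ (-(5 / 4 : ℝ)) ≥ |τ| ^ (-(5 / 4 : ℝ)) :=
        Real.rpow_le_rpow_of_nonpos (by linarith) hRτ (by norm_num)
      have hpos1 : 0 < (1 + |τ|) ^ (3 / 4 : ℝ) := by positivity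
      have hpos2 : 0 < |τ| ^ (5 / 4 : ℝ) := by positivity
      calc ‖rightMellinExt g (1 / 2 + τ * I)‖ ≤ C / (1 + τ ^ 2) := h1
        _ ≤ C / (|τ| ^ (5 / 4 : ℝ) * (1 + |τ|) ^ (3 / 4 : ℝ) / 2) := by
            apply div_le_div_of_nonneg_left hC0 (by positivity) hA
        _ = |τ| ^ (-(5 / 4 : ℝ)) * (2 * C * (1 + |τ|) ^ (-(3 / 4 : ℝ))) := by
            rw [Real.rpow_neg hτ0.le, Real.rpow_neg (by positivity)]
            field_simp
        _ ≤ R ^ (-(5 / 4 : ℝ)) * (2 * C * (1 + |τ|) ^ (-(3 / 4 : ℝ))) := by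
            gcongr
    · rw [Set.indicator_of_notMem hτ, norm_zero]; positivity
  calc eLpNorm ({τ : ℝ | R ≤ |τ|}.indicator fun τ : ℝ ↦ rightMellinExt g (1 / 2 + τ * I)) 2 volume
      ≤ eLpNorm ((R ^ (-(5 / 4 : ℝ)) : ℝ) • h) 2 volume := eLpNorm_mono_ae (ae_of_all _ hpt)
    _ = ENNReal.ofReal (R ^ (-(5 / 4 : ℝ))) * eLpNorm h 2 volume := by
        rw [eLpNorm_const_smul, Real.enorm_eq_ofReal (by positivity)]

/-! ## §E. Assembly on the critical line -/

section Assembly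

variable {A : ℝ} {T : ℕ → ℝ} {g : Lp ℂ 2 (volume : Measure ℝ)}

/-- `ζ(½ + iτ) ≠ 0` for a.e. `τ` (the zeros on the line are countable). [folklore] -/
private theorem ae_zeta_line_ne_zero : ∀ᵐ τ : ℝ, riemannZeta (1 / 2 + τ * I) ≠ 0 := by
  set S : Set ℝ := {τ : ℝ | riemannZeta (1 / 2 + τ * I) = 0} with hS
  have hcount : S.Countable := by
    have hsub : S ⊆ ⋃ N : ℕ, {τ : ℝ | riemannZeta (1 / 2 + τ * I) = 0 ∧ |τ| ≤ N} := by
      intro τ hτ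
      obtain ⟨N, hN⟩ := exists_nat_ge |τ|
      exact Set.mem_iUnion.2 ⟨N, hτ, hN⟩
    refine Set.Countable.mono hsub (Set.countable_iUnion fun N ↦ Set.Finite.countable ?_)
    have hfin := ((isCompact_Icc (a := (1 / 2 : ℝ)) (b := 1 / 2)).reProdIm
      (isCompact_Icc (a := -(N : ℝ)) (b := N))).inter_riemannZetaZeros_finite
    have hinj : Set.InjOn (fun τ : ℝ ↦ (1 / 2 + τ * I : ℂ)) Set.univ := by
      intro a _ b _ h
      have := congrArg Complex.im h
      simpa using this
    refine (hfin.preimage (hinj.mono (Set.subset_univ _))).subset ?_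
    intro τ hτ
    refine ⟨Complex.mem_reProdIm.2 ⟨?_, ?_⟩, hτ.1⟩
    · simp
    · simpa [abs_le] using hτ.2
  have h0 : volume S = 0 := hcount.measure_zero volume
  filter_upwards [measure_eq_zero_iff_ae_notMem.1 h0] with τ hτ
  exact hτ

/-- `|τ| ≠ c` for a.e. `τ`. [folklore] -/
private theorem ae_abs_ne (c : ℝ) : ∀ᵐ τ : ℝ, |τ| ≠ c := by
  have h0 : volume ({c, -c} : Set ℝ) = 0 := (Set.toFinite _).measure_zero volume
  filter_upwards [measure_eq_zero_iff_ae_notMem.1 h0] with τ hτ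
  intro h
  apply hτ
  rcases abs_eq_abs.1 (h.trans (abs_of_nonneg (h ▸ abs_nonneg τ)).symm) with h' | h'
  · exact Or.inl h'
  · exact Or.inr h'

/-- `G(½ + iτ) ∈ L²(dτ)` for `g ∈ 𝓛₁`. [cite: Burnol2004b, §4 Definition of 𝓛₁ (arXiv:math/0203120v7 p. 10, TeX l.899–906)] -/
theorem memLp_G_line (hg : g ∈ burnolScriptL1) :
    MemLp (fun τ : ℝ ↦ rightMellinExt g (1 / 2 + τ * I)) 2 volume := by
  obtain ⟨C, hC⟩ := BurnolResidueSum.exists_norm_line_le_of_mem_scriptL1 hg (σ := 1 / 2) (by norm_num)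
  have hC0 : 0 ≤ C := by
    have := (norm_nonneg _).trans (hC 0); simpa using this
  have hcont : Continuous fun τ : ℝ ↦ rightMellinExt g (1 / 2 + τ * I) := by
    refine continuous_iff_continuousAt.2 fun τ ↦ ?_
    have hne : (1 / 2 + τ * I : ℂ) ≠ 1 := fun h ↦ by
      have := congrArg Complex.re h; norm_num at this
    exact (BurnolResidueSum.differentiableAt_rightMellinExt hg.1 hne).continuousAt.comp
      (f := fun τ : ℝ ↦ (1 / 2 + τ * I : ℂ)) (x := τ) (by fun_prop)
  refine memLp_two_of_continuous_of_decay hcont (C := 2 * C) fun τ ↦ ?_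
  have h1 := hC τ
  have e1 : (((1 : ℝ) / 2 : ℝ) : ℂ) + τ * I = 1 / 2 + τ * I := by push_cast; ring
  rw [e1] at h1
  have hpos : 0 < 1 + |τ| := by positivity
  have hτ2 : 1 + |τ| ≤ 2 * (1 + τ ^ 2) := by nlinarith [abs_nonneg τ, sq_abs τ]
  have hr : (1 + |τ|) ^ (-(3 / 4 : ℝ)) ≥ (1 + |τ|)⁻¹ := by
    rw [← Real.rpow_neg_one]
    exact Real.rpow_le_rpow_of_exponent_le (by linarith [abs_nonneg τ]) (by norm_num)
  calc ‖rightMellinExt g (1 / 2 + τ * I)‖ ≤ C / (1 + τ ^ 2) := h1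
    _ ≤ 2 * C * (1 + |τ|)⁻¹ := by
        rw [div_le_iff₀ (by positivity)]
        calc C = 2 * C * (1 + |τ|)⁻¹ * ((1 + |τ|) / 2) := by field_simp
          _ ≤ 2 * C * (1 + |τ|)⁻¹ * (1 + τ ^ 2) := by gcongr; linarith
    _ ≤ 2 * C * (1 + |τ|) ^ (-(3 / 4 : ℝ)) := by gcongr

/-- The right edge integrand `y ↦ G(5/4+iy)/ζ(5/4+iy)` is continuous with
`‖·‖(4+|y|)²` integrable. [cite: Burnol2004b, proof of Thm. 5.2 (arXiv:math/0203120v7 p. 12, TeX l.1035–1045)] -/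
theorem right_edge_props (hg : g ∈ burnolScriptL1) :
    Continuous (fun y : ℝ ↦ rightMellinExt g ((5 / 4 : ℝ) + y * I) / riemannZeta ((5 / 4 : ℝ) + y * I)) ∧
      Integrable (fun y : ℝ ↦ ‖rightMellinExt g ((5 / 4 : ℝ) + y * I) / riemannZeta ((5 / 4 : ℝ) + y * I)‖ *
        (4 + |y|) ^ 2) := by
  have hre : ∀ y : ℝ, 1 < (((5 / 4 : ℝ) : ℂ) + y * I).re := fun y ↦ by simp; norm_num
  have hne1 : ∀ y : ℝ, (((5 / 4 : ℝ) : ℂ) + y * I) ≠ 1 := fun y h ↦ by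
    have := congrArg Complex.re h; simp at this; norm_num at this
  have hζ0 : ∀ y : ℝ, riemannZeta (((5 / 4 : ℝ) : ℂ) + y * I) ≠ 0 := fun y ↦
    riemannZeta_ne_zero_of_one_lt_re (hre y)
  have hcont : Continuous (fun y : ℝ ↦ rightMellinExt g ((5 / 4 : ℝ) + y * I) /
      riemannZeta ((5 / 4 : ℝ) + y * I)) := by
    refine continuous_iff_continuousAt.2 fun y ↦ ?_
    have hline : ContinuousAt (fun y : ℝ ↦ (((5 / 4 : ℝ) : ℂ) + y * I)) y := by fun_prop
    exact ((BurnolResidueSum.differentiableAt_rightMellinExt hg.1 (hne1 y)).continuousAt.comp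
      (f := fun y : ℝ ↦ (((5 / 4 : ℝ) : ℂ) + y * I)) (x := y) hline).div
      ((differentiableAt_riemannZeta (hne1 y)).continuousAt.comp
        (f := fun y : ℝ ↦ (((5 / 4 : ℝ) : ℂ) + y * I)) (x := y) hline) (hζ0 y)
  refine ⟨hcont, ?_⟩
  obtain ⟨C, hC0, hC⟩ := exists_norm_line_le_sq hg (σ := 5 / 4) (by norm_num)
  set B : ℝ := ∑' k : ℕ, (k : ℝ) ^ (-(5 / 4 : ℝ)) with hB
  have hB0 : 0 ≤ B := tsum_nonneg fun k ↦ Real.rpow_nonneg (Nat.cast_nonneg k) _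
  refine Integrable.mono' ((integrable_inv_one_add_sq.const_mul (32 * B * C))) ?_ ?_
  · exact (hcont.norm.mul (by fun_prop)).aestronglyMeasurable
  · refine ae_of_all _ fun y ↦ ?_
    rw [Real.norm_eq_abs, abs_of_nonneg (by positivity), norm_div]
    have hζ := norm_inv_zeta_le_tsum (hre y)
    have hre' : (((5 / 4 : ℝ) : ℂ) + y * I).re = 5 / 4 := by simp
    rw [hre'] at hζ
    have hG := hC y
    have h4 : (4 + |y|) ^ 2 ≤ 32 * (1 + y ^ 2) := by nlinarith [abs_nonneg y, sq_abs y]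
    have hpos : 0 < 1 + y ^ 2 := by positivity
    calc ‖rightMellinExt g ((5 / 4 : ℝ) + y * I)‖ / ‖riemannZeta ((5 / 4 : ℝ) + y * I)‖ * (4 + |y|) ^ 2
        = ‖rightMellinExt g ((5 / 4 : ℝ) + y * I)‖ * ‖(riemannZeta ((5 / 4 : ℝ) + y * I))⁻¹‖ *
            (4 + |y|) ^ 2 := by rw [norm_inv, div_eq_mul_inv]
      _ ≤ (C / (1 + y ^ 2) ^ 2) * B * (32 * (1 + y ^ 2)) := by gcongr
      _ = 32 * B * C * (1 + y ^ 2)⁻¹ := by field_simp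
      _ = 32 * B * C * (1 + y ^ 2)⁻¹ := rfl

/-- The left edge integrand: by the functional equation `G(s)/ζ(s) = H(1−s)/ζ(1−s)` it is
`y ↦ H(5/4−iy)/ζ(5/4−iy)` (`H = G_{𝓕g}`, `𝓕g ∈ 𝓛₁` by Lemma 4.10), continuous with `‖·‖(4+|y|)²`
integrable. [cite: Burnol2004b, Lemma 4.10 and proof of Thm. 5.2 (arXiv:math/0203120v7 pp. 11–12, TeX l.947–951, 1030–1034)] -/
theorem left_edge_props (hg : g ∈ burnolScriptL1) :
    (∀ y : ℝ, rightMellinExt g ((-1 / 4 : ℝ) + y * I) / riemannZeta ((-1 / 4 : ℝ) + y * I) =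
      rightMellinExt (𝓕 g : Lp ℂ 2 (volume : Measure ℝ)) ((5 / 4 : ℝ) + (-y) * I) /
        riemannZeta ((5 / 4 : ℝ) + (-y) * I)) ∧
    Continuous (fun y : ℝ ↦ rightMellinExt g ((-1 / 4 : ℝ) + y * I) / riemannZeta ((-1 / 4 : ℝ) + y * I)) ∧
      Integrable (fun y : ℝ ↦ ‖rightMellinExt g ((-1 / 4 : ℝ) + y * I) / riemannZeta ((-1 / 4 : ℝ) + y * I)‖ *
        (4 + |y|) ^ 2) := by
  have hFg : (𝓕 g : Lp ℂ 2 (volume : Measure ℝ)) ∈ burnolScriptL1 := Burnol2004b_lemma4_10_holds g hg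
  have hfe : ∀ y : ℝ, rightMellinExt g ((-1 / 4 : ℝ) + y * I) / riemannZeta ((-1 / 4 : ℝ) + y * I) =
      rightMellinExt (𝓕 g : Lp ℂ 2 (volume : Measure ℝ)) ((5 / 4 : ℝ) + (-y) * I) /
        riemannZeta ((5 / 4 : ℝ) + (-y) * I) := by
    intro y
    have h := div_zeta_neg_quarter_line hg.1 y
    push_cast at h ⊢
    exact h
  obtain ⟨hc, hi⟩ := right_edge_props hFg
  refine ⟨hfe, ?_, ?_⟩
  · have : (fun y : ℝ ↦ rightMellinExt g ((-1 / 4 : ℝ) + y * I) / riemannZeta ((-1 / 4 : ℝ) + y * I)) =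
        (fun y : ℝ ↦ rightMellinExt (𝓕 g : Lp ℂ 2 (volume : Measure ℝ)) ((5 / 4 : ℝ) + y * I) /
          riemannZeta ((5 / 4 : ℝ) + y * I)) ∘ fun y : ℝ ↦ -y := by
      funext y; simp only [Function.comp, hfe y]; push_cast; ring_nf
    rw [this]; exact hc.comp continuous_neg
  · have h := hi.comp_neg
    refine h.congr (ae_of_all _ fun y ↦ ?_)
    simp only [hfe y, abs_neg]
    push_cast; ring_nf

/-- Horizontal edges: the integrand `x ↦ G(x+iy)/ζ(x+iy)` is measurable, and bounded on
`[−¼, 5/4]` at a height `|y| = T_n` of the Prop-5.1 sequence (no zero there). [cite: Burnol2004b, Prop. 5.1 (arXiv:math/0203120v7 p. 11)] -/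
theorem horizontal_edge_props (hT : IsInvZetaHeightSeq A T) (hg : g ∈ sonineL 1) (n : ℕ) {y : ℝ}
    (hy : |y| = T n) :
    Measurable (fun x : ℝ ↦ rightMellinExt g (x + y * I) / riemannZeta (x + y * I)) ∧
      ∃ M : ℝ, 0 ≤ M ∧ ∀ x ∈ Ioc (-1 / 4 : ℝ) (5 / 4),
        ‖rightMellinExt g (x + y * I) / riemannZeta (x + y * I)‖ ≤ M := by
  have hTpos : 0 < T n := lt_of_le_of_lt (Nat.cast_nonneg n) (hT.2.1 n)
  refine ⟨((measurable_rightMellinExt hg).comp (by fun_prop)).div (measurable_zeta.comp (by fun_prop)), ?_⟩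
  have hcont : ContinuousOn (fun x : ℝ ↦ rightMellinExt g (x + y * I) / riemannZeta (x + y * I))
      (Icc (-1 / 4 : ℝ) (5 / 4)) := by
    intro x hx
    have hs1 : (x : ℂ) + y * I ≠ 1 := fun h ↦ by
      have := congrArg Complex.im h; simp at this
      rw [this, abs_zero] at hy; exact hTpos.ne' hy.symm |>.elim
    have hζ : riemannZeta (x + y * I) ≠ 0 :=
      BurnolResidueSum.zeta_ne_zero_of_isInvZetaHeightSeq hT n (by simpa using hy)
        (by simp; linarith [hx.1])
    have hline : ContinuousAt (fun x : ℝ ↦ ((x : ℂ) + y * I)) x := by fun_prop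
    exact (((BurnolResidueSum.differentiableAt_rightMellinExt hg hs1).continuousAt.comp
      (f := fun x : ℝ ↦ ((x : ℂ) + y * I)) (x := x) hline).div
      ((differentiableAt_riemannZeta hs1).continuousAt.comp
        (f := fun x : ℝ ↦ ((x : ℂ) + y * I)) (x := x) hline) hζ).continuousWithinAt
  obtain ⟨M, hM⟩ := isCompact_Icc.exists_bound_of_continuousOn hcont
  exact ⟨max M 0, le_max_right _ _, fun x hx ↦ (hM x (Ioc_subset_Icc_self hx)).trans (le_max_left _ _)⟩

/-- **The partial sums on the critical line, as an a.e. identity in `τ`** (four boundary integrals,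
the Prop-5.4 coefficient, and the inside/outside indicator).
[cite: Burnol2004b, proof of Thm. 5.2 (arXiv:math/0203120v7 pp. 12–13, TeX l.1012–1029, 1060–1075)] -/
theorem partialSum_ae_eq (hT : IsInvZetaHeightSeq A T) (hg : g ∈ sonineL 1) (n : ℕ) :
    (fun τ : ℝ ↦ burnolResiduePartialSum (rightMellinExt g) T n (1 / 2 + τ * I)) =ᵐ[volume] fun τ ↦
      riemannZeta (1 / 2 + τ * I) * (2 * Real.pi * I)⁻¹ *
        ((∫ x in (-1 / 4 : ℝ)..(5 / 4), rightMellinExt g (x + ↑(-T n) * I) / riemannZeta (x + ↑(-T n) * I) *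
            ((2 + (x + ↑(-T n) * I)) / (((1 / 2 + τ * I) - (x + ↑(-T n) * I)) * ((1 / 2 + τ * I) + 2)))) -
          (∫ x in (-1 / 4 : ℝ)..(5 / 4), rightMellinExt g (x + ↑(T n) * I) / riemannZeta (x + ↑(T n) * I) *
            ((2 + (x + ↑(T n) * I)) / (((1 / 2 + τ * I) - (x + ↑(T n) * I)) * ((1 / 2 + τ * I) + 2)))) +
          I * (∫ y in (-T n)..(T n), rightMellinExt g (↑(5 / 4 : ℝ) + y * I) / riemannZeta (↑(5 / 4 : ℝ) + y * I) *
            ((2 + (↑(5 / 4 : ℝ) + y * I)) / (((1 / 2 + τ * I) - (↑(5 / 4 : ℝ) + y * I)) * ((1 / 2 + τ * I) + 2)))) -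
          I * (∫ y in (-T n)..(T n), rightMellinExt g (↑(-1 / 4 : ℝ) + y * I) / riemannZeta (↑(-1 / 4 : ℝ) + y * I) *
            ((2 + (↑(-1 / 4 : ℝ) + y * I)) / (((1 / 2 + τ * I) - (↑(-1 / 4 : ℝ) + y * I)) * ((1 / 2 + τ * I) + 2))))) +
      burnolInvZetaResiduePartialSum (rightMellinExt g) T n *
        (riemannZeta (1 / 2 + τ * I) / ((1 / 2 + τ * I) + 2)) +
      {τ : ℝ | |τ| < T n}.indicator (fun τ : ℝ ↦ rightMellinExt g (1 / 2 + τ * I)) τ := by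
  filter_upwards [ae_zeta_line_ne_zero, ae_abs_ne (T n)] with τ hζ hτ
  rw [partialSum_line_eq hT hg n hζ hτ, rectBoundaryIntegral_def]
  by_cases h : |τ| < T n
  · rw [Set.indicator_of_mem (show τ ∈ {τ : ℝ | |τ| < T n} from h), if_pos h]
  · rw [Set.indicator_of_notMem (show τ ∉ {τ : ℝ | |τ| < T n} from h), if_neg h]

/-! ### Conjunct (2): the partial sums are square integrable on the line -/

/-- The right-hand side pieces are in `L²`: horizontal edges. [cite: Burnol2004b, proof of Thm. 5.2 (arXiv:math/0203120v7 p. 13)] -/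
theorem memLp_horizontal {φ : ℝ → ℂ} (hφ : Measurable φ) {M : ℝ} (hM : 0 ≤ M)
    (hφM : ∀ x ∈ Ioc (-1 / 4 : ℝ) (5 / 4), ‖φ x‖ ≤ M) (y : ℝ) :
    MemLp (fun τ : ℝ ↦ riemannZeta (1 / 2 + τ * I) *
      ∫ x in (-1 / 4 : ℝ)..(5 / 4), φ x *
        ((2 + (x + y * I)) / (((1 / 2 + τ * I) - (x + y * I)) * ((1 / 2 + τ * I) + 2)))) 2 volume := by
  refine ⟨?_, lt_of_le_of_lt (eLpNorm_horizontal_le hM hφM y)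
    (ENNReal.mul_lt_top ENNReal.ofReal_lt_top weight_lt_top)⟩
  have h := aestronglyMeasurable_zeta_mul_integral hφ (ℓ := fun x : ℝ ↦ ((x : ℂ) + y * I)) (by fun_prop)
    (volume.restrict (Ioc (-1 / 4 : ℝ) (5 / 4)))
  refine h.congr (ae_of_all _ fun τ ↦ ?_)
  simp only
  rw [intervalIntegral.integral_of_le (by norm_num)]

/-- The right-hand side pieces are in `L²`: vertical edges over a bounded height range.
[cite: Burnol2004b, proof of Thm. 5.2 (arXiv:math/0203120v7 p. 13)] -/
theorem memLp_vertical {φ : ℝ → ℂ} (hφc : Continuous φ) {x₀ : ℝ} (hx₀ : 3 / 4 ≤ |1 / 2 - x₀|)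
    (hx₀' : |x₀| ≤ 2) {c d : ℝ} (hcd : c ≤ d) :
    MemLp (fun τ : ℝ ↦ riemannZeta (1 / 2 + τ * I) *
      ∫ y in c..d, φ y *
        ((2 + (x₀ + y * I)) / (((1 / 2 + τ * I) - (x₀ + y * I)) * ((1 / 2 + τ * I) + 2)))) 2 volume := by
  have hint : IntegrableOn (fun y ↦ ‖φ y‖ * (4 + |y|) ^ 2) (Ioc c d) := by
    refine ((hφc.norm.mul (by fun_prop)).continuousOn.integrableOn_compact isCompact_Icc).mono_set
      Ioc_subset_Icc_self
  refine ⟨?_, ?_⟩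
  · have h := aestronglyMeasurable_zeta_mul_integral hφc.measurable
      (ℓ := fun y : ℝ ↦ ((x₀ : ℂ) + y * I)) (by fun_prop) (volume.restrict (Ioc c d))
    refine h.congr (ae_of_all _ fun τ ↦ ?_)
    simp only
    rw [intervalIntegral.integral_of_le hcd]
  · have h := eLpNorm_vertical_le hφc.measurable hx₀ hx₀' measurableSet_Ioc hint
    have heq : eLpNorm (fun τ : ℝ ↦ riemannZeta (1 / 2 + τ * I) *
        ∫ y in c..d, φ y *
          ((2 + (x₀ + y * I)) / (((1 / 2 + τ * I) - (x₀ + y * I)) * ((1 / 2 + τ * I) + 2)))) 2 volume =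
        eLpNorm (fun τ : ℝ ↦ riemannZeta (1 / 2 + τ * I) *
        ∫ y in Ioc c d, φ y *
          ((2 + (x₀ + y * I)) / (((1 / 2 + τ * I) - (x₀ + y * I)) * ((1 / 2 + τ * I) + 2)))) 2 volume :=
      eLpNorm_congr_ae (ae_of_all _ fun τ ↦ by simp only; rw [intervalIntegral.integral_of_le hcd])
    rw [heq]
    exact h.trans_lt ENNReal.ofReal_lt_top

/-- **Conjunct (2) of Thm. 5.2: every partial sum is square integrable on the critical line.**
[cite: Burnol2004b, Thm. 5.2 (arXiv:math/0203120v7 p. 12, TeX l.989–1000)] -/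
theorem memLp_partialSum (hT : IsInvZetaHeightSeq A T) (hg : g ∈ burnolScriptL1) (n : ℕ) :
    MemLp (fun τ : ℝ ↦ burnolResiduePartialSum (rightMellinExt g) T n (1 / 2 + τ * I)) 2 volume := by
  have hTpos : 0 < T n := lt_of_le_of_lt (Nat.cast_nonneg n) (hT.2.1 n)
  obtain ⟨hmb, Mb, hMb0, hMb⟩ := horizontal_edge_props hT hg.1 n (y := -T n) (by rw [abs_neg, abs_of_pos hTpos])
  obtain ⟨hmt, Mt, hMt0, hMt⟩ := horizontal_edge_props hT hg.1 n (y := T n) (abs_of_pos hTpos)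
  obtain ⟨hrc, -⟩ := right_edge_props hg
  obtain ⟨-, hlc, -⟩ := left_edge_props hg
  have h1 := memLp_horizontal hmb hMb0 hMb (-T n)
  have h2 := memLp_horizontal hmt hMt0 hMt (T n)
  have h3 := memLp_vertical hrc (x₀ := 5 / 4) (by norm_num) (by norm_num [abs_of_pos]) (c := -T n) (d := T n)
    (by linarith)
  have h4 := memLp_vertical hlc (x₀ := -1 / 4) (by norm_num) (by norm_num [abs_of_neg, abs_of_pos])
    (c := -T n) (d := T n) (by linarith)
  have h5 := (memLp_zeta_div_line).const_mul (burnolInvZetaResiduePartialSum (rightMellinExt g) T n)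
  have h6 : MemLp ({τ : ℝ | |τ| < T n}.indicator fun τ : ℝ ↦ rightMellinExt g (1 / 2 + τ * I)) 2 volume :=
    MemLp.indicator (measurableSet_lt continuous_abs.measurable measurable_const) (memLp_G_line hg)
  have hsum : MemLp (fun τ : ℝ ↦ (2 * Real.pi * I)⁻¹ * ((fun τ : ℝ ↦ riemannZeta (1 / 2 + τ * I) *
      ∫ x in (-1 / 4 : ℝ)..(5 / 4), rightMellinExt g (x + ↑(-T n) * I) / riemannZeta (x + ↑(-T n) * I) *
        ((2 + (x + ↑(-T n) * I)) / (((1 / 2 + τ * I) - (x + ↑(-T n) * I)) * ((1 / 2 + τ * I) + 2)))) τ -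
      (fun τ : ℝ ↦ riemannZeta (1 / 2 + τ * I) *
      ∫ x in (-1 / 4 : ℝ)..(5 / 4), rightMellinExt g (x + ↑(T n) * I) / riemannZeta (x + ↑(T n) * I) *
        ((2 + (x + ↑(T n) * I)) / (((1 / 2 + τ * I) - (x + ↑(T n) * I)) * ((1 / 2 + τ * I) + 2)))) τ +
      I * (fun τ : ℝ ↦ riemannZeta (1 / 2 + τ * I) *
      ∫ y in (-T n)..(T n), rightMellinExt g (↑(5 / 4 : ℝ) + y * I) / riemannZeta (↑(5 / 4 : ℝ) + y * I) *
        ((2 + (↑(5 / 4 : ℝ) + y * I)) / (((1 / 2 + τ * I) - (↑(5 / 4 : ℝ) + y * I)) * ((1 / 2 + τ * I) + 2)))) τ -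
      I * (fun τ : ℝ ↦ riemannZeta (1 / 2 + τ * I) *
      ∫ y in (-T n)..(T n), rightMellinExt g (↑(-1 / 4 : ℝ) + y * I) / riemannZeta (↑(-1 / 4 : ℝ) + y * I) *
        ((2 + (↑(-1 / 4 : ℝ) + y * I)) / (((1 / 2 + τ * I) - (↑(-1 / 4 : ℝ) + y * I)) * ((1 / 2 + τ * I) + 2)))) τ) +
      (fun τ : ℝ ↦ burnolInvZetaResiduePartialSum (rightMellinExt g) T n *
        (riemannZeta (1 / 2 + τ * I) / ((1 / 2 + τ * I) + 2))) τ +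
      {τ : ℝ | |τ| < T n}.indicator (fun τ : ℝ ↦ rightMellinExt g (1 / 2 + τ * I)) τ) 2 volume :=
    (((((h1.sub h2).add (h3.const_mul I)).sub (h4.const_mul I)).const_mul _).add h5).add h6
  refine (hsum.ae_eq ?_)
  filter_upwards [partialSum_ae_eq hT hg.1 n] with τ hτ
  rw [hτ]
  ring


/-! ### Conjunct (3): the `L²` block norms are summable -/

/-- Triangle inequality for three summands. [folklore] -/
private theorem eLpNorm_add_three_le {f g h : ℝ → ℂ} (hf : AEStronglyMeasurable f volume)
    (hg : AEStronglyMeasurable g volume) (hh : AEStronglyMeasurable h volume) :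
    eLpNorm (f + g + h) 2 volume ≤ eLpNorm f 2 volume + eLpNorm g 2 volume + eLpNorm h 2 volume :=
  (eLpNorm_add_le (hf.add hg) hh one_le_two).trans
    (add_le_add (eLpNorm_add_le hf hg one_le_two) le_rfl)

/-- Triangle inequality for `a − b + c − d`. [folklore] -/
private theorem eLpNorm_sub_add_sub_le {a b c d : ℝ → ℂ} (ha : AEStronglyMeasurable a volume)
    (hb : AEStronglyMeasurable b volume) (hc : AEStronglyMeasurable c volume)
    (hd : AEStronglyMeasurable d volume) :
    eLpNorm (a - b + c - d) 2 volume ≤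
      eLpNorm a 2 volume + eLpNorm b 2 volume + eLpNorm c 2 volume + eLpNorm d 2 volume := by
  calc eLpNorm (a - b + c - d) 2 volume ≤ eLpNorm (a - b + c) 2 volume + eLpNorm d 2 volume :=
        eLpNorm_sub_le ((ha.sub hb).add hc) hd one_le_two
    _ ≤ eLpNorm (a - b) 2 volume + eLpNorm c 2 volume + eLpNorm d 2 volume :=
        add_le_add (eLpNorm_add_le (ha.sub hb) hc one_le_two) le_rfl
    _ ≤ eLpNorm a 2 volume + eLpNorm b 2 volume + eLpNorm c 2 volume + eLpNorm d 2 volume :=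
        add_le_add (add_le_add (eLpNorm_sub_le ha hb one_le_two) le_rfl) le_rfl

/-- **Horizontal decay at the heights `T_n`, `n ≥ 1`**: `‖G(x ± iT_n)/ζ(x ± iT_n)‖ ≤ C·T_n^{−3}` on
`[−¼, 5/4]` (quick decrease of `G` and `|1/ζ| < |s|^A` on the good lines).
[cite: Burnol2004b, Prop. 5.1 and proof of Thm. 5.2 (arXiv:math/0203120v7 pp. 11–12, TeX l.959–962, 1019–1022)] -/
theorem exists_horizontal_decay (hT : IsInvZetaHeightSeq A T) (hg : g ∈ burnolScriptL1) :
    ∃ C : ℝ, 0 ≤ C ∧ ∀ n : ℕ, 1 ≤ n → ∀ x ∈ Ioc (-1 / 4 : ℝ) (5 / 4), ∀ y : ℝ, |y| = T n →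
      ‖rightMellinExt g (x + y * I) / riemannZeta (x + y * I)‖ ≤ C * (T n) ^ (-(3 : ℝ)) := by
  set N : ℕ := ⌈A⌉₊ + 3 with hN
  obtain ⟨CN, hCN⟩ := hg.2 (-1) 2 N
  have hAN : A - N ≤ -3 := by
    have := Nat.le_ceil A
    rw [hN]; push_cast; linarith
  refine ⟨max CN 0, le_max_right _ _, fun n hn x hx y hy ↦ ?_⟩
  have hTpos : 0 < T n := lt_of_le_of_lt (Nat.cast_nonneg n) (hT.2.1 n)
  have hTn1 : 1 ≤ T n := by
    have h1 := hT.2.1 n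
    have h2 : (1 : ℝ) ≤ n := by exact_mod_cast hn
    linarith
  set s : ℂ := x + y * I with hs
  have hsre : s.re = x := by simp [hs]
  have hsim : s.im = y := by simp [hs]
  have hx1 : -1 ≤ x := by linarith [hx.1]
  have hx2 : x ≤ 2 := by linarith [hx.2]
  have hζ := hT.2.2 n s (by rw [hsim]; exact hy) (by rw [hsre]; exact hx1) (by rw [hsre]; exact hx2)
  have hGs := hCN s (by rw [hsre]; exact hx1) (by rw [hsre]; exact hx2) (by rw [hsim, hy]; exact hTn1)
  have hTle : T n ≤ ‖s‖ := by rw [← hy, ← hsim]; exact abs_im_le_norm s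
  have hs1 : 1 ≤ ‖s‖ := hTn1.trans hTle
  have hs0 : 0 < ‖s‖ := by linarith
  calc ‖rightMellinExt g s / riemannZeta s‖ = ‖rightMellinExt g s‖ * ‖riemannZeta s‖⁻¹ := by
        rw [norm_div, div_eq_mul_inv]
    _ ≤ (max CN 0 * ‖s‖ ^ (-(N : ℝ))) * ‖s‖ ^ A :=
        mul_le_mul (hGs.trans (by gcongr; exact le_max_left _ _)) hζ.le (inv_nonneg.2 (norm_nonneg _))
          (by positivity)
    _ = max CN 0 * ‖s‖ ^ (A - N) := by rw [mul_assoc, ← Real.rpow_add hs0]; ring_nf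
    _ ≤ max CN 0 * ‖s‖ ^ (-(3 : ℝ)) :=
        mul_le_mul_of_nonneg_left (Real.rpow_le_rpow_of_exponent_le hs1 hAN) (le_max_right _ _)
    _ ≤ max CN 0 * (T n) ^ (-(3 : ℝ)) :=
        mul_le_mul_of_nonneg_left (Real.rpow_le_rpow_of_nonpos hTpos hTle (by norm_num)) (le_max_right _ _)

/-- Summability of a telescoping sequence of a monotone bounded sequence. [folklore] -/
private theorem summable_sub_of_monotone_bounded {a : ℕ → ℝ} (hmono : Monotone a) {B : ℝ} (hB : ∀ n, a n ≤ B) :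
    Summable fun n ↦ a (n + 1) - a n := by
  refine summable_of_sum_range_le (c := B - a 0) (fun n ↦ sub_nonneg.2 (hmono (Nat.le_succ n))) fun n ↦ ?_
  rw [Finset.sum_range_sub]
  linarith [hB n]

/-- The vertical-edge integrand `y ↦ φ(y)(2+s)/((Z−s)(Z+2))`, `s = x₀+iy`, `x₀ ≠ ½`, is continuous.
[folklore] -/
private theorem continuous_vertical_integrand {φ : ℝ → ℂ} (hφ : Continuous φ) {x₀ : ℝ} (hx₀ : x₀ ≠ 1 / 2)
    (τ : ℝ) : Continuous fun y : ℝ ↦ φ y *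
      ((2 + (x₀ + y * I)) / (((1 / 2 + τ * I) - (x₀ + y * I)) * ((1 / 2 + τ * I) + 2))) := by
  refine hφ.mul (Continuous.div (by fun_prop) (by fun_prop) fun y h ↦ ?_)
  rcases mul_eq_zero.1 h with h | h
  · have := congrArg Complex.re h
    simp at this
    exact hx₀ (by linarith)
  · have := congrArg Complex.re h
    norm_num at this

/-- **A vertical block in `L²`**: for `φ` continuous with `‖φ‖(4+|y|)²` integrable and `x₀ ∈ {−¼, 5/4}`-type
abscissa, `‖ζ·(∫_{−T'}^{T'} − ∫_{−T}^{T}) φκ‖_{L²} ≤ √(192π)·(e(T') − e(T))`, `e(T) = ∫_{−T}^{T}‖φ‖(4+|y|)²`.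
[cite: Burnol2004b, proof of Thm. 5.2 (arXiv:math/0203120v7 p. 13, TeX l.1106–1120)] -/
theorem eLpNorm_vertical_block_le {φ : ℝ → ℂ} (hφ : Continuous φ)
    (hint : Integrable fun y : ℝ ↦ ‖φ y‖ * (4 + |y|) ^ 2) {x₀ : ℝ} (hx₀ : 3 / 4 ≤ |1 / 2 - x₀|)
    (hx₀' : |x₀| ≤ 2) {c d : ℝ} (hc : 0 ≤ c) (hcd : c ≤ d) :
    eLpNorm (fun τ : ℝ ↦ (riemannZeta (1 / 2 + τ * I) * ∫ y in (-d)..d, φ y *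
        ((2 + (x₀ + y * I)) / (((1 / 2 + τ * I) - (x₀ + y * I)) * ((1 / 2 + τ * I) + 2)))) -
      (riemannZeta (1 / 2 + τ * I) * ∫ y in (-c)..c, φ y *
        ((2 + (x₀ + y * I)) / (((1 / 2 + τ * I) - (x₀ + y * I)) * ((1 / 2 + τ * I) + 2))))) 2 volume ≤
      ENNReal.ofReal (Real.sqrt (192 * π) * ((∫ y in Ioc (-d) d, ‖φ y‖ * (4 + |y|) ^ 2) -
        ∫ y in Ioc (-c) c, ‖φ y‖ * (4 + |y|) ^ 2)) := by
  have hx₀ne : x₀ ≠ 1 / 2 := by intro h; rw [h] at hx₀; norm_num at hx₀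
  set S : Set ℝ := Ioc (-d) d \ Ioc (-c) c with hS
  have hSm : MeasurableSet S := measurableSet_Ioc.diff measurableSet_Ioc
  have heq : (fun τ : ℝ ↦ (riemannZeta (1 / 2 + τ * I) * ∫ y in (-d)..d, φ y *
        ((2 + (x₀ + y * I)) / (((1 / 2 + τ * I) - (x₀ + y * I)) * ((1 / 2 + τ * I) + 2)))) -
      (riemannZeta (1 / 2 + τ * I) * ∫ y in (-c)..c, φ y *
        ((2 + (x₀ + y * I)) / (((1 / 2 + τ * I) - (x₀ + y * I)) * ((1 / 2 + τ * I) + 2))))) =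
      fun τ : ℝ ↦ riemannZeta (1 / 2 + τ * I) * ∫ y in S, φ y *
        ((2 + (x₀ + y * I)) / (((1 / 2 + τ * I) - (x₀ + y * I)) * ((1 / 2 + τ * I) + 2))) := by
    funext τ
    rw [← mul_sub, intervalIntegral.integral_of_le (by linarith), intervalIntegral.integral_of_le (by linarith),
      ← setIntegral_sdiff measurableSet_Ioc _ (Ioc_subset_Ioc (by linarith) hcd)]
    exact ((continuous_vertical_integrand hφ hx₀ne τ).continuousOn.integrableOn_compact
      isCompact_Icc).mono_set Ioc_subset_Icc_self
  rw [heq]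
  have hintS : IntegrableOn (fun y ↦ ‖φ y‖ * (4 + |y|) ^ 2) S := hint.integrableOn
  refine (eLpNorm_vertical_le hφ.measurable hx₀ hx₀' hSm hintS).trans (le_of_eq ?_)
  congr 2
  rw [hS, setIntegral_sdiff measurableSet_Ioc hint.integrableOn (Ioc_subset_Ioc (by linarith) hcd)]

/-- Indicator blocks: `‖𝟙_{|τ|<T'}G − 𝟙_{|τ|<T}G‖_{L²} ≤ ‖𝟙_{|τ|≥T}G‖_{L²}` for `T ≤ T'`. [folklore] -/
private theorem eLpNorm_indicator_block_le (Gl : ℝ → ℂ) {c d : ℝ} (hcd : c ≤ d) :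
    eLpNorm ({τ : ℝ | |τ| < d}.indicator Gl - {τ : ℝ | |τ| < c}.indicator Gl) 2 volume ≤
      eLpNorm ({τ : ℝ | c ≤ |τ|}.indicator Gl) 2 volume := by
  refine eLpNorm_mono_ae (ae_of_all _ fun τ ↦ ?_)
  simp only [Pi.sub_apply]
  by_cases h1 : |τ| < c
  · have h2 : |τ| < d := lt_of_lt_of_le h1 hcd
    rw [Set.indicator_of_mem (show τ ∈ {τ : ℝ | |τ| < d} from h2),
      Set.indicator_of_mem (show τ ∈ {τ : ℝ | |τ| < c} from h1), sub_self, norm_zero]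
    exact norm_nonneg _
  · rw [Set.indicator_of_notMem (show τ ∉ {τ : ℝ | |τ| < c} from h1), sub_zero,
      Set.indicator_of_mem (show τ ∈ {τ : ℝ | c ≤ |τ|} from not_lt.1 h1)]
    by_cases h2 : |τ| < d
    · rw [Set.indicator_of_mem (show τ ∈ {τ : ℝ | |τ| < d} from h2)]
    · rw [Set.indicator_of_notMem (show τ ∉ {τ : ℝ | |τ| < d} from h2), norm_zero]
      exact norm_nonneg _

/-- Monotonicity of `T ↦ ∫_{(−T, T]} ψ` for `ψ ≥ 0` integrable. [folklore] -/
private theorem setIntegral_Ioc_symm_mono {ψ : ℝ → ℝ} (hψ : Integrable ψ) (hψ0 : ∀ y, 0 ≤ ψ y) {c d : ℝ}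
    (hcd : c ≤ d) : ∫ y in Ioc (-c) c, ψ y ≤ ∫ y in Ioc (-d) d, ψ y :=
  setIntegral_mono_set hψ.integrableOn (ae_of_all _ hψ0)
    (Ioc_subset_Ioc (neg_le_neg hcd) hcd).eventuallyLE

/-- `∑ (n+1)^{-p}`-type sums in `ℝ≥0∞` are finite for `p > 1`. [folklore] -/
private theorem tsum_ofReal_rpow_succ_ne_top {p : ℝ} (hp : 1 < p) (K : ℝ) :
    ∑' n : ℕ, ENNReal.ofReal (K * ((n : ℝ) + 1) ^ (-p)) ≠ ∞ := by
  by_cases hK : 0 ≤ K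
  · have hs : Summable fun n : ℕ ↦ K * ((n : ℝ) + 1) ^ (-p) := by
      have h := (summable_nat_add_iff 1).2 (Real.summable_nat_rpow.2 (by linarith : -p < -1))
      refine (h.mul_left K).congr fun n ↦ ?_
      push_cast; ring_nf
    rw [← ENNReal.ofReal_tsum_of_nonneg (fun n ↦ by positivity) hs]
    exact ENNReal.ofReal_ne_top
  · have : (fun n : ℕ ↦ ENNReal.ofReal (K * ((n : ℝ) + 1) ^ (-p))) = fun _ ↦ 0 := by
      funext n
      rw [ENNReal.ofReal_eq_zero]
      exact mul_nonpos_of_nonpos_of_nonneg (le_of_lt (not_le.1 hK)) (by positivity)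
    rw [this, tsum_zero]; exact ENNReal.zero_ne_top

set_option maxHeartbeats 1600000 in
/-- **Conjunct (3) of Thm. 5.2 in `ℝ≥0∞` form: `Σ_n ‖S_{n+1} − S_n‖_{L²(½+iℝ)} < ∞`** ("it will be
enough to prove it to be absolutely convergent in `L²`").
[cite: Burnol2004b, Thm. 5.2 and its proof (arXiv:math/0203120v7 pp. 12–13, TeX l.989–1000, 1052–1120)] -/
theorem tsum_eLpNorm_sub_ne_top (hT : IsInvZetaHeightSeq A T) (hg : g ∈ burnolScriptL1) :
    ∑' n : ℕ, eLpNorm (fun τ : ℝ ↦ burnolResiduePartialSum (rightMellinExt g) T (n + 1) (1 / 2 + τ * I) -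
        burnolResiduePartialSum (rightMellinExt g) T n (1 / 2 + τ * I)) 2 volume ≠ ∞ := by
  classical
  have hTpos : ∀ n, 0 < T n := fun n ↦ lt_of_le_of_lt (Nat.cast_nonneg n) (hT.2.1 n)
  have hTmono : Monotone T := hT.1.monotone
  have hTn : ∀ n : ℕ, (n : ℝ) < T n := hT.2.1
  -- the pieces
  set G : ℂ → ℂ := rightMellinExt g with hGdef
  set F : ℂ → ℂ := fun s ↦ G s / riemannZeta s with hFdef
  set Hh : ℝ → ℝ → ℂ := fun y τ ↦ riemannZeta (1 / 2 + τ * I) *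
    ∫ x in (-1 / 4 : ℝ)..(5 / 4), F (x + y * I) *
      ((2 + (x + y * I)) / (((1 / 2 + τ * I) - (x + y * I)) * ((1 / 2 + τ * I) + 2))) with hHh
  set Vv : ℝ → ℝ → ℝ → ℂ := fun x₀ d τ ↦ riemannZeta (1 / 2 + τ * I) *
    ∫ y in (-d)..d, F (x₀ + y * I) *
      ((2 + (x₀ + y * I)) / (((1 / 2 + τ * I) - (x₀ + y * I)) * ((1 / 2 + τ * I) + 2))) with hVv
  set cc : ℕ → ℂ := fun n ↦ burnolInvZetaResiduePartialSum G T n with hcc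
  set zd : ℝ → ℂ := fun τ ↦ riemannZeta (1 / 2 + τ * I) / ((1 / 2 + τ * I) + 2) with hzd
  set Gl : ℝ → ℂ := fun τ ↦ G (1 / 2 + τ * I) with hGl
  set Ind : ℕ → ℝ → ℂ := fun n ↦ {τ : ℝ | |τ| < T n}.indicator Gl with hInd
  set RHS : ℕ → ℝ → ℂ := fun n τ ↦ (2 * Real.pi * I)⁻¹ * (Hh (-T n) τ - Hh (T n) τ +
      I * Vv (5 / 4) (T n) τ - I * Vv (-1 / 4) (T n) τ) + cc n * zd τ + Ind n τ with hRHS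
  have hae : ∀ n, (fun τ : ℝ ↦ burnolResiduePartialSum G T n (1 / 2 + τ * I)) =ᵐ[volume] RHS n := by
    intro n
    filter_upwards [partialSum_ae_eq hT hg.1 n] with τ hτ
    rw [hτ, hRHS]
    simp only [hHh, hVv, hcc, hzd, hInd, hGl, hFdef, hGdef]
    push_cast
    ring
  -- measurability and finiteness of the pieces
  obtain ⟨hRc, hRi⟩ := right_edge_props hg
  obtain ⟨-, hLc, hLi⟩ := left_edge_props hg
  have hHm : ∀ y, AEStronglyMeasurable (Hh y) volume := by
    intro y
    have hφm : Measurable fun x : ℝ ↦ F (x + y * I) :=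
      ((measurable_rightMellinExt hg.1).comp (by fun_prop)).div (measurable_zeta.comp (by fun_prop))
    have h := aestronglyMeasurable_zeta_mul_integral hφm (ℓ := fun x : ℝ ↦ ((x : ℂ) + y * I)) (by fun_prop)
      (volume.restrict (Ioc (-1 / 4 : ℝ) (5 / 4)))
    refine h.congr (ae_of_all _ fun τ ↦ ?_)
    simp only [hHh]
    rw [intervalIntegral.integral_of_le (by norm_num)]
  have hVm : ∀ (x₀ d : ℝ), Continuous (fun y : ℝ ↦ F (x₀ + y * I)) → 0 ≤ d →
      AEStronglyMeasurable (Vv x₀ d) volume := by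
    intro x₀ d hφ hd
    have h := aestronglyMeasurable_zeta_mul_integral hφ.measurable (ℓ := fun y : ℝ ↦ ((x₀ : ℂ) + y * I))
      (by fun_prop) (volume.restrict (Ioc (-d) d))
    refine h.congr (ae_of_all _ fun τ ↦ ?_)
    simp only [hVv]
    rw [intervalIntegral.integral_of_le (by linarith)]
  have hRc' : Continuous fun y : ℝ ↦ F ((5 / 4 : ℝ) + y * I) := hRc
  have hLc' : Continuous fun y : ℝ ↦ F ((-1 / 4 : ℝ) + y * I) := hLc
  have hzdm : MemLp zd 2 volume := memLp_zeta_div_line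
  have hGlm : MemLp Gl 2 volume := memLp_G_line hg
  have hIndm : ∀ n, AEStronglyMeasurable (Ind n) volume := fun n ↦
    (hGlm.indicator (measurableSet_lt continuous_abs.measurable measurable_const)).1
  -- constants
  obtain ⟨Ch, hCh0, hCh⟩ := exists_horizontal_decay hT hg
  obtain ⟨K, hKtop, hK⟩ := exists_eLpNorm_indicator_line_le hg
  set W : ℝ≥0∞ := ∫⁻ x in Icc (-1 / 4 : ℝ) (5 / 4), ENNReal.ofReal (|x - 1 / 2| ^ (-(1 / 2 : ℝ))) with hW
  have hWtop : W ≠ ∞ := weight_lt_top.ne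
  set eR : ℕ → ℝ := fun m ↦ ∫ y in Ioc (-T m) (T m), ‖F ((5 / 4 : ℝ) + y * I)‖ * (4 + |y|) ^ 2 with heR
  set eL : ℕ → ℝ := fun m ↦ ∫ y in Ioc (-T m) (T m), ‖F ((-1 / 4 : ℝ) + y * I)‖ * (4 + |y|) ^ 2 with heL
  -- bounds for the pieces, block index `m ≥ 1`
  have hHb : ∀ m : ℕ, 1 ≤ m → ∀ y : ℝ, |y| = T m →
      eLpNorm (Hh y) 2 volume ≤ ENNReal.ofReal (60 * Real.sqrt π * Ch * (m : ℝ) ^ (-(2 : ℝ))) * W := by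
    intro m hm y hy
    have hTm1 : 1 ≤ T m := by
      have h1 := hTn m
      have h2 : (1 : ℝ) ≤ m := Nat.one_le_cast.2 hm
      linarith
    have hM0 : 0 ≤ Ch * (T m) ^ (-(3 : ℝ)) := by positivity
    have h := eLpNorm_horizontal_le hM0 (fun x hx ↦ hCh m hm x hx y hy) y
    refine h.trans (mul_le_mul' (ENNReal.ofReal_le_ofReal ?_) le_rfl)
    rw [hy]
    have hm0 : (0 : ℝ) < m := by exact_mod_cast hm
    have h1 : (T m) ^ (-(3 : ℝ)) * (4 + T m) ≤ 5 * (T m) ^ (-(2 : ℝ)) := by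
      rw [show (-(3 : ℝ)) = -(2 : ℝ) + (-1) by norm_num, Real.rpow_add (hTpos m), Real.rpow_neg_one]
      have : (T m)⁻¹ * (4 + T m) ≤ 5 := by
        rw [inv_mul_le_iff₀ (hTpos m)]; linarith
      calc (T m) ^ (-(2 : ℝ)) * (T m)⁻¹ * (4 + T m) = (T m) ^ (-(2 : ℝ)) * ((T m)⁻¹ * (4 + T m)) := by ring
        _ ≤ (T m) ^ (-(2 : ℝ)) * 5 := by gcongr
        _ = _ := by ring
    have h2 : (T m) ^ (-(2 : ℝ)) ≤ (m : ℝ) ^ (-(2 : ℝ)) :=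
      Real.rpow_le_rpow_of_nonpos hm0 (hTn m).le (by norm_num)
    calc 12 * Real.sqrt π * (Ch * (T m) ^ (-(3 : ℝ))) * (4 + T m)
        = 12 * Real.sqrt π * Ch * ((T m) ^ (-(3 : ℝ)) * (4 + T m)) := by ring
      _ ≤ 12 * Real.sqrt π * Ch * (5 * (m : ℝ) ^ (-(2 : ℝ))) :=
          mul_le_mul_of_nonneg_left (h1.trans (mul_le_mul_of_nonneg_left h2 (by norm_num)))
            (by positivity)
      _ = _ := by ring
  have hVb : ∀ (x₀ : ℝ) (e : ℕ → ℝ), (∀ m, e m = ∫ y in Ioc (-T m) (T m), ‖F (x₀ + y * I)‖ * (4 + |y|) ^ 2) →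
      Continuous (fun y : ℝ ↦ F (x₀ + y * I)) →
      Integrable (fun y : ℝ ↦ ‖F (x₀ + y * I)‖ * (4 + |y|) ^ 2) → 3 / 4 ≤ |1 / 2 - x₀| → |x₀| ≤ 2 →
      ∀ m : ℕ, eLpNorm (Vv x₀ (T (m + 1)) - Vv x₀ (T m)) 2 volume ≤
        ENNReal.ofReal (Real.sqrt (192 * π) * (e (m + 1) - e m)) := by
    intro x₀ e he hφ hi hx₀ hx₀' m
    rw [he, he]
    exact eLpNorm_vertical_block_le hφ hi hx₀ hx₀' (hTpos m).le (hTmono (Nat.le_succ m))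
  have hIb : ∀ m : ℕ, 1 ≤ m → eLpNorm (Ind (m + 1) - Ind m) 2 volume ≤
      ENNReal.ofReal ((m : ℝ) ^ (-(5 / 4 : ℝ))) * K := by
    intro m hm
    have hTm1 : 1 ≤ T m := by
      have h1 := hTn m
      have h2 : (1 : ℝ) ≤ m := Nat.one_le_cast.2 hm
      linarith
    have hm0 : (0 : ℝ) < m := by exact_mod_cast hm
    refine (eLpNorm_indicator_block_le Gl (hTmono (Nat.le_succ m))).trans ((hK (T m) hTm1).trans ?_)
    exact mul_le_mul'
      (ENNReal.ofReal_le_ofReal (Real.rpow_le_rpow_of_nonpos hm0 (hTn m).le (by norm_num))) le_rfl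
  have hCb : ∀ m : ℕ, eLpNorm (fun τ ↦ cc (m + 1) * zd τ - cc m * zd τ) 2 volume =
      ‖cc (m + 1) - cc m‖ₑ * eLpNorm zd 2 volume := by
    intro m
    rw [← eLpNorm_const_smul (cc (m + 1) - cc m) zd]
    congr 1
    funext τ
    simp only [Pi.smul_apply, smul_eq_mul]
    ring
  -- the block estimate
  have hblock : ∀ m : ℕ, 1 ≤ m →
      eLpNorm (RHS (m + 1) - RHS m) 2 volume ≤
        ‖(2 * Real.pi * I : ℂ)⁻¹‖ₑ *
          (ENNReal.ofReal (60 * Real.sqrt π * Ch * ((m : ℝ) + 1) ^ (-(2 : ℝ))) * W +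
            ENNReal.ofReal (60 * Real.sqrt π * Ch * (m : ℝ) ^ (-(2 : ℝ))) * W +
            (ENNReal.ofReal (60 * Real.sqrt π * Ch * ((m : ℝ) + 1) ^ (-(2 : ℝ))) * W +
            ENNReal.ofReal (60 * Real.sqrt π * Ch * (m : ℝ) ^ (-(2 : ℝ))) * W) +
            ENNReal.ofReal (Real.sqrt (192 * π) * (eR (m + 1) - eR m)) +
            ENNReal.ofReal (Real.sqrt (192 * π) * (eL (m + 1) - eL m))) +
          ‖cc (m + 1) - cc m‖ₑ * eLpNorm zd 2 volume +
          ENNReal.ofReal ((m : ℝ) ^ (-(5 / 4 : ℝ))) * K := by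
    intro m hm
    have hm1 : 1 ≤ m + 1 := by omega
    -- decompose
    have hdec : RHS (m + 1) - RHS m =
        ((2 * Real.pi * I : ℂ)⁻¹ • (((Hh (-T (m + 1)) - Hh (-T m)) - (Hh (T (m + 1)) - Hh (T m)) +
          I • (Vv (5 / 4) (T (m + 1)) - Vv (5 / 4) (T m)) -
          I • (Vv (-1 / 4) (T (m + 1)) - Vv (-1 / 4) (T m))))) +
        (fun τ ↦ cc (m + 1) * zd τ - cc m * zd τ) + (Ind (m + 1) - Ind m) := by
      funext τ
      simp only [hRHS, Pi.sub_apply, Pi.add_apply, Pi.smul_apply, smul_eq_mul]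
      ring
    rw [hdec]
    have hA1 : AEStronglyMeasurable (Hh (-T (m + 1)) - Hh (-T m)) volume := (hHm _).sub (hHm _)
    have hA2 : AEStronglyMeasurable (Hh (T (m + 1)) - Hh (T m)) volume := (hHm _).sub (hHm _)
    have hA3 : AEStronglyMeasurable (I • (Vv (5 / 4) (T (m + 1)) - Vv (5 / 4) (T m))) volume :=
      ((hVm _ _ hRc' (hTpos _).le).sub (hVm _ _ hRc' (hTpos _).le)).const_smul I
    have hA4 : AEStronglyMeasurable (I • (Vv (-1 / 4) (T (m + 1)) - Vv (-1 / 4) (T m))) volume :=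
      ((hVm _ _ hLc' (hTpos _).le).sub (hVm _ _ hLc' (hTpos _).le)).const_smul I
    have hinner := eLpNorm_sub_add_sub_le hA1 hA2 hA3 hA4
    have hF1m : AEStronglyMeasurable ((2 * Real.pi * I : ℂ)⁻¹ •
        (((Hh (-T (m + 1)) - Hh (-T m)) - (Hh (T (m + 1)) - Hh (T m)) +
          I • (Vv (5 / 4) (T (m + 1)) - Vv (5 / 4) (T m)) -
          I • (Vv (-1 / 4) (T (m + 1)) - Vv (-1 / 4) (T m))))) volume :=
      (((hA1.sub hA2).add hA3).sub hA4).const_smul _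
    have hF2m : AEStronglyMeasurable (fun τ ↦ cc (m + 1) * zd τ - cc m * zd τ) volume :=
      (hzdm.1.const_mul _).sub (hzdm.1.const_mul _)
    have hF3m : AEStronglyMeasurable (Ind (m + 1) - Ind m) volume := (hIndm _).sub (hIndm _)
    refine (eLpNorm_add_three_le hF1m hF2m hF3m).trans ?_
    rw [eLpNorm_const_smul, hCb m]
    have hnI : ‖(I : ℂ)‖ₑ = 1 := by rw [← ofReal_norm, Complex.norm_I, ENNReal.ofReal_one]
    have hsm1 : eLpNorm (I • (Vv (5 / 4) (T (m + 1)) - Vv (5 / 4) (T m))) 2 volume =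
        eLpNorm (Vv (5 / 4) (T (m + 1)) - Vv (5 / 4) (T m)) 2 volume := by
      rw [eLpNorm_const_smul, hnI, one_mul]
    have hsm2 : eLpNorm (I • (Vv (-1 / 4) (T (m + 1)) - Vv (-1 / 4) (T m))) 2 volume =
        eLpNorm (Vv (-1 / 4) (T (m + 1)) - Vv (-1 / 4) (T m)) 2 volume := by
      rw [eLpNorm_const_smul, hnI, one_mul]
    rw [hsm1, hsm2] at hinner
    have hT1 : |(-T (m + 1))| = T (m + 1) := by rw [abs_neg, abs_of_pos (hTpos _)]
    have hT2 : |(-T m)| = T m := by rw [abs_neg, abs_of_pos (hTpos _)]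
    have hb1 := hHb (m + 1) hm1 (-T (m + 1)) hT1
    have hb2 := hHb m hm (-T m) hT2
    have hb3 := hHb (m + 1) hm1 (T (m + 1)) (abs_of_pos (hTpos _))
    have hb4 := hHb m hm (T m) (abs_of_pos (hTpos _))
    have hv1 := hVb (5 / 4) eR (fun m ↦ rfl) hRc' hRi (by norm_num) (by norm_num [abs_of_pos]) m
    have hv2 := hVb (-1 / 4) eL (fun m ↦ rfl) hLc' hLi (by norm_num) (by norm_num [abs_of_neg]) m
    have hi := hIb m hm
    have hh1 : eLpNorm (Hh (-T (m + 1)) - Hh (-T m)) 2 volume ≤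
        ENNReal.ofReal (60 * Real.sqrt π * Ch * ((m : ℝ) + 1) ^ (-(2 : ℝ))) * W +
          ENNReal.ofReal (60 * Real.sqrt π * Ch * (m : ℝ) ^ (-(2 : ℝ))) * W := by
      refine (eLpNorm_sub_le (hHm _) (hHm _) one_le_two).trans ?_
      push_cast at hb1
      exact add_le_add hb1 hb2
    have hh2 : eLpNorm (Hh (T (m + 1)) - Hh (T m)) 2 volume ≤
        ENNReal.ofReal (60 * Real.sqrt π * Ch * ((m : ℝ) + 1) ^ (-(2 : ℝ))) * W +
          ENNReal.ofReal (60 * Real.sqrt π * Ch * (m : ℝ) ^ (-(2 : ℝ))) * W := by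
      refine (eLpNorm_sub_le (hHm _) (hHm _) one_le_two).trans ?_
      push_cast at hb3
      exact add_le_add hb3 hb4
    exact add_le_add (add_le_add (mul_le_mul' le_rfl
      (hinner.trans (add_le_add (add_le_add (add_le_add hh1 hh2) hv1) hv2))) le_rfl) hi
  -- summability of the majorant
  have hmonoR : ∀ m, eR (m + 1) ≤ eR (m + 1 + 1) := fun m ↦
    setIntegral_Ioc_symm_mono hRi (fun y ↦ by positivity) (hTmono (Nat.le_succ (m + 1)))
  have hmonoL : ∀ m, eL (m + 1) ≤ eL (m + 1 + 1) := fun m ↦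
    setIntegral_Ioc_symm_mono hLi (fun y ↦ by positivity) (hTmono (Nat.le_succ (m + 1)))
  have hsumR : Summable fun m : ℕ ↦ eR (m + 1 + 1) - eR (m + 1) :=
    summable_sub_of_monotone_bounded (monotone_nat_of_le_succ hmonoR)
      (B := ∫ y : ℝ, ‖F ((5 / 4 : ℝ) + y * I)‖ * (4 + |y|) ^ 2)
      fun m ↦ setIntegral_le_integral hRi (ae_of_all _ fun y ↦ by positivity)
  have hsumL : Summable fun m : ℕ ↦ eL (m + 1 + 1) - eL (m + 1) :=
    summable_sub_of_monotone_bounded (monotone_nat_of_le_succ hmonoL)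
      (B := ∫ y : ℝ, ‖F ((-1 / 4 : ℝ) + y * I)‖ * (4 + |y|) ^ 2)
      fun m ↦ setIntegral_le_integral hLi (ae_of_all _ fun y ↦ by positivity)
  have hsumC : Summable fun m : ℕ ↦ ‖cc (m + 1 + 1) - cc (m + 1)‖ :=
    (summable_nat_add_iff 1).2 (Burnol2004b_prop5_4_holds A T hT g hg).1
  -- finiteness of the majorant sum
  have hmaj : ∑' m : ℕ, (‖(2 * Real.pi * I : ℂ)⁻¹‖ₑ *
          (ENNReal.ofReal (60 * Real.sqrt π * Ch * (((m + 1 : ℕ) : ℝ) + 1) ^ (-(2 : ℝ))) * W +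
            ENNReal.ofReal (60 * Real.sqrt π * Ch * ((m + 1 : ℕ) : ℝ) ^ (-(2 : ℝ))) * W +
            (ENNReal.ofReal (60 * Real.sqrt π * Ch * (((m + 1 : ℕ) : ℝ) + 1) ^ (-(2 : ℝ))) * W +
            ENNReal.ofReal (60 * Real.sqrt π * Ch * ((m + 1 : ℕ) : ℝ) ^ (-(2 : ℝ))) * W) +
            ENNReal.ofReal (Real.sqrt (192 * π) * (eR (m + 1 + 1) - eR (m + 1))) +
            ENNReal.ofReal (Real.sqrt (192 * π) * (eL (m + 1 + 1) - eL (m + 1)))) +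
          ‖cc (m + 1 + 1) - cc (m + 1)‖ₑ * eLpNorm zd 2 volume +
          ENNReal.ofReal (((m + 1 : ℕ) : ℝ) ^ (-(5 / 4 : ℝ))) * K) ≠ ∞ := by
    have hh : ∑' m : ℕ, ENNReal.ofReal (60 * Real.sqrt π * Ch * ((m + 1 : ℕ) : ℝ) ^ (-(2 : ℝ))) * W ≠ ∞ := by
      rw [ENNReal.tsum_mul_right]
      refine ENNReal.mul_ne_top ?_ hWtop
      have := tsum_ofReal_rpow_succ_ne_top (by norm_num : (1 : ℝ) < 2) (60 * Real.sqrt π * Ch)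
      push_cast at this ⊢
      exact this
    have hh' : ∑' m : ℕ, ENNReal.ofReal (60 * Real.sqrt π * Ch * (((m + 1 : ℕ) : ℝ) + 1) ^ (-(2 : ℝ))) * W ≠ ∞ := by
      rw [ENNReal.tsum_mul_right]
      refine ENNReal.mul_ne_top ?_ hWtop
      have h2 := tsum_ofReal_rpow_succ_ne_top (by norm_num : (1 : ℝ) < 2) (60 * Real.sqrt π * Ch)
      refine ne_top_of_le_ne_top h2 (ENNReal.tsum_le_tsum fun m ↦ ENNReal.ofReal_le_ofReal ?_)
      push_cast
      exact mul_le_mul_of_nonneg_left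
        (Real.rpow_le_rpow_of_nonpos (by positivity) (by linarith) (by norm_num)) (by positivity)
    have hv : ∀ (e : ℕ → ℝ), Summable (fun m : ℕ ↦ e (m + 1 + 1) - e (m + 1)) →
        (∀ m, e (m + 1) ≤ e (m + 1 + 1)) →
        ∑' m : ℕ, ENNReal.ofReal (Real.sqrt (192 * π) * (e (m + 1 + 1) - e (m + 1))) ≠ ∞ := by
      intro e hs hmono
      rw [← ENNReal.ofReal_tsum_of_nonneg (fun m ↦ mul_nonneg (Real.sqrt_nonneg _) (sub_nonneg.2 (hmono m)))
        (hs.mul_left _)]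
      exact ENNReal.ofReal_ne_top
    have hvR := hv eR hsumR hmonoR
    have hvL := hv eL hsumL hmonoL
    have hc : ∑' m : ℕ, ‖cc (m + 1 + 1) - cc (m + 1)‖ₑ * eLpNorm zd 2 volume ≠ ∞ := by
      rw [ENNReal.tsum_mul_right]
      refine ENNReal.mul_ne_top ?_ hzdm.eLpNorm_lt_top.ne
      have : ∑' m : ℕ, ‖cc (m + 1 + 1) - cc (m + 1)‖ₑ =
          ∑' m : ℕ, ENNReal.ofReal ‖cc (m + 1 + 1) - cc (m + 1)‖ := by
        simp_rw [ofReal_norm]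
      rw [this, ← ENNReal.ofReal_tsum_of_nonneg (fun m ↦ norm_nonneg _) hsumC]
      exact ENNReal.ofReal_ne_top
    have hi : ∑' m : ℕ, ENNReal.ofReal (((m + 1 : ℕ) : ℝ) ^ (-(5 / 4 : ℝ))) * K ≠ ∞ := by
      rw [ENNReal.tsum_mul_right]
      refine ENNReal.mul_ne_top ?_ hKtop.ne
      have := tsum_ofReal_rpow_succ_ne_top (by norm_num : (1 : ℝ) < 5 / 4) 1
      push_cast at this ⊢
      simpa using this
    have h2πI : ‖(2 * Real.pi * I : ℂ)⁻¹‖ₑ ≠ ∞ := enorm_ne_top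
    simp only [ENNReal.tsum_add, ENNReal.tsum_mul_left]
    apply_rules [ENNReal.add_ne_top.2, And.intro, ENNReal.mul_ne_top]
  -- conclusion
  have h0 : eLpNorm (fun τ : ℝ ↦ burnolResiduePartialSum G T (0 + 1) (1 / 2 + τ * I) -
      burnolResiduePartialSum G T 0 (1 / 2 + τ * I)) 2 volume ≠ ∞ :=
    ((memLp_partialSum hT hg 1).sub (memLp_partialSum hT hg 0)).eLpNorm_lt_top.ne
  rw [tsum_eq_zero_add' ENNReal.summable]
  refine ENNReal.add_ne_top.2 ⟨h0, ne_top_of_le_ne_top hmaj (ENNReal.tsum_le_tsum fun m ↦ ?_)⟩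
  have heq : eLpNorm (fun τ : ℝ ↦ burnolResiduePartialSum G T (m + 1 + 1) (1 / 2 + τ * I) -
      burnolResiduePartialSum G T (m + 1) (1 / 2 + τ * I)) 2 volume =
      eLpNorm (RHS (m + 1 + 1) - RHS (m + 1)) 2 volume :=
    eLpNorm_congr_ae ((hae (m + 1 + 1)).sub (hae (m + 1)))
  rw [heq]
  have h := hblock (m + 1) (by omega)
  push_cast at h ⊢
  exact h

/-! ### Conjunct (4) from (1) and (3): `L²` convergence to `G` -/

/-- **`L²`-Cauchy + a.e. convergence ⇒ `L²` convergence to the a.e. limit.** [folklore] -/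
private theorem tendsto_eLpNorm_of_tsum_ne_top_of_ae_tendsto {S : ℕ → ℝ → ℂ} {L : ℝ → ℂ}
    (h2 : ∀ n, MemLp (S n) 2 volume)
    (h3 : ∑' n, eLpNorm (S (n + 1) - S n) 2 volume ≠ ∞)
    (h1 : ∀ᵐ τ : ℝ, Tendsto (fun n ↦ S n τ) atTop (𝓝 (L τ))) :
    Tendsto (fun n ↦ eLpNorm (L - S n) 2 volume) atTop (𝓝 0) := by
  set u : ℕ → Lp ℂ 2 (volume : Measure ℝ) := fun n ↦ (h2 n).toLp (S n) with hu
  have hu_ae : ∀ n, (u n : ℝ → ℂ) =ᵐ[volume] S n := fun n ↦ (h2 n).coeFn_toLp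
  have hedist : ∀ n, edist (u n) (u (n + 1)) ≤ eLpNorm (S (n + 1) - S n) 2 volume := by
    intro n
    rw [edist_comm, Lp.edist_def]
    refine le_of_eq (eLpNorm_congr_ae ?_)
    filter_upwards [hu_ae n, hu_ae (n + 1)] with τ h1 h2
    simp only [Pi.sub_apply, h1, h2]
  have hcauchy : CauchySeq u := cauchySeq_of_edist_le_of_tsum_ne_top _ hedist h3
  obtain ⟨Lp_lim, hlim⟩ := cauchySeq_tendsto_of_complete hcauchy
  -- a.e. convergence along a subsequence
  have hmeas := tendstoInMeasure_of_tendsto_Lp hlim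
  obtain ⟨ns, hns, hns_ae⟩ := hmeas.exists_seq_tendsto_ae
  have hall : ∀ᵐ τ : ℝ, ∀ n, (u n : ℝ → ℂ) τ = S n τ := ae_all_iff.2 hu_ae
  have hLae : (Lp_lim : ℝ → ℂ) =ᵐ[volume] L := by
    filter_upwards [hns_ae, hall, h1] with τ hτ hallτ h1τ
    have h1' : Tendsto (fun i ↦ S (ns i) τ) atTop (𝓝 (L τ)) := h1τ.comp hns.tendsto_atTop
    have h2' : Tendsto (fun i ↦ S (ns i) τ) atTop (𝓝 ((Lp_lim : ℝ → ℂ) τ)) := by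
      refine hτ.congr fun i ↦ ?_
      exact hallτ (ns i)
    exact tendsto_nhds_unique h2' h1'
  -- conclusion
  have h := (Lp.tendsto_Lp_iff_tendsto_eLpNorm' u Lp_lim).1 hlim
  refine h.congr fun n ↦ ?_
  rw [eLpNorm_sub_comm]
  refine eLpNorm_congr_ae ?_
  filter_upwards [hu_ae n, hLae] with τ h1 h2
  simp only [Pi.sub_apply, h1, h2]

end Assembly

end BurnolResidueL2

/-! ## The named fact -/

/-- **Burnol 2004b, Thm. 5.2 — DISCHARGED** (all four conjuncts: the pointwise residue expansion is
dbl-t12's `BurnolResidueSum.tendsto_burnolResiduePartialSum`; the `L²(½+iℝ)` clause — square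
integrability of the partial sums, summable block norms, convergence to `G` — is this file).
[cite: Burnol2004b, Thm. 5.2 (arXiv:math/0203120v7 p. 12, TeX l.989–1120)] -/
theorem Burnol2004b_thm5_2_holds : Burnol2004b_thm5_2 := by
  intro A T hT g hg
  refine ⟨fun Z hZ1 hZ0 ↦ BurnolResidueSum.tendsto_burnolResiduePartialSum hT hg hZ1 hZ0,
    fun n ↦ BurnolResidueL2.memLp_partialSum hT hg n,
    ENNReal.summable_toReal (BurnolResidueL2.tsum_eLpNorm_sub_ne_top hT hg), ?_⟩
  have h1 : ∀ᵐ τ : ℝ, Tendsto (fun n ↦ burnolResiduePartialSum (rightMellinExt g) T n (1 / 2 + τ * I))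
      atTop (𝓝 (rightMellinExt g (1 / 2 + τ * I))) := by
    filter_upwards [BurnolResidueL2.ae_zeta_line_ne_zero] with τ hζ
    have hZ1 : (1 / 2 + τ * I : ℂ) ≠ 1 := fun h ↦ by
      have := congrArg Complex.re h; norm_num at this
    exact (BurnolResidueSum.tendsto_burnolResiduePartialSum hT hg hZ1 hζ).2
  exact BurnolResidueL2.tendsto_eLpNorm_of_tsum_ne_top_of_ae_tendsto
    (S := fun n τ ↦ burnolResiduePartialSum (rightMellinExt g) T n (1 / 2 + τ * I))
    (L := fun τ ↦ rightMellinExt g (1 / 2 + τ * I))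
    (fun n ↦ BurnolResidueL2.memLp_partialSum hT hg n) (BurnolResidueL2.tsum_eLpNorm_sub_ne_top hT hg) h1

/-- **Burnol 2004b, Cor. 5.3 — DISCHARGED** through the tree door
`BurnolZetaQuotientCompleteness.Burnol2004b_cor5_3_of` (dbl-iso) from Thm. 5.2 (this file) and Thm. 4.9
(dbl-t1's `Burnol2004b_thm4_9_holds`). [cite: Burnol2004b, Cor. 5.3 (arXiv:math/0203120v7 p. 14, TeX l.1124–1127)] -/
theorem Burnol2004b_cor5_3_holds : Burnol2004b_cor5_3 :=
  BurnolZetaQuotientCompleteness.Burnol2004b_cor5_3_of Burnol2004b_thm5_2_holds Burnol2004b_thm4_9_holds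

/-- **Burnol 2004b, Thm. 3.3 — DISCHARGED** through the tree door
`BurnolZetaMinimal.Burnol2004b_thm3_3_of_cor5_3` (dbl-t6: clauses (i)(ii)(iv)(v)(vi) were tree theorems,
clause (iii) is Cor. 5.3). [cite: Burnol2004b, Thm. 3.3 (arXiv:math/0203120v7 p. 7, TeX l.587–594)] -/
theorem Burnol2004b_thm3_3_holds : Burnol2004b_thm3_3 :=
  BurnolZetaMinimal.Burnol2004b_thm3_3_of_cor5_3 Burnol2004b_cor5_3_holds

end Literature.NumberTheory.LFunctions
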